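import Literature.MathematicalPhysics.QuantumFieldTheory.Balaban1983to89.B9Thm314GFlatV1Kernel
import Literature.MathematicalPhysics.QuantumFieldTheory.Balaban1983to89.B9Thm314PFlatMultiLevelTorus
import Literature.MathematicalPhysics.QuantumFieldTheory.Balaban1983to89.B6Prop26GradKLevelV1

/-!
# `Balaban1983to89.B9Thm314GFlatV1Transfer` — [B9] THEOREM 3.14 (pp. 426–427, (3.154)) AT `U = 1` FOR THE GENUINE `k`-LEVEL
`G = Δ_a⁻¹` ((2.19)/(2.22) of [4]) ON THE V1 TORUS, FILE 2 (TRANSFER / ENGINE / ASSEMBLY): the estimates of the two letters `V_P`, `V_Q` of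
FILE 1 (`B9Thm314GFlatV1Kernel`) between a pair of operators carrying the (2.136)₁ majorants of the two nested families `{Ω_j}`, `{Ω′_j}` on one
torus, the WITNESS CHAIN turning «at least one localization X_i intersects Ωᶜ» into the factor `e^{−½δ·d(y,y′,Ω)}`, the abstract resolvent bound
`|(Gμ)(x) − (G′μ)(x)| ≤ √(2A)·√(ΘL²cA²)·pref(y)·|μ|·e^{−½δ·min(d,d′)(y,y′)}·e^{−¼δ·d(y,y′,Ω)}`, and its ASSEMBLY for `G = Δ_a⁻¹` — the (2.136)₁ and
(2.136)₂ members of Theorem 3.14 (`thm314_G_flat_V1`, `thm314_gradG_flat_V1`) from p38's (2.136)₁,₂ majorants, gen 19's two-family (3.49)₄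
difference and FILE 1 (no existing module is touched; no definition, no fact is minted — theorems only; the planned FILE 3
`B9Thm314GFlatV1MultiLevelTorus` is merged into this file)

FRAMING (verbatim cell line):
statement-level skeleton of published theorems with citation tags; proofs where landed; nothing here is a claim about the Yang–Mills mass gap

Sources under audit (cell pub-balaban / lit-balaban): T. Bałaban, *Propagators for lattice gauge theories in a background field*,
Commun. Math. Phys. **99** (1985) 389–434 [`Balaban1985BackgroundPropagators`, "B9"], pp. 426–427 [PDF 38–39] (Theorem 3.14, (3.154)),
p. 399 [PDF 11] ((3.49)) — held text `paper:balaban1985-cmp99-background-propagators` p0038/p0039 read this generation; T. Bałaban,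
*Propagators and renormalization transformations for lattice gauge theories. II*, Commun. Math. Phys. **96** (1984) 223–250
[`Balaban1984PropagatorsII`, "[4]"], (2.16)–(2.22) pp. 225–226, (2.45)–(2.46) p. 231, Lemma 2.1 (2.60)–(2.62) p. 234, (2.69) p. 235,
(2.88) p. 238, Prop. 2.6 (2.136) p. 247 — held text `paper:balaban1984-cmp96-propagators-rt-ii`; T. Bałaban, *Propagators … I*, Commun.
Math. Phys. **95** (1984) 17–40 [`Balaban1984PropagatorsI`], (1.11) p. 19, (1.18) p. 20 (the iterated bond average `Q_j` and its straight
contours) through the tree's verbatim quotations (`LatticeFieldCalculus`, `B8Prop3MultiLevelTorus`).  Unit `lit-balaban-p21` (Phase-2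
proof seat p21 gen 20, HOME `run/shared/lean/pub/lit-balaban/`, free-target protocol G.5-34(d), TAKING 2026-08-23T16:59Z; B9 fold owner
r06, referee ref-4).

## WHAT IS PRINTED (quotations AS PRINTED)

B9 p. 427 (scan p039): «**Theorem 3.14.** If we take a pair of operators constructed for the two sequences {Ω_j}, {Ω′_j}, then their
difference satisfies all the inequalities characteristic for operators of the considered type, with the additional factor
exp(−δ₀d(y, y′, Ω)), d(y, y′, Ω) = inf_{y₁∈Ωᶜ∩T^{(k)}} (|y − y₁| + |y₁ − y′|) (3.154) on the right-hand sides. This theorem can be proved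
in exactly the same way as the corresponding property in the theorem of [2]. We take random walk expansions for both operators, and in
the difference all terms for walks with localizations contained in Ω are cancelled. Remaining terms correspond to walks of the general
type (3.107), for which at least one localization X_i intersects Ωᶜ. Then the exponential factor in (3.108) gives the factor (3.154)
(after adjusting a definition of δ₀).»  [4] p. 226 (scan p004): «Δ_a = ∂*∂ + ∂R∂* + Q*aQ = Δ − ∂P∂* + Q*aQ, (2.19) … A = G∂Rλ + GQ*ω,
(2.22) where G = Δ_a⁻¹.»; p. 234 (scan p012): «d(y, y′) ≧ RM|j − j′ − 1| ≧ ½RM|j − j′| for |j − j′| ≧ 2 … (2.60) … Lemma 2.1 …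
Σ_{y′∈𝔅} e^{−αδ₀d(y,y′)} ≦ O(1) … (2.61)»; p. 247 (scan p025): «Proposition 2.6. … |(GJ)(x)|, … ≦ O(1)[(L^jη)², …]e^{−δ₃d(y,y′)}|J|
(2.136) for x ∈ Δ(y), y ∈ Λ_j, supp J ⊂ Δ(y′)».

## WHAT THIS FILE CERTIFIES (kernel-checked; V1 torus `B6GlobalChartV1.PV`, families `domT hN D hk` of p21's `TDomains`, block maps `blkV1`)

* §1 the geometry of (3.154) for fine sites against one family: **`tdistK_blk_le_of_top`** (`|y₁ − t| ≤ d(y(z), t) + 1` on `T^{(k)}`),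
  **`tdistK_blk_blk_le_of_dist`**, **`tdistK_blk_blk_le`** (`|z₁ − w₁| ≤ d(y(z), y(w)) + 2`), **`dOmega_le_chain`** (the witness chain
  `d(y,y′,Ω) ≤ |y − β₁| + |β₁ − β₂| + |β₂ − y′|` when `β₁` or `β₂` lies in `Ωᶜ ∩ T^{(k)}`).
* §2 **`dist_tube_le`** — the fine bonds charged by one index bond `(j, c)` lie in `B^j(c₋) ∪ B^j(c₊)`, torus diameter `≤ 2L^k`.
* §3 bookkeeping: **`card_fibre_le`** (`≤ (d+1)W(y)` fine bonds start in a block), **`sum_le_of_fibre_bound`** (the `ℓ¹–ℓ^∞` pairing (2.69) block by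
  block), `sq_mul_pref`, `powLev_sq_le`, `one_le_ratio`, and the two geometric tails.
* §4 the `∂P∂*` letter: **`termCT_le`** ((CT) pairs — both points in `Ω` — through the two-family difference `hΔ`), **`witness_of_not_pairCT`**,
  **`termD_le`**, **`termD'_le`** ((¬CT) pairs — each kernel with the witness chain; in `{Ω′_j}` also the transfer (2.60)), **`abs_VP_apply_le`**
  (the three sums closed by the fibre count and (2.61) in each family:
  `|(V_Pg)(f)| ≤ (d+1)c(C_Δ + C_Pe^{2δ}(1+L²))·A·B·(L^{2k}/L^{2j(p)})·e^{½δd(y,p)}·e^{−½δd(y,y′,Ω)}`).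
* §5 the `Q*aQ` letter after FILE 1's cancellation: **`gprof_tube`**, **`abs_QsE_trunc_le`** (`{Ω_j}`: column mass, coverage `j ≥ j(p)`, the band
  (2.16), the tube witness, `Σ_{j≥j(p)}L^{−2j} ≤ 2L^{−2j(p)}`), **`abs_QsE_trunc'_le`** (`{Ω′_j}`: coverage in `{Ω′_j}` + the transfer (2.60),
  `Σ_{j≤k}L^{2j}/L^{2k} ≤ 2`).
* §6 **`abs_V_apply_le`** (both letters: `Θ = (d+1)c(C_Δ + C_Pe^{2δ}(1+L²)) + 2b₁e^{(5/2)δ}(1+L²)`), **`engine`**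
  (`|(G(V_P+V_Q)g)(x)| ≤ ΘL²cA²·B·pref(y)·e^{−½δd(y,y′,Ω)}` under the majorant of the outer factor — block decomposition
  (`abs_le_sum_of_hasMajorant`), transfer (2.60), sum (2.61)), **`blockSupp_transfer_V1`**, **`trivial_bound_V1`** (the plain-decay half
  `2A·pref(y)·B·e^{−δ·min(d,d′)}`), **`resolvent_diff_bound`** (THE ABSTRACT THEOREM: the geometric mean of the two halves, gen 18's `combined_bound`).
  Inputs BY NAME, restating nothing: FILE 1 (`VP`, `VQ`, `VP_single_apply`, `VQ_apply_eq`, `trunc`/`trunc'`, `qk`, `sum_qk`,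
  `abs_bondAvgIter_le_sum_qk`, `witness_of_not_isCT`/`'`, `IsCT`), gen 18's `B9Thm314GpFlatTorusGeometry` (`tdistK`, `dOmega`, `OmegaC`,
  `blk_mem_OmegaC`, `dOmega_le`, `posT_eq_of_top`, `dist_posT_le_mul_distT`, `cenB`/`cenLab`), `B9Thm314GpFlatResolvent`
  (`abs_le_sum_of_hasMajorant`, `transfer_top`, `blkOf_eq_iff_blkOf_eq`), gen 19's `B9Thm314QGGQInvFlatTransfer` §1 (`tdistK_triangle`,
  `tdistK_comm`, `dOmega_le_tdistK_add`, `dOmega_le_add_tdistK`, `tdistK_le_distT_of_top`), `B9Thm314GpFlatMultiLevelTorus.combined_bound`,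
  r05's `B8Prop3MultiLevelTorus` (`abs_QsE_apply_le`, `iterBlockOf_of_bondAvgIter_single_ne_zero`, `lev_le_of_bondAvgIter_single_ne_zero`, `PV_L`),
  p21's `B6Geom246MultiLevelTorus`/`B8Ineq192MultiLevelTorus` (`dist_toT_le`, `dist_toT_toR`, `dist_site_posT_le`, `triangle_refl_nonneg_T`,
  `symmT`, `triangleTB`), `B6Ineq268MultiLevelBox` (`W`, `card_blkOf_le`), `B6Lemma21Repaired.Ineq261With`, `B6RandomWalk.HasMajorant`,
  `B6Prop26KLevelSkeletonV1.pref`, `B4TorusKernel.MultiPeriod.circAbs`, `B5Eq118OneStroke.val_iterBlockOf`, `B6AgreeQaQV1Chart.sitesPerDir_zero_eq_mul`.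

* §7 the engine with a GENERAL OUTER PREFACTOR `φ` (for the other members of (2.136)): **`engine_gen`**, **`trivial_bound_gen`**,
  **`resolvent_diff_bound_gen`** (`|(Tμ)(x) − (T′μ)(x)| ≤ √(2A′)·√(ΘL²cA′A)·φ(y)·B·e^{−½δ·min(d,d′)}·e^{−¼δ·d(y,y′,Ω)}` for `T − T′ = T(V_P + V_Q)G′`).
* §8 **`thm314_G_flat_V1`** — THEOREM 3.14 AT `U = 1`, THE (2.136)₁ MEMBER FOR `G = Δ_a⁻¹`: there are `δ, C, M₀ > 0`, `N₀ > 0` (on `d, L` and the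
  weight band `[b₀, b₁]` only) such that for every V1 torus (`hN`), every PAIR of p21 torus families `D, D′` on it (`1 ≤ k`, `M_h = L^a ≥ 8`,
  `R ≥ 2L²`, `P_μ ≥ 5L`, `L ≥ 5`, `L·M_h ≥ M₀`, `R·L·M_h ≥ N₀ + 1`), every fine factor `c_f ≠ 0`, positive weights `w, w′` in the global band agreeing
  on the common index bonds, common top blocks `y, y′`, `supp μ ⊂ B(y′)`, `|μ| ≤ B` and fine bonds `x ∈ B(y)`:
  `|(G[Ω]μ)(x) − (G[Ω′]μ)(x)| ≤ C·(L^k/c_f)²·B·e^{−δ·min(d(y,y′), d′(y,y′))}·e^{−δ·d(y,y′,Ω)}`.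
* §9 **`thm314_gradG_flat_V1`** — THE (2.136)₂ MEMBER: under the same hypotheses, for every direction `ν`,
  `|(∇_ν(G[Ω] − G[Ω′])μ)(x)| ≤ C·(L^k·|c_f|⁻¹)·B·e^{−δ·min(d(y,y′), d′(y,y′))}·e^{−δ·d(y,y′,Ω)}` (`∇_ν = B6GradLegKLevelV1.DV ν c_f`).
  Further inputs BY NAME for §8–§9: p38's `B6Prop26GradKLevelV1.prop26_2136_grad_kLevel_unconditional_pad_V1` (both conjuncts, at `α = ½`,
  `σ = σ₁`; rate `delta3 ½ (2σ₁)`); gen 19's `B9Thm314PFlatMultiLevelTorus.thm314_P_flat_multiLevelTorus` member 4 at the printed weights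
  (`B6Prop22KLevelCensus.KIdx.aPrinted_windows`) through FILE 1's `member4_eq_dPd`; FILE 1's `dPd_le`, `onFun_GE_sub`, `w_le_of_band`; gen 18's
  `B9Thm314GpFlatMultiLevelTorus.consts_260_261`; `B6RandomWalk.hasMajorant_mono`, `delta3_pos`.

## HONEST SCOPE

* ABSTRACT in: the pair `(GD, GD′)` of endomorphisms of the bond functions of `T_η` with (2.136)₁-shaped majorants `A·pref(y)·e^{−δd}` with
  respect to the block maps of the two families, and the identity `GD − GD′ = GD ∘ (V_P + V_Q) ∘ GD′` (hypothesis `hres`; for `G = Δ_a⁻¹` it is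
  FILE 1's `onFun_GE_sub`); the two-family (3.49)₄ difference `hΔ` (the shape of gen 19's `B9Thm314PFlatMultiLevelTorus.thm314_P_flat_multiLevelTorus`
  member 4 read through FILE 1's `member4_eq_dPd`); the one-family (3.49)₄ bounds `hPD`, `hPD′` (FILE 1's `dPd_le`); the weight band `hwb`/`hwb′`
  ((2.16), FILE 1's `w_le_of_band`), non-negative weights agreeing on the common top index bonds (`hww`); ONE rate `δ` for all inputs with the
  threshold `hthr` of (2.60) (`L² ≤ e^{¼δ(RLM_h − 1)}`) and the sums (2.61) `Ineq261With c` in both families.  §8–§9 discharge these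
  for `G = Δ_a⁻¹` with p38's `prop26_2136_grad_kLevel_unconditional_pad_V1` ((2.136)₁,₂), gen 19's FILE 5, FILE 1's `dPd_le`, and gen 18's
  `consts_260_261`, at the minimum of the rates; the hypotheses of §8–§9 are the union of the inputs' (`L ≥ 5`, `M_h = L^a ≥ 8`, `R ≥ 2L²`,
  `P_μ ≥ 5L` from p38's (2.136); `L·M_h ≥ M₀`, `R·L·M_h ≥ N₀ + 1` from (3.49)/(2.60)/(2.61)); the members (2.136)₃,₄ (`G∇*`, `ΔG`) are not
  treated here (their one-family majorants on the V1 torus are other seats' targets; §7 takes them as the outer factor once landed).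
* Constants explicit (`Θ`, `√(2A)·√(ΘL²cA²)`); the rates of the conclusion are `½δ` (plain decay) and `¼δ` (the factor (3.154)) — print's
  «after adjusting a definition of δ₀».  `U = 1`; `1 ≤ k`; the sites of (2.136) are the fine bonds of `T_η`, blocked by their initial points.
* ROUTE (declared, as gens 18–19): the second resolvent identity in place of the walk expansions; «at least one localization X_i intersects Ωᶜ»
  is the witness chain `dOmega_le_chain` applied to the (¬CT) pairs of the `∂P∂*` letter and to every surviving index bond of the `Q*aQ` letter
  (FILE 1's `witness_of_not_isCT`), while the (CT) pairs carry gen 19's two-family factor `e^{−δd(p,q,Ω)}`; the growing factor `e^{½δd(y,p)}` of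
  the per-block bounds is paid by the outer majorant through the transfer (2.60) (`transfer_top`).
* Nothing is inferred from the manuscript: every step is kernel-checked; the quoted sentences locate the statements.
-/

noncomputable section

open scoped BigOperators Matrix
open Finset

namespace Literature.MathematicalPhysics.QuantumFieldTheory.Balaban1983to89.B9Thm314GFlatV1Transfer

open B4Reflection242 (boxDom blk)
open B4TorusKernel.MultiPeriod (torusSupNorm circAbs circAbs_le_abs circAbs_add_mul circAbs_nonneg)
open B6MultiLevelBoxOperator (N0 aPrinted)
open B6MultiLevelTorusOperator (TDomains one_le_of_mem)
open B6Geom246MultiLevelBox (bset blkOf scale_bounds toR)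
open B6Geom246MultiLevelTorus (geomT toT TPt posT dist_toT_le dist_toT_toR dist_site_posT_le)
open B6RandomWalk (HasMajorant BlockSupp)
open B6Ineq2133TwoScaleV1 (onFun onFun_apply)
open B6SectAOperatorsV1 (dE dsE QE QsE aE BondIdx BondIdxSpace)
open BalabanImbrieJaffe1984to88.BIJ85AxialPropagator411 (BondSpace)
open B6GlobalChartV1 (PV toBox toBox_apply toBox_injective boxEquiv boxEquiv_apply blkV1 domT blk_toBox iterBlockOf_mem_domT_iff)
open B6ScalarChartV1 (boxEquiv_symm_toBox toBox_boxEquiv_symm)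
open B6Ineq288MultiLevelTorus (dPd)
open B6Ineq268MultiLevelBox (W W_pos W_eq card_blkOf_le)
open B6Prop22DerivMultiLevelTorus (dT)
open B9Thm314GpFlatTorusGeometry (cenLab cenB dist_toR_cenB_le powL_mono_real dist_posT_le_mul_distT OmegaC blk_mem_OmegaC tdistK
  tdistK_nonneg dOmega dOmega_nonneg dOmega_le posT_eq_of_top)
open B9Thm314GpFlatResolvent (abs_le_sum_of_hasMajorant transfer_top blkOf_eq_iff_blkOf_eq)
open B9Thm314QGGQInvFlatTransfer (tdistK_triangle tdistK_comm dOmega_le_tdistK_add dOmega_le_add_tdistK tdistK_le_distT_of_top)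
open B6Lemma21Repaired (Ineq261With)
open B6Prop26KLevelSkeletonV1 (pref pref_nonneg)
open B6CubeWindowV1 (GlobalBand)
open LatticeFieldCalculus (bondAvgIter)
open B5Eq118OneStroke (iterBlockOf val_iterBlockOf)
open B8Prop3MultiLevelTorus (QsE_apply_eq_sum abs_QsE_apply_le bondAvgIter_single_nonneg iterBlockOf_of_bondAvgIter_single_ne_zero
  lev_le_of_bondAvgIter_single_ne_zero)
open B9Thm314GFlatV1Kernel

variable {d ℓ : ℕ} {m K : ℕ} {hd : 1 ≤ d + 1} {hL : Odd (ℓ + 1) ∧ 1 < ℓ + 1}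
variable {Mh k R : ℕ} {P' : Fin (d + 1) → ℕ}

/-! ## §1  Geometry of (3.154) for fine sites: `|· − ·|` on `T^{(k)}` against the block distances of one family, and the witness chain -/

section Geometry

variable {ℓ Mh k R : ℕ} {P : Fin (d + 1) → ℕ}

/-- **A SITE AGAINST A TOP BLOCK**: for a site `z` of the torus and a top block `t` of a family, `|y₁ − t| ≤ d(y(z), t) + 1` on `T^{(k)}` in units of `L^k`
(`y₁` the `k`-lattice point of `z`: centre of the `k`-block of `z` → `z` → position of `y(z)` → position of `t`, by the block radii and
`|· − ·|_T ≤ L^k·d`). [cite: Balaban1985BackgroundPropagators, (3.154) p.427; Balaban1984PropagatorsII, (2.46) p.231] -/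
theorem tdistK_blk_le_of_top (D₀ : TDomains d ℓ Mh k P R) (hMh : 1 ≤ Mh) (hP : ∀ μ, 1 ≤ P μ) (z : ↥(boxDom (N0 ℓ Mh k P)))
    {t : ↥(bset D₀.toDomains)} (ht : t.1.1 = k) :
    tdistK (ℓ := ℓ) (Mh := Mh) (k := k) (P := P) (blk ((ℓ + 1) ^ k) z.1) t.1.2 ≤ (geomT D₀).dist (blkOf D₀.toDomains z) t + 1 := by
  have hN : ∀ i, 1 ≤ N0 ℓ Mh k P i := one_le_of_mem z.2
  set Lk : ℝ := (((ℓ + 1) ^ k : ℕ) : ℝ) with hLk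
  have hLk1 : 1 ≤ Lk := by rw [hLk]; exact_mod_cast Nat.one_le_pow _ _ (by omega)
  have hLk0 : 0 < Lk := lt_of_lt_of_le one_pos hLk1
  set b := blkOf D₀.toDomains z with hb
  have epc : toT (N0 ℓ Mh k P) (cenLab ((ℓ + 1) ^ k) (blk ((ℓ + 1) ^ k) z.1)) = toT (N0 ℓ Mh k P) (cenB ((ℓ + 1) ^ k) z.1) := rfl
  have ept : toT (N0 ℓ Mh k P) (cenLab ((ℓ + 1) ^ k) t.1.2) = posT D₀ t := (posT_eq_of_top D₀ ht).symm
  have h1 : dist (toT (N0 ℓ Mh k P) (cenB ((ℓ + 1) ^ k) z.1)) (toT (N0 ℓ Mh k P) (toR z.1)) ≤ Lk / 2 := by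
    have h0 := dist_toR_cenB_le (b := (ℓ + 1) ^ k) (Nat.one_le_pow _ _ (by omega)) z.1
    have h := dist_toT_le hN (cenB ((ℓ + 1) ^ k) z.1) (toR z.1)
    rw [dist_comm (cenB ((ℓ + 1) ^ k) z.1)] at h
    rw [hLk]; linarith
  have h2 : dist (toT (N0 ℓ Mh k P) (toR z.1)) (posT D₀ b) ≤ Lk / 2 := by
    have h := dist_site_posT_le (D := D₀) hb.symm
    have hLb : (((ℓ + 1) ^ b.1.1 : ℕ) : ℝ) ≤ Lk := powL_mono_real (scale_bounds D₀.toDomains b).2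
    linarith
  have h3 : dist (posT D₀ b) (posT D₀ t) ≤ (geomT D₀).dist b t * Lk := dist_posT_le_mul_distT D₀ hMh hP b t
  unfold tdistK
  rw [epc, ept, ← hLk, div_le_iff₀ hLk0]
  calc dist (toT (N0 ℓ Mh k P) (cenB ((ℓ + 1) ^ k) z.1)) (posT D₀ t)
      ≤ dist (toT (N0 ℓ Mh k P) (cenB ((ℓ + 1) ^ k) z.1)) (toT (N0 ℓ Mh k P) (toR z.1))
          + dist (toT (N0 ℓ Mh k P) (toR z.1)) (posT D₀ b) + dist (posT D₀ b) (posT D₀ t) := dist_triangle4 _ _ _ _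
    _ ≤ Lk / 2 + Lk / 2 + (geomT D₀).dist b t * Lk := by linarith
    _ = ((geomT D₀).dist b t + 1) * Lk := by ring

/-- **TWO SITES AT TORUS DISTANCE `≤ n·L^k`** have `k`-lattice points at distance `≤ n + 1` on `T^{(k)}` (block radii `≤ L^k/2` twice).
[cite: Balaban1985BackgroundPropagators, (3.154) p.427, dictionary] -/
theorem tdistK_blk_blk_le_of_dist {z w : ↥(boxDom (N0 ℓ Mh k P))} {n : ℝ}
    (h : dist (toT (N0 ℓ Mh k P) (toR z.1)) (toT (N0 ℓ Mh k P) (toR w.1)) ≤ n * (((ℓ + 1) ^ k : ℕ) : ℝ)) :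
    tdistK (ℓ := ℓ) (Mh := Mh) (k := k) (P := P) (blk ((ℓ + 1) ^ k) z.1) (blk ((ℓ + 1) ^ k) w.1) ≤ n + 1 := by
  have hN : ∀ i, 1 ≤ N0 ℓ Mh k P i := one_le_of_mem z.2
  set Lk : ℝ := (((ℓ + 1) ^ k : ℕ) : ℝ) with hLk
  have hLk1 : 1 ≤ Lk := by rw [hLk]; exact_mod_cast Nat.one_le_pow _ _ (by omega)
  have hLk0 : 0 < Lk := lt_of_lt_of_le one_pos hLk1
  have epz : toT (N0 ℓ Mh k P) (cenLab ((ℓ + 1) ^ k) (blk ((ℓ + 1) ^ k) z.1)) = toT (N0 ℓ Mh k P) (cenB ((ℓ + 1) ^ k) z.1) := rfl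
  have epw : toT (N0 ℓ Mh k P) (cenLab ((ℓ + 1) ^ k) (blk ((ℓ + 1) ^ k) w.1)) = toT (N0 ℓ Mh k P) (cenB ((ℓ + 1) ^ k) w.1) := rfl
  have hc : ∀ x : ↥(boxDom (N0 ℓ Mh k P)), dist (toT (N0 ℓ Mh k P) (cenB ((ℓ + 1) ^ k) x.1)) (toT (N0 ℓ Mh k P) (toR x.1)) ≤ Lk / 2 := by
    intro x
    have h0 := dist_toR_cenB_le (b := (ℓ + 1) ^ k) (Nat.one_le_pow _ _ (by omega)) x.1
    have h := dist_toT_le hN (cenB ((ℓ + 1) ^ k) x.1) (toR x.1)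
    rw [dist_comm (cenB ((ℓ + 1) ^ k) x.1)] at h
    rw [hLk]; linarith
  unfold tdistK
  rw [epz, epw, ← hLk, div_le_iff₀ hLk0]
  have hw := hc w
  rw [dist_comm] at hw
  calc dist (toT (N0 ℓ Mh k P) (cenB ((ℓ + 1) ^ k) z.1)) (toT (N0 ℓ Mh k P) (cenB ((ℓ + 1) ^ k) w.1))
      ≤ dist (toT (N0 ℓ Mh k P) (cenB ((ℓ + 1) ^ k) z.1)) (toT (N0 ℓ Mh k P) (toR z.1))
          + dist (toT (N0 ℓ Mh k P) (toR z.1)) (toT (N0 ℓ Mh k P) (toR w.1))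
          + dist (toT (N0 ℓ Mh k P) (toR w.1)) (toT (N0 ℓ Mh k P) (cenB ((ℓ + 1) ^ k) w.1)) := dist_triangle4 _ _ _ _
    _ ≤ Lk / 2 + n * Lk + Lk / 2 := by linarith [hc z]
    _ = (n + 1) * Lk := by ring

/-- **TWO SITES THROUGH THE BLOCKS OF ONE FAMILY**: `|z₁ − w₁| ≤ d(y(z), y(w)) + 2` on `T^{(k)}` (positions of the two blocks, radii).
[cite: Balaban1985BackgroundPropagators, (3.154) p.427; Balaban1984PropagatorsII, (2.46) p.231] -/
theorem tdistK_blk_blk_le (D₀ : TDomains d ℓ Mh k P R) (hMh : 1 ≤ Mh) (hP : ∀ μ, 1 ≤ P μ) (z w : ↥(boxDom (N0 ℓ Mh k P))) :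
    tdistK (ℓ := ℓ) (Mh := Mh) (k := k) (P := P) (blk ((ℓ + 1) ^ k) z.1) (blk ((ℓ + 1) ^ k) w.1)
      ≤ (geomT D₀).dist (blkOf D₀.toDomains z) (blkOf D₀.toDomains w) + 2 := by
  set Lk : ℝ := (((ℓ + 1) ^ k : ℕ) : ℝ) with hLk
  have hLk1 : 1 ≤ Lk := by rw [hLk]; exact_mod_cast Nat.one_le_pow _ _ (by omega)
  have hrad : ∀ x : ↥(boxDom (N0 ℓ Mh k P)), dist (toT (N0 ℓ Mh k P) (toR x.1)) (posT D₀ (blkOf D₀.toDomains x)) ≤ Lk / 2 := by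
    intro x
    have h := dist_site_posT_le (D := D₀) (rfl : blkOf D₀.toDomains x = blkOf D₀.toDomains x)
    have hLb : (((ℓ + 1) ^ (blkOf D₀.toDomains x).1.1 : ℕ) : ℝ) ≤ Lk := powL_mono_real (scale_bounds D₀.toDomains _).2
    linarith
  have h3 := dist_posT_le_mul_distT D₀ hMh hP (blkOf D₀.toDomains z) (blkOf D₀.toDomains w)
  have key : dist (toT (N0 ℓ Mh k P) (toR z.1)) (toT (N0 ℓ Mh k P) (toR w.1))
      ≤ ((geomT D₀).dist (blkOf D₀.toDomains z) (blkOf D₀.toDomains w) + 1) * Lk := by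
    have hw := hrad w
    rw [dist_comm] at hw
    calc dist (toT (N0 ℓ Mh k P) (toR z.1)) (toT (N0 ℓ Mh k P) (toR w.1))
        ≤ dist (toT (N0 ℓ Mh k P) (toR z.1)) (posT D₀ (blkOf D₀.toDomains z))
            + dist (posT D₀ (blkOf D₀.toDomains z)) (posT D₀ (blkOf D₀.toDomains w))
            + dist (posT D₀ (blkOf D₀.toDomains w)) (toT (N0 ℓ Mh k P) (toR w.1)) := dist_triangle4 _ _ _ _
      _ ≤ Lk / 2 + (geomT D₀).dist (blkOf D₀.toDomains z) (blkOf D₀.toDomains w) * Lk + Lk / 2 := by linarith [hrad z]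
      _ = ((geomT D₀).dist (blkOf D₀.toDomains z) (blkOf D₀.toDomains w) + 1) * Lk := by ring
  have := tdistK_blk_blk_le_of_dist (z := z) (w := w) key
  linarith

variable (D D' : TDomains d ℓ Mh k P R)

/-- **THE WITNESS CHAIN OF (3.154)**: if one of the two `k`-lattice points `β₁, β₂` lies in `Ωᶜ ∩ T^{(k)}`, then for all `y, y′`:
`d(y, y′, Ω) ≤ |y − β₁| + |β₁ − β₂| + |β₂ − y′|`. [cite: Balaban1985BackgroundPropagators, Thm 3.14 (3.154) p.427 («at least one localization X_i intersects Ωᶜ»)] -/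
theorem dOmega_le_chain {β₁ β₂ : Fin (d + 1) → ℤ} (h : β₁ ∈ OmegaC D D' ∨ β₂ ∈ OmegaC D D') (β β' : Fin (d + 1) → ℤ) :
    dOmega D D' β β' ≤ tdistK (ℓ := ℓ) (Mh := Mh) (k := k) (P := P) β β₁ + tdistK (ℓ := ℓ) (Mh := Mh) (k := k) (P := P) β₁ β₂
      + tdistK (ℓ := ℓ) (Mh := Mh) (k := k) (P := P) β₂ β' := by
  rcases h with h₁ | h₂
  · have := dOmega_le D D' (β := β) (β' := β') h₁
    have ht := tdistK_triangle (ℓ := ℓ) (Mh := Mh) (k := k) (P := P) β₁ β₂ β'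
    linarith
  · have := dOmega_le D D' (β := β) (β' := β') h₂
    have ht := tdistK_triangle (ℓ := ℓ) (Mh := Mh) (k := k) (P := P) β β₁ β₂
    linarith

end Geometry

/-! ## §2  The tube of an index bond: fine bonds charged by `(Q·)_i`, `i = (j, c)`, lie in `B^j(c₋) ∪ B^j(c₊)` — torus diameter `< 2L^j` -/

section Tube

/-- arithmetic core: two labels `a, a′ < L_j·N_j` whose `L_j`-blocks are equal or cyclically adjacent differ by less than `2L_j` on the cycle
`ℤ/(L_jN_j)ℤ`. [folklore] -/
private theorem circAbs_sub_le_of_blocks {Lj Nj : ℕ} (hL : 1 ≤ Lj) {a a' : ℕ} (ha : a < Lj * Nj) (ha' : a' < Lj * Nj)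
    (h : a / Lj = a' / Lj ∨ a' / Lj = (a / Lj + 1) % Nj ∨ a / Lj = (a' / Lj + 1) % Nj) :
    circAbs (Lj * Nj) ((a : ℤ) - a') ≤ 2 * (Lj : ℤ) - 1 := by
  have hN1 : 1 ≤ Lj * Nj := by
    rcases Nat.eq_zero_or_pos (Lj * Nj) with h0 | h0
    · omega
    · omega
  set q := a / Lj with hq
  set q' := a' / Lj with hq'
  have hr : a % Lj < Lj := Nat.mod_lt _ (by omega)
  have hr' : a' % Lj < Lj := Nat.mod_lt _ (by omega)
  have ea : Lj * q + a % Lj = a := Nat.div_add_mod a Lj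
  have ea' : Lj * q' + a' % Lj = a' := Nat.div_add_mod a' Lj
  have hqN : q < Nj := by rw [hq]; exact Nat.div_lt_of_lt_mul ha
  have hqN' : q' < Nj := by rw [hq']; exact Nat.div_lt_of_lt_mul ha'
  -- integer forms (the products `Lj·q`, `Lj·q′` are the only nonlinear atoms)
  have eaZ : (a : ℤ) = (Lj : ℤ) * q + (a % Lj : ℕ) := by exact_mod_cast ea.symm
  have ea'Z : (a' : ℤ) = (Lj : ℤ) * q' + (a' % Lj : ℕ) := by exact_mod_cast ea'.symm
  have hrZ : ((a % Lj : ℕ) : ℤ) < Lj := by exact_mod_cast hr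
  have hr'Z : ((a' % Lj : ℕ) : ℤ) < Lj := by exact_mod_cast hr'
  have hr0 : (0 : ℤ) ≤ ((a % Lj : ℕ) : ℤ) := by positivity
  have hr'0 : (0 : ℤ) ≤ ((a' % Lj : ℕ) : ℤ) := by positivity
  have habs : ∀ x : ℤ, |x| ≤ 2 * (Lj : ℤ) - 1 → circAbs (Lj * Nj) x ≤ 2 * (Lj : ℤ) - 1 := fun x hx =>
    (circAbs_le_abs hN1 x).trans hx
  rcases h with h1 | h2 | h3
  · -- same block
    have hp : (Lj : ℤ) * q = (Lj : ℤ) * q' := by rw [show (q : ℤ) = q' by exact_mod_cast h1]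
    exact habs _ (abs_le.2 ⟨by linarith, by linarith⟩)
  · -- `a′` one block ahead (cyclically)
    by_cases hlt : q + 1 < Nj
    · rw [Nat.mod_eq_of_lt hlt] at h2
      have hp : (Lj : ℤ) * q' = (Lj : ℤ) * q + Lj := by rw [show (q' : ℤ) = q + 1 by exact_mod_cast h2]; ring
      exact habs _ (abs_le.2 ⟨by linarith, by linarith⟩)
    · have hq1 : q + 1 = Nj := by omega
      rw [hq1, Nat.mod_self] at h2
      have hN : ((Lj * Nj : ℕ) : ℤ) = (Lj : ℤ) * q + Lj := by rw [← hq1]; push_cast; ring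
      have hp : (Lj : ℤ) * q' = 0 := by rw [show (q' : ℤ) = 0 by exact_mod_cast h2]; ring
      have e : ((a : ℤ) - a') = ((a : ℤ) - a' - (Lj * Nj : ℕ)) + ((Lj * Nj : ℕ) : ℤ) * 1 := by ring
      rw [e, circAbs_add_mul]
      exact (circAbs_le_abs hN1 _).trans (abs_le.2 ⟨by linarith, by linarith⟩)
  · -- `a` one block ahead (cyclically)
    by_cases hlt : q' + 1 < Nj
    · rw [Nat.mod_eq_of_lt hlt] at h3
      have hp : (Lj : ℤ) * q = (Lj : ℤ) * q' + Lj := by rw [show (q : ℤ) = q' + 1 by exact_mod_cast h3]; ring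
      exact habs _ (abs_le.2 ⟨by linarith, by linarith⟩)
    · have hq1 : q' + 1 = Nj := by omega
      rw [hq1, Nat.mod_self] at h3
      have hN : ((Lj * Nj : ℕ) : ℤ) = (Lj : ℤ) * q' + Lj := by rw [← hq1]; push_cast; ring
      have hp : (Lj : ℤ) * q = 0 := by rw [show (q : ℤ) = 0 by exact_mod_cast h3]; ring
      have e : ((a : ℤ) - a') = ((a : ℤ) - a' + (Lj * Nj : ℕ)) + ((Lj * Nj : ℕ) : ℤ) * (-1) := by ring
      rw [e, circAbs_add_mul]
      exact (circAbs_le_abs hN1 _).trans (abs_le.2 ⟨by linarith, by linarith⟩)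

/-- the label of the shifted coarse site: `val((y + e_μ₀)_μ) = val(y_μ)` off `μ₀`, `(val(y_μ₀) + 1) mod N_j` at `μ₀`. [folklore] -/
private theorem val_shift_apply {P : Params} {j : ℕ} (y : Site P j) (μ₀ μ : Fin P.d) :
    ((y.shift μ₀) μ).val = if μ = μ₀ then ((y μ).val + 1) % P.sitesPerDir j else (y μ).val := by
  unfold Site.shift
  by_cases h : μ = μ₀
  · subst h
    rw [Function.update_self, if_pos rfl, ZMod.val_add, ZMod.val_one_eq_one_mod, Nat.add_mod_mod]
  · rw [Function.update_of_ne h, if_neg h]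

/-- **THE TUBE OF AN INDEX BOND HAS TORUS DIAMETER `≤ 2L^k`**: two fine sites whose `j`-blocks (`j ≤ k`) are each `c₋` or `c₊ = c₋ + e_μ` (the blocks
met by the straight contours of `(Q_j·)(c)`, [B5] (1.11)/(1.18)) are at torus sup-distance `< 2L^j ≤ 2L^k`.
[cite: Balaban1984PropagatorsI, (1.11) p.19 («x(c) … in the block B(c₊)»), (1.18) p.20; Balaban1984PropagatorsII, (2.1) p.224] -/
theorem dist_tube_le (hN : ∀ μ, N0 ℓ Mh k P' μ = (PV d ℓ m K hd hL).sitesPerDir 0) {j : ℕ} (hj : j ≤ m + K) (hjk : j ≤ k)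
    (c : PBond (PV d ℓ m K hd hL) j) {x x' : Site (PV d ℓ m K hd hL) 0}
    (hx : iterBlockOf j x = c.src ∨ iterBlockOf j x = c.tgt) (hx' : iterBlockOf j x' = c.src ∨ iterBlockOf j x' = c.tgt) :
    dist (toT (N0 ℓ Mh k P') (toR (toBox hN x).1)) (toT (N0 ℓ Mh k P') (toR (toBox hN x').1)) ≤ 2 * (((ℓ + 1) ^ k : ℕ) : ℝ) := by
  have hN1 : ∀ i, 1 ≤ N0 ℓ Mh k P' i := one_le_of_mem (toBox hN x).2
  rw [dist_toT_toR hN1]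
  unfold torusSupNorm
  refine Finset.sup'_le _ _ fun μ _ => ?_
  -- labels and the period in direction `μ`
  set Lj : ℕ := (ℓ + 1) ^ j with hLj
  set Nj : ℕ := (PV d ℓ m K hd hL).sitesPerDir j with hNj
  have hL1 : 1 ≤ Lj := Nat.one_le_pow _ _ (by omega)
  have hper : N0 ℓ Mh k P' μ = Lj * Nj := by
    rw [hN μ, B6AgreeQaQV1Chart.sitesPerDir_zero_eq_mul (PV d ℓ m K hd hL) (j' := j) hj]
  have hval : ∀ z : Site (PV d ℓ m K hd hL) 0, (z μ).val / Lj = ((iterBlockOf j z) μ).val := fun z => by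
    rw [val_iterBlockOf j hj z μ]
  have hdiff : ((toBox hN x).1 - (toBox hN x').1) μ = ((x μ).val : ℤ) - ((x' μ).val : ℤ) := by
    simp only [Pi.sub_apply, toBox_apply]
  have ha : (x μ).val < Lj * Nj := by rw [← hper, hN μ]; exact ZMod.val_lt _
  have ha' : (x' μ).val < Lj * Nj := by rw [← hper, hN μ]; exact ZMod.val_lt _
  -- the three block configurations
  have htgt : ∀ ν, ((c.tgt) ν).val = if ν = c.dir then ((c.src ν).val + 1) % Nj else (c.src ν).val := fun ν => by
    show ((c.src.shift c.dir) ν).val = _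
    rw [val_shift_apply]
  have hblocks : (x μ).val / Lj = (x' μ).val / Lj ∨ (x' μ).val / Lj = ((x μ).val / Lj + 1) % Nj
      ∨ (x μ).val / Lj = ((x' μ).val / Lj + 1) % Nj := by
    rw [hval x, hval x']
    rcases hx with h1 | h1 <;> rcases hx' with h2 | h2 <;> rw [h1, h2]
    · exact Or.inl rfl
    · rw [htgt μ]
      by_cases hμ : μ = c.dir
      · rw [if_pos hμ]; exact Or.inr (Or.inl rfl)
      · rw [if_neg hμ]; exact Or.inl rfl
    · rw [htgt μ]
      by_cases hμ : μ = c.dir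
      · rw [if_pos hμ]; exact Or.inr (Or.inr rfl)
      · rw [if_neg hμ]; exact Or.inl rfl
    · exact Or.inl rfl
  have hcore := circAbs_sub_le_of_blocks (Nj := Nj) hL1 ha ha' hblocks
  rw [hdiff, hper]
  have hLjk : (Lj : ℤ) ≤ (((ℓ + 1) ^ k : ℕ) : ℤ) := by
    rw [hLj]; exact_mod_cast Nat.pow_le_pow_right (by omega) hjk
  have : (circAbs (Lj * Nj) (((x μ).val : ℤ) - ((x' μ).val : ℤ)) : ℤ) ≤ 2 * (((ℓ + 1) ^ k : ℕ) : ℤ) := by linarith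
  exact_mod_cast this

end Tube


/-! ## §3  Bookkeeping: point-mass expansion, fibre counts and fibre sums over the fine bonds of a block -/

section Bookkeeping

variable (hN : ∀ μ, N0 ℓ Mh k P' μ = (PV d ℓ m K hd hL).sitesPerDir 0)

/-- `(Tg)(f) = Σ_v (Te_v)(f)·g(v)`. [folklore] -/
private theorem apply_eq_sum_single (T : Module.End ℝ (PBond (PV d ℓ m K hd hL) 0 → ℝ))
    (g : PBond (PV d ℓ m K hd hL) 0 → ℝ) (f : PBond (PV d ℓ m K hd hL) 0) :
    T g f = ∑ v, T (Pi.single v (1 : ℝ)) f * g v :=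
  B6Prop23Chain.apply_eq_sum_mat T g f

/-- **AT MOST `(d+1)·(L^j)^{d+1}` FINE BONDS START IN A `j`-BLOCK** (`d + 1` directions per site, `W(y) = (L^j)^{d+1}` sites in `B^j(y)`).
[cite: Balaban1984PropagatorsII, (2.69) p.235 («(L^jη)^d» — the block volume), dictionary] -/
theorem card_fibre_le (D₀ : TDomains d ℓ Mh k P' R) (q : ↥(bset D₀.toDomains)) :
    (((Finset.univ.filter fun v : PBond (PV d ℓ m K hd hL) 0 => blkV1 hN D₀ v = q).card : ℕ) : ℝ)
      ≤ ((d : ℝ) + 1) * W D₀.toDomains q := by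
  have hcard : (Finset.univ.filter fun v : PBond (PV d ℓ m K hd hL) 0 => blkV1 hN D₀ v = q).card
      ≤ ((Finset.univ.filter fun x : ↥(boxDom (N0 ℓ Mh k P')) => blkOf D₀.toDomains x = q) ×ˢ
          (Finset.univ : Finset (Fin (d + 1)))).card := by
    refine Finset.card_le_card_of_injOn (fun v => (toBox hN v.src, v.dir)) ?_ ?_
    · intro v hv
      have hv' : blkV1 hN D₀ v = q := (Finset.mem_filter.1 (Finset.mem_coe.1 hv)).2
      exact Finset.mem_coe.2 (Finset.mem_product.2 ⟨Finset.mem_filter.2 ⟨Finset.mem_univ _, hv'⟩, Finset.mem_univ _⟩)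
    · intro v _ v' _ h
      have h1 : toBox hN v.src = toBox hN v'.src := (Prod.ext_iff.1 h).1
      have h2 : v.dir = v'.dir := (Prod.ext_iff.1 h).2
      have hs : v.src = v'.src := toBox_injective hN h1
      cases v
      cases v'
      simp only at hs h2
      rw [hs, h2]
  have hprod : ((((Finset.univ.filter fun x : ↥(boxDom (N0 ℓ Mh k P')) => blkOf D₀.toDomains x = q) ×ˢ
      (Finset.univ : Finset (Fin (d + 1)))).card : ℕ) : ℝ)
      = (((Finset.univ.filter fun x : ↥(boxDom (N0 ℓ Mh k P')) => blkOf D₀.toDomains x = q).card : ℕ) : ℝ) * ((d : ℝ) + 1) := by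
    rw [Finset.card_product, Finset.card_univ, Fintype.card_fin]; push_cast; ring
  have hW := card_blkOf_le D₀.toDomains q
  calc (((Finset.univ.filter fun v : PBond (PV d ℓ m K hd hL) 0 => blkV1 hN D₀ v = q).card : ℕ) : ℝ)
      ≤ ((((Finset.univ.filter fun x : ↥(boxDom (N0 ℓ Mh k P')) => blkOf D₀.toDomains x = q) ×ˢ
          (Finset.univ : Finset (Fin (d + 1)))).card : ℕ) : ℝ) := by exact_mod_cast hcard
    _ = _ := hprod
    _ ≤ W D₀.toDomains q * ((d : ℝ) + 1) := mul_le_mul_of_nonneg_right hW (by positivity)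
    _ = ((d : ℝ) + 1) * W D₀.toDomains q := mul_comm _ _

/-- **SUMMING A `W`-NORMALISED BLOCK PROFILE OVER THE FINE BONDS**: if `F(v) ≤ W(y(v))⁻¹·Γ(y(v))` with `Γ ≥ 0` on the blocks of one family, then
`Σ_v F(v) ≤ (d+1)·Σ_y Γ(y)` (the `ℓ¹`–`ℓ^∞` pairing (2.69) block by block). [cite: Balaban1984PropagatorsII, (2.69) p.235, dictionary] -/
theorem sum_le_of_fibre_bound (D₀ : TDomains d ℓ Mh k P' R) (F : PBond (PV d ℓ m K hd hL) 0 → ℝ) (Γ : ↥(bset D₀.toDomains) → ℝ)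
    (hΓ : ∀ q, 0 ≤ Γ q) (hF : ∀ v, F v ≤ (W D₀.toDomains (blkV1 hN D₀ v))⁻¹ * Γ (blkV1 hN D₀ v)) :
    ∑ v, F v ≤ ((d : ℝ) + 1) * ∑ q, Γ q := by
  rw [← Finset.sum_fiberwise Finset.univ (blkV1 hN D₀) F, Finset.mul_sum]
  refine Finset.sum_le_sum fun q _ => ?_
  have hq : ∀ v ∈ Finset.univ.filter (fun v => blkV1 hN D₀ v = q), F v ≤ (W D₀.toDomains q)⁻¹ * Γ q := by
    intro v hv
    have h := hF v
    rw [(Finset.mem_filter.1 hv).2] at h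
    exact h
  refine (Finset.sum_le_card_nsmul _ _ _ hq).trans ?_
  rw [nsmul_eq_mul]
  have hW := W_pos D₀.toDomains q
  calc (((Finset.univ.filter (fun v => blkV1 hN D₀ v = q)).card : ℕ) : ℝ) * ((W D₀.toDomains q)⁻¹ * Γ q)
      ≤ ((d : ℝ) + 1) * W D₀.toDomains q * ((W D₀.toDomains q)⁻¹ * Γ q) :=
        mul_le_mul_of_nonneg_right (card_fibre_le hN D₀ q) (mul_nonneg (inv_nonneg.2 hW.le) (hΓ q))
    _ = ((d : ℝ) + 1) * Γ q := by field_simp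

/-- `c_f²·pref(y) = (L^{j(y)})²`. [cite: Balaban1984PropagatorsII, (2.136) p.247, bookkeeping] -/
theorem sq_mul_pref (D₀ : TDomains d ℓ Mh k P' R) {cf : ℝ} (hcf : cf ≠ 0) (q : ↥(bset D₀.toDomains)) :
    cf ^ 2 * pref cf (D := D₀) q = (((ℓ : ℝ) + 1) ^ q.1.1) ^ 2 := by
  unfold pref
  have e : (((ℓ + 1 : ℕ) : ℝ)) = (ℓ : ℝ) + 1 := by push_cast; ring
  rw [e, div_pow]
  field_simp

/-- `(L^{j(y)})² ≤ (L^k)²` for every block. [cite: Balaban1984PropagatorsII, (2.3)–(2.4) p.224, bookkeeping] -/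
theorem powLev_sq_le (D₀ : TDomains d ℓ Mh k P' R) (q : ↥(bset D₀.toDomains)) :
    (((ℓ : ℝ) + 1) ^ q.1.1) ^ 2 ≤ (((ℓ : ℝ) + 1) ^ k) ^ 2 := by
  have hL1 : (1 : ℝ) ≤ (ℓ : ℝ) + 1 := by linarith [(Nat.cast_nonneg ℓ : (0 : ℝ) ≤ ℓ)]
  exact pow_le_pow_left₀ (by positivity) (pow_le_pow_right₀ hL1 (scale_bounds D₀.toDomains q).2) 2

/-- `1 ≤ L^{2k}/L^{2j(y)}` for every block. [cite: Balaban1984PropagatorsII, (2.3)–(2.4) p.224, bookkeeping] -/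
theorem one_le_ratio (D₀ : TDomains d ℓ Mh k P' R) (q : ↥(bset D₀.toDomains)) :
    (1 : ℝ) ≤ ((ℓ : ℝ) + 1) ^ (2 * k) / ((ℓ : ℝ) + 1) ^ (2 * q.1.1) := by
  have hL1 : (1 : ℝ) ≤ (ℓ : ℝ) + 1 := by linarith [(Nat.cast_nonneg ℓ : (0 : ℝ) ≤ ℓ)]
  rw [le_div_iff₀ (by positivity), one_mul]
  exact pow_le_pow_right₀ hL1 (by linarith [(scale_bounds D₀.toDomains q).2])

/-- the geometric tail `Σ_{j ∈ [p, k]} r^j ≤ 2r^p` for `0 ≤ r ≤ 1/2`. [folklore] -/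
private theorem sum_ite_pow_le {r : ℝ} (hr0 : 0 ≤ r) (hr : r ≤ 1 / 2) (p n : ℕ) :
    ∑ j ∈ Finset.range n, (if p ≤ j then r ^ j else 0) ≤ 2 * r ^ p := by
  rw [← Finset.sum_filter]
  have hsub : (Finset.range n).filter (fun j => p ≤ j) ⊆ Finset.Ico p (max p n) := by
    intro j hj
    rw [Finset.mem_filter, Finset.mem_range] at hj
    rw [Finset.mem_Ico]
    exact ⟨hj.2, lt_max_of_lt_right hj.1⟩
  refine (Finset.sum_le_sum_of_subset_of_nonneg hsub fun j _ _ => pow_nonneg hr0 j).trans ?_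
  refine (geom_sum_Ico_le_of_lt_one hr0 (by linarith)).trans ?_
  rw [div_le_iff₀ (by linarith)]
  nlinarith [pow_nonneg hr0 p]

/-- the reflected geometric sum `Σ_{j ≤ k} r^{k−j} ≤ 2` for `0 ≤ r ≤ 1/2`. [folklore] -/
private theorem sum_pow_sub_le {r : ℝ} (hr0 : 0 ≤ r) (hr : r ≤ 1 / 2) (k : ℕ) :
    ∑ j ∈ Finset.range (k + 1), r ^ (k - j) ≤ 2 := by
  have e : ∑ j ∈ Finset.range (k + 1), r ^ (k - j) = ∑ j ∈ Finset.range (k + 1), r ^ j := by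
    have h := Finset.sum_range_reflect (fun j => r ^ j) (k + 1)
    simp only [Nat.add_sub_cancel] at h
    exact h
  rw [e, Finset.range_eq_Ico]
  refine (geom_sum_Ico_le_of_lt_one hr0 (by linarith)).trans ?_
  rw [pow_zero, div_le_iff₀ (by linarith)]
  linarith

end Bookkeeping


/-! ## §4  The `∂P∂*` letter between the two resolvent factors ((2.19)/(2.22)): the three sums of (3.154)'s mechanism

For a fine bond `f` (initial point `x`, in the block `p = y(x)` of `{Ω_j}`) and the inner factor's output `g = G[Ω′]μ`
(`supp μ ⊂ B(y′)`, `|μ| ≤ B`, profile `|g(v)| ≤ A·pref(y′(v))·e^{−δd′(y′(v), y′)}·B` from the majorant of `G[Ω′]`):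
`(V_Pg)(f) = Σ_v c_f²[(∂P[Ω]∂*)(x, v) − (∂P[Ω′]∂*)(x, v)]·g(v)`, and the pairs `(x, v)` split into
(CT) both in `Ω` — the two-family difference of gen 19's FILE 5 (`hΔ`: `e^{−δd(p,q,Ω)}` × top-block volume⁻¹);
(¬CT) one of them in `Ωᶜ` — each kernel separately ((3.49)₄, `hPD`/`hPD′`) with the WITNESS CHAIN of §1 converting the kernels' decay
through the point of `Ωᶜ` into `e^{−½δd(y,y′,Ω)}` at the price `e^{½δd(y,p)}` (paid by the outer factor) — print's «at least one of
localizations X_i intersects Ωᶜ» (p. 427). -/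

section PPart

variable (hN : ∀ μ, N0 ℓ Mh k P' μ = (PV d ℓ m K hd hL).sitesPerDir 0) (D D' : TDomains d ℓ Mh k P' R) (hk : k ≤ m + K)

/-- **(CT) PAIRS — BOTH POINTS IN `Ω`**: the term `c_f²·|(∂P∂* − ∂P′∂*)(x, v)|·|g(v)|` is at most
`W′(y′(v))⁻¹·A·B·C_Δ·e^{½δd(y,p)}·e^{−½δd(y,y′,Ω)}·e^{−¼δd′(y′, y′(v))}` (the chain `d(y,y′,Ω) ≤ |y − p| + d(p,q,Ω) + |q − y′|` through the
common top blocks `p ∋ x`, `q ∋ v`). [cite: Balaban1985BackgroundPropagators, Thm 3.14 (3.154) p.427; Balaban1984PropagatorsII, (2.22) p.226, (2.88) p.238] -/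
theorem termCT_le (hMh : 1 ≤ Mh) (hP : ∀ μ, 1 ≤ P' μ) {δ CΔ A B cf : ℝ} (hδ : 0 ≤ δ) (hcf : cf ≠ 0) (hCΔ : 0 ≤ CΔ)
    (hA : 0 ≤ A) (hB : 0 ≤ B)
    (hΔ : ∀ (p q : ℕ × (Fin (d + 1) → ℤ)) (hpD : p ∈ bset D.toDomains) (hpD' : p ∈ bset D'.toDomains)
      (hqD : q ∈ bset D.toDomains) (hqD' : q ∈ bset D'.toDomains), p.1 = k → q.1 = k →
      ∀ (x x' : ↥(boxDom (N0 ℓ Mh k P'))), blkOf D.toDomains x = ⟨p, hpD⟩ → blkOf D.toDomains x' = ⟨q, hqD⟩ →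
      ∀ μ ν : Fin (d + 1), |dPd D μ ν x x' - dPd D' μ ν x x'|
        ≤ CΔ * ((((ℓ : ℝ) + 1) ^ k) ^ 2)⁻¹ * ((((ℓ : ℝ) + 1) ^ k) ^ (d + 1))⁻¹
          * Real.exp (-(δ * min ((geomT D).dist ⟨p, hpD⟩ ⟨q, hqD⟩) ((geomT D').dist ⟨p, hpD'⟩ ⟨q, hqD'⟩)))
          * Real.exp (-(δ * dOmega D D' p.2 q.2)))
    {y : ↥(bset D.toDomains)} (hy : y.1.1 = k) {y' : ↥(bset D'.toDomains)} (hy' : y'.1.1 = k)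
    {g : PBond (PV d ℓ m K hd hL) 0 → ℝ}
    (hg : ∀ v, |g v| ≤ A * pref cf (blkV1 hN D' v) * Real.exp (-(δ * (geomT D').dist (blkV1 hN D' v) y')) * B)
    (f v : PBond (PV d ℓ m K hd hL) 0) (hΩx : D.lev (toBox hN f.src).1 = k ∧ D'.lev (toBox hN f.src).1 = k)
    (hΩv : D.lev (toBox hN v.src).1 = k ∧ D'.lev (toBox hN v.src).1 = k) :
    cf ^ 2 * |dPd D f.dir v.dir (toBox hN f.src) (toBox hN v.src) - dPd D' f.dir v.dir (toBox hN f.src) (toBox hN v.src)| * |g v|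
      ≤ (W D'.toDomains (blkV1 hN D' v))⁻¹ * (A * B * CΔ
          * (Real.exp (1 / 2 * δ * (geomT D).dist y (blkV1 hN D f)) * Real.exp (-(1 / 2 * δ * dOmega D D' y.1.2 y'.1.2)))
          * Real.exp (-(1 / 4 * δ * (geomT D').dist y' (blkV1 hN D' v)))) := by
  have hd0 : ∀ s t : ↥(bset D.toDomains), 0 ≤ (geomT D).dist s t := (B6Geom246MultiLevelTorus.triangle_refl_nonneg_T D hMh hP).2.2
  have hd0' : ∀ s t : ↥(bset D'.toDomains), 0 ≤ (geomT D').dist s t :=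
    (B6Geom246MultiLevelTorus.triangle_refl_nonneg_T D' hMh hP).2.2
  set x := toBox hN f.src with hx
  set z := toBox hN v.src with hz
  -- the two common top blocks
  have hpx1 : (blkV1 hN D f).1 = (k, blk ((ℓ + 1) ^ k) x.1) := by
    have h : D.toDomains.lev x.1 = k := hΩx.1
    show (D.toDomains.lev x.1, blk ((ℓ + 1) ^ D.toDomains.lev x.1) x.1) = _
    rw [h]
  have hpx1' : (blkOf D'.toDomains x).1 = (k, blk ((ℓ + 1) ^ k) x.1) := by
    have h : D'.toDomains.lev x.1 = k := hΩx.2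
    show (D'.toDomains.lev x.1, blk ((ℓ + 1) ^ D'.toDomains.lev x.1) x.1) = _
    rw [h]
  have hqz1 : (blkV1 hN D v).1 = (k, blk ((ℓ + 1) ^ k) z.1) := by
    have h : D.toDomains.lev z.1 = k := hΩv.1
    show (D.toDomains.lev z.1, blk ((ℓ + 1) ^ D.toDomains.lev z.1) z.1) = _
    rw [h]
  have hqz1' : (blkV1 hN D' v).1 = (k, blk ((ℓ + 1) ^ k) z.1) := by
    have h : D'.toDomains.lev z.1 = k := hΩv.2
    show (D'.toDomains.lev z.1, blk ((ℓ + 1) ^ D'.toDomains.lev z.1) z.1) = _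
    rw [h]
  have hp₀D : (k, blk ((ℓ + 1) ^ k) x.1) ∈ bset D.toDomains := by rw [← hpx1]; exact (blkV1 hN D f).2
  have hp₀D' : (k, blk ((ℓ + 1) ^ k) x.1) ∈ bset D'.toDomains := by rw [← hpx1']; exact (blkOf D'.toDomains x).2
  have hq₀D : (k, blk ((ℓ + 1) ^ k) z.1) ∈ bset D.toDomains := by rw [← hqz1]; exact (blkV1 hN D v).2
  have hq₀D' : (k, blk ((ℓ + 1) ^ k) z.1) ∈ bset D'.toDomains := by rw [← hqz1']; exact (blkV1 hN D' v).2
  have hfp : blkV1 hN D f = ⟨(k, blk ((ℓ + 1) ^ k) x.1), hp₀D⟩ := Subtype.ext hpx1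
  have hvq : blkV1 hN D v = ⟨(k, blk ((ℓ + 1) ^ k) z.1), hq₀D⟩ := Subtype.ext hqz1
  have hvq' : blkV1 hN D' v = ⟨(k, blk ((ℓ + 1) ^ k) z.1), hq₀D'⟩ := Subtype.ext hqz1'
  have hdiff := hΔ _ _ hp₀D hp₀D' hq₀D hq₀D' rfl rfl x z hfp hvq f.dir v.dir
  have h2 := hg v
  rw [hvq'] at h2
  rw [hvq', hfp]
  -- sizes of the top blocks
  have hW' : W D'.toDomains ⟨(k, blk ((ℓ + 1) ^ k) z.1), hq₀D'⟩ = (((ℓ : ℝ) + 1) ^ k) ^ (d + 1) := W_eq _ _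
  have hWpos : 0 < (((ℓ : ℝ) + 1) ^ k) ^ (d + 1) := by positivity
  have hpref : cf ^ 2 * pref cf (D := D') ⟨(k, blk ((ℓ + 1) ^ k) z.1), hq₀D'⟩ = (((ℓ : ℝ) + 1) ^ k) ^ 2 := sq_mul_pref D' hcf _
  -- the chain through the two common top blocks
  have hc1 : tdistK (ℓ := ℓ) (Mh := Mh) (k := k) (P := P') y.1.2 (blk ((ℓ + 1) ^ k) x.1)
      ≤ (geomT D).dist y ⟨(k, blk ((ℓ + 1) ^ k) x.1), hp₀D⟩ :=
    tdistK_le_distT_of_top D hMh hP (y := y) (u := ⟨(k, blk ((ℓ + 1) ^ k) x.1), hp₀D⟩) hy rfl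
  have hc2 : tdistK (ℓ := ℓ) (Mh := Mh) (k := k) (P := P') (blk ((ℓ + 1) ^ k) z.1) y'.1.2
      ≤ (geomT D').dist ⟨(k, blk ((ℓ + 1) ^ k) z.1), hq₀D'⟩ y' :=
    tdistK_le_distT_of_top D' hMh hP (y := ⟨(k, blk ((ℓ + 1) ^ k) z.1), hq₀D'⟩) (u := y') rfl hy'
  have hchain : dOmega D D' y.1.2 y'.1.2 ≤ (geomT D).dist y ⟨(k, blk ((ℓ + 1) ^ k) x.1), hp₀D⟩
      + dOmega D D' (blk ((ℓ + 1) ^ k) x.1) (blk ((ℓ + 1) ^ k) z.1) + (geomT D').dist ⟨(k, blk ((ℓ + 1) ^ k) z.1), hq₀D'⟩ y' := by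
    have h1 := dOmega_le_tdistK_add D D' y.1.2 (blk ((ℓ + 1) ^ k) x.1) y'.1.2
    have h2 := dOmega_le_add_tdistK D D' (blk ((ℓ + 1) ^ k) x.1) (blk ((ℓ + 1) ^ k) z.1) y'.1.2
    linarith
  -- the exponent budget (the non-negativity facts stay local: hypotheses `0 ≤ dOmega …` in the context make `positivity` unfold them)
  have hexp : Real.exp (-(δ * min ((geomT D).dist ⟨(k, blk ((ℓ + 1) ^ k) x.1), hp₀D⟩ ⟨(k, blk ((ℓ + 1) ^ k) z.1), hq₀D⟩)
        ((geomT D').dist ⟨(k, blk ((ℓ + 1) ^ k) x.1), hp₀D'⟩ ⟨(k, blk ((ℓ + 1) ^ k) z.1), hq₀D'⟩)))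
      * Real.exp (-(δ * dOmega D D' (blk ((ℓ + 1) ^ k) x.1) (blk ((ℓ + 1) ^ k) z.1)))
      * Real.exp (-(δ * (geomT D').dist ⟨(k, blk ((ℓ + 1) ^ k) z.1), hq₀D'⟩ y'))
      ≤ (Real.exp (1 / 2 * δ * (geomT D).dist y ⟨(k, blk ((ℓ + 1) ^ k) x.1), hp₀D⟩) * Real.exp (-(1 / 2 * δ * dOmega D D' y.1.2 y'.1.2)))
        * Real.exp (-(1 / 4 * δ * (geomT D').dist y' ⟨(k, blk ((ℓ + 1) ^ k) z.1), hq₀D'⟩)) := by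
    have hm0 : 0 ≤ min ((geomT D).dist ⟨(k, blk ((ℓ + 1) ^ k) x.1), hp₀D⟩ ⟨(k, blk ((ℓ + 1) ^ k) z.1), hq₀D⟩)
        ((geomT D').dist ⟨(k, blk ((ℓ + 1) ^ k) x.1), hp₀D'⟩ ⟨(k, blk ((ℓ + 1) ^ k) z.1), hq₀D'⟩) := le_min (hd0 _ _) (hd0' _ _)
    have hΩ0 : 0 ≤ dOmega D D' (blk ((ℓ + 1) ^ k) x.1) (blk ((ℓ + 1) ^ k) z.1) := dOmega_nonneg D D' _ _
    have hd'0 : 0 ≤ (geomT D').dist ⟨(k, blk ((ℓ + 1) ^ k) z.1), hq₀D'⟩ y' := hd0' _ _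
    have hsy : (geomT D').dist y' ⟨(k, blk ((ℓ + 1) ^ k) z.1), hq₀D'⟩ = (geomT D').dist ⟨(k, blk ((ℓ + 1) ^ k) z.1), hq₀D'⟩ y' :=
      B8Ineq192MultiLevelTorus.symmT D' _ _
    rw [hsy, ← Real.exp_add, ← Real.exp_add, ← Real.exp_add, ← Real.exp_add]
    refine Real.exp_le_exp.2 ?_
    have e1 := mul_le_mul_of_nonneg_left hchain hδ
    have e2 := mul_nonneg hδ hm0
    have e3 := mul_nonneg hδ hΩ0
    have e4 := mul_nonneg hδ hd'0
    rw [mul_add, mul_add] at e1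
    linarith
  have hR1 := le_trans (abs_nonneg _) hdiff
  calc cf ^ 2 * |dPd D f.dir v.dir x z - dPd D' f.dir v.dir x z| * |g v|
      ≤ cf ^ 2 * (CΔ * ((((ℓ : ℝ) + 1) ^ k) ^ 2)⁻¹ * ((((ℓ : ℝ) + 1) ^ k) ^ (d + 1))⁻¹
          * Real.exp (-(δ * min ((geomT D).dist ⟨(k, blk ((ℓ + 1) ^ k) x.1), hp₀D⟩ ⟨(k, blk ((ℓ + 1) ^ k) z.1), hq₀D⟩)
              ((geomT D').dist ⟨(k, blk ((ℓ + 1) ^ k) x.1), hp₀D'⟩ ⟨(k, blk ((ℓ + 1) ^ k) z.1), hq₀D'⟩)))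
          * Real.exp (-(δ * dOmega D D' (blk ((ℓ + 1) ^ k) x.1) (blk ((ℓ + 1) ^ k) z.1))))
        * (A * pref cf (D := D') ⟨(k, blk ((ℓ + 1) ^ k) z.1), hq₀D'⟩
          * Real.exp (-(δ * (geomT D').dist ⟨(k, blk ((ℓ + 1) ^ k) z.1), hq₀D'⟩ y')) * B) :=
        mul_le_mul (mul_le_mul_of_nonneg_left hdiff (sq_nonneg cf)) h2 (abs_nonneg _) (mul_nonneg (sq_nonneg cf) hR1)
    _ = ((((ℓ : ℝ) + 1) ^ k) ^ (d + 1))⁻¹ * (A * B * CΔ) * (((((ℓ : ℝ) + 1) ^ k) ^ 2)⁻¹ * (cf ^ 2 * pref cf (D := D') ⟨(k, blk ((ℓ + 1) ^ k) z.1), hq₀D'⟩))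
        * (Real.exp (-(δ * min ((geomT D).dist ⟨(k, blk ((ℓ + 1) ^ k) x.1), hp₀D⟩ ⟨(k, blk ((ℓ + 1) ^ k) z.1), hq₀D⟩)
              ((geomT D').dist ⟨(k, blk ((ℓ + 1) ^ k) x.1), hp₀D'⟩ ⟨(k, blk ((ℓ + 1) ^ k) z.1), hq₀D'⟩)))
          * Real.exp (-(δ * dOmega D D' (blk ((ℓ + 1) ^ k) x.1) (blk ((ℓ + 1) ^ k) z.1)))
          * Real.exp (-(δ * (geomT D').dist ⟨(k, blk ((ℓ + 1) ^ k) z.1), hq₀D'⟩ y'))) := by ring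
    _ ≤ ((((ℓ : ℝ) + 1) ^ k) ^ (d + 1))⁻¹ * (A * B * CΔ) * 1
        * ((Real.exp (1 / 2 * δ * (geomT D).dist y ⟨(k, blk ((ℓ + 1) ^ k) x.1), hp₀D⟩) * Real.exp (-(1 / 2 * δ * dOmega D D' y.1.2 y'.1.2)))
          * Real.exp (-(1 / 4 * δ * (geomT D').dist y' ⟨(k, blk ((ℓ + 1) ^ k) z.1), hq₀D'⟩))) := by
        have hX : ((((ℓ : ℝ) + 1) ^ k) ^ 2)⁻¹ * (cf ^ 2 * pref cf (D := D') ⟨(k, blk ((ℓ + 1) ^ k) z.1), hq₀D'⟩) = 1 := by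
          rw [hpref]; exact inv_mul_cancel₀ (by positivity)
        rw [hX]
        exact mul_le_mul_of_nonneg_left hexp (mul_nonneg (mul_nonneg (inv_nonneg.2 hWpos.le) (mul_nonneg (mul_nonneg hA hB) hCΔ)) zero_le_one)
    _ = _ := by rw [hW']; ring

/-- the witness of a pair which is not a (CT) pair: one of the two `k`-lattice points lies in `Ωᶜ ∩ T^{(k)}`.
[cite: Balaban1985BackgroundPropagators, Thm 3.14 p.427 («at least one of localizations X_i intersects Ωᶜ»)] -/
theorem witness_of_not_pairCT {x z : ↥(boxDom (N0 ℓ Mh k P'))}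
    (hw : ¬ ((D.lev x.1 = k ∧ D'.lev x.1 = k) ∧ (D.lev z.1 = k ∧ D'.lev z.1 = k))) :
    blk ((ℓ + 1) ^ k) x.1 ∈ OmegaC D D' ∨ blk ((ℓ + 1) ^ k) z.1 ∈ OmegaC D D' := by
  by_cases hx : D.lev x.1 = k ∧ D'.lev x.1 = k
  · exact Or.inr (blk_mem_OmegaC D D' fun hz => hw ⟨hx, hz⟩)
  · exact Or.inl (blk_mem_OmegaC D D' hx)

/-- **(¬CT) PAIRS, THE KERNEL OF `{Ω_j}`**: the term `c_f²·|(∂P[Ω]∂*)(x, v)|·|g(v)|` is at most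
`W(y(v))⁻¹·A·B·C_P·e^{2δ}·(L^{2k}/L^{2j(p)})·e^{½δd(y,p)}·e^{−½δd(y,y′,Ω)}·e^{−¼δd(p, y(v))}` — (3.49)₄ for `P[Ω]`, the profile of `g`,
and the witness chain `d(y,y′,Ω) ≤ (d(y,p)+1) + (d(p,y(v))+2) + (d′(y′(v),y′)+1)` through the point of `Ωᶜ` among `x₁, v₁`.
[cite: Balaban1985BackgroundPropagators, Thm 3.14 (3.154) p.427, (3.49) p.399; Balaban1984PropagatorsII, (2.88) p.238] -/
theorem termD_le (hMh : 1 ≤ Mh) (hP : ∀ μ, 1 ≤ P' μ) {δ CP A B cf : ℝ} (hδ : 0 ≤ δ) (hcf : cf ≠ 0) (hCP : 0 ≤ CP)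
    (hA : 0 ≤ A) (hB : 0 ≤ B)
    (hPD : ∀ (μ ν : Fin (d + 1)) (x x' : ↥(boxDom (N0 ℓ Mh k P'))),
      |dPd D μ ν x x'| ≤ CP * ((((ℓ : ℝ) + 1) ^ D.lev x.1) ^ 2)⁻¹ * (W D.toDomains (blkOf D.toDomains x'))⁻¹ *
        Real.exp (-(δ * (geomT D).dist (blkOf D.toDomains x) (blkOf D.toDomains x'))))
    {y : ↥(bset D.toDomains)} (hy : y.1.1 = k) {y' : ↥(bset D'.toDomains)} (hy' : y'.1.1 = k)
    {g : PBond (PV d ℓ m K hd hL) 0 → ℝ}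
    (hg : ∀ v, |g v| ≤ A * pref cf (blkV1 hN D' v) * Real.exp (-(δ * (geomT D').dist (blkV1 hN D' v) y')) * B)
    (f v : PBond (PV d ℓ m K hd hL) 0)
    (hw : ¬ ((D.lev (toBox hN f.src).1 = k ∧ D'.lev (toBox hN f.src).1 = k) ∧ (D.lev (toBox hN v.src).1 = k ∧ D'.lev (toBox hN v.src).1 = k))) :
    cf ^ 2 * |dPd D f.dir v.dir (toBox hN f.src) (toBox hN v.src)| * |g v|
      ≤ (W D.toDomains (blkV1 hN D v))⁻¹ * (A * B * CP * Real.exp (2 * δ)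
          * (((ℓ : ℝ) + 1) ^ (2 * k) / ((ℓ : ℝ) + 1) ^ (2 * (blkV1 hN D f).1.1))
          * (Real.exp (1 / 2 * δ * (geomT D).dist y (blkV1 hN D f)) * Real.exp (-(1 / 2 * δ * dOmega D D' y.1.2 y'.1.2)))
          * Real.exp (-(1 / 4 * δ * (geomT D).dist (blkV1 hN D f) (blkV1 hN D v)))) := by
  have hd0 : ∀ s t : ↥(bset D.toDomains), 0 ≤ (geomT D).dist s t := (B6Geom246MultiLevelTorus.triangle_refl_nonneg_T D hMh hP).2.2
  have hd0' : ∀ s t : ↥(bset D'.toDomains), 0 ≤ (geomT D').dist s t :=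
    (B6Geom246MultiLevelTorus.triangle_refl_nonneg_T D' hMh hP).2.2
  have hL1 : (1 : ℝ) ≤ (ℓ : ℝ) + 1 := by linarith [(Nat.cast_nonneg ℓ : (0 : ℝ) ≤ ℓ)]
  set x := toBox hN f.src with hx
  set z := toBox hN v.src with hz
  have h1 := hPD f.dir v.dir x z
  have h2 := hg v
  have hlev : D.lev x.1 = (blkV1 hN D f).1.1 := rfl
  rw [hlev] at h1
  have hWq : 0 < W D.toDomains (blkV1 hN D v) := W_pos _ _
  have hpref : cf ^ 2 * pref cf (blkV1 hN D' v) ≤ (((ℓ : ℝ) + 1) ^ k) ^ 2 := by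
    rw [sq_mul_pref D' hcf]; exact powLev_sq_le D' _
  have hratio : (((ℓ : ℝ) + 1) ^ k) ^ 2 * ((((ℓ : ℝ) + 1) ^ (blkV1 hN D f).1.1) ^ 2)⁻¹
      = ((ℓ : ℝ) + 1) ^ (2 * k) / ((ℓ : ℝ) + 1) ^ (2 * (blkV1 hN D f).1.1) := by
    rw [← pow_mul, ← pow_mul, mul_comm k 2, mul_comm (blkV1 hN D f).1.1 2, div_eq_mul_inv]
  -- the witness chain
  have hc := dOmega_le_chain D D' (witness_of_not_pairCT D D' hw) y.1.2 y'.1.2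
  have t1 : tdistK (ℓ := ℓ) (Mh := Mh) (k := k) (P := P') y.1.2 (blk ((ℓ + 1) ^ k) x.1) ≤ (geomT D).dist y (blkV1 hN D f) + 1 := by
    rw [tdistK_comm]
    have h := tdistK_blk_le_of_top D hMh hP x hy
    rw [B8Ineq192MultiLevelTorus.symmT D] at h
    exact h
  have t2 : tdistK (ℓ := ℓ) (Mh := Mh) (k := k) (P := P') (blk ((ℓ + 1) ^ k) x.1) (blk ((ℓ + 1) ^ k) z.1)
      ≤ (geomT D).dist (blkV1 hN D f) (blkV1 hN D v) + 2 := tdistK_blk_blk_le D hMh hP x z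
  have t3 : tdistK (ℓ := ℓ) (Mh := Mh) (k := k) (P := P') (blk ((ℓ + 1) ^ k) z.1) y'.1.2 ≤ (geomT D').dist (blkV1 hN D' v) y' + 1 :=
    tdistK_blk_le_of_top D' hMh hP z hy'
  have hchain : dOmega D D' y.1.2 y'.1.2
      ≤ (geomT D).dist y (blkV1 hN D f) + (geomT D).dist (blkV1 hN D f) (blkV1 hN D v) + (geomT D').dist (blkV1 hN D' v) y' + 4 := by
    linarith
  -- the exponent budget
  have hexp : Real.exp (-(δ * (geomT D).dist (blkV1 hN D f) (blkV1 hN D v))) * Real.exp (-(δ * (geomT D').dist (blkV1 hN D' v) y'))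
      ≤ Real.exp (2 * δ) * (Real.exp (1 / 2 * δ * (geomT D).dist y (blkV1 hN D f)) * Real.exp (-(1 / 2 * δ * dOmega D D' y.1.2 y'.1.2)))
        * Real.exp (-(1 / 4 * δ * (geomT D).dist (blkV1 hN D f) (blkV1 hN D v))) := by
    rw [← Real.exp_add, ← Real.exp_add, ← Real.exp_add, ← Real.exp_add]
    refine Real.exp_le_exp.2 ?_
    have e1 := mul_le_mul_of_nonneg_left hchain hδ
    have e2 := mul_nonneg hδ (hd0 (blkV1 hN D f) (blkV1 hN D v))
    have e3 := mul_nonneg hδ (hd0' (blkV1 hN D' v) y')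
    rw [mul_add, mul_add, mul_add] at e1
    linarith
  have hR1 := le_trans (abs_nonneg _) h1
  have hE0 : 0 ≤ Real.exp (2 * δ) * (Real.exp (1 / 2 * δ * (geomT D).dist y (blkV1 hN D f))
      * Real.exp (-(1 / 2 * δ * dOmega D D' y.1.2 y'.1.2))) * Real.exp (-(1 / 4 * δ * (geomT D).dist (blkV1 hN D f) (blkV1 hN D v))) := by
    positivity
  calc cf ^ 2 * |dPd D f.dir v.dir x z| * |g v|
      ≤ cf ^ 2 * (CP * ((((ℓ : ℝ) + 1) ^ (blkV1 hN D f).1.1) ^ 2)⁻¹ * (W D.toDomains (blkV1 hN D v))⁻¹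
          * Real.exp (-(δ * (geomT D).dist (blkV1 hN D f) (blkV1 hN D v))))
        * (A * pref cf (blkV1 hN D' v) * Real.exp (-(δ * (geomT D').dist (blkV1 hN D' v) y')) * B) :=
        mul_le_mul (mul_le_mul_of_nonneg_left h1 (sq_nonneg cf)) h2 (abs_nonneg _) (mul_nonneg (sq_nonneg cf) hR1)
    _ = (W D.toDomains (blkV1 hN D v))⁻¹ * (A * B * CP) * ((cf ^ 2 * pref cf (blkV1 hN D' v)) * ((((ℓ : ℝ) + 1) ^ (blkV1 hN D f).1.1) ^ 2)⁻¹)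
        * (Real.exp (-(δ * (geomT D).dist (blkV1 hN D f) (blkV1 hN D v))) * Real.exp (-(δ * (geomT D').dist (blkV1 hN D' v) y'))) := by
        ring
    _ ≤ (W D.toDomains (blkV1 hN D v))⁻¹ * (A * B * CP) * ((((ℓ : ℝ) + 1) ^ k) ^ 2 * ((((ℓ : ℝ) + 1) ^ (blkV1 hN D f).1.1) ^ 2)⁻¹)
        * (Real.exp (-(δ * (geomT D).dist (blkV1 hN D f) (blkV1 hN D v))) * Real.exp (-(δ * (geomT D').dist (blkV1 hN D' v) y'))) := by
        have h0 : 0 ≤ (W D.toDomains (blkV1 hN D v))⁻¹ * (A * B * CP) := by positivity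
        exact mul_le_mul_of_nonneg_right (mul_le_mul_of_nonneg_left (mul_le_mul_of_nonneg_right hpref (by positivity)) h0)
          (by positivity)
    _ ≤ (W D.toDomains (blkV1 hN D v))⁻¹ * (A * B * CP) * ((((ℓ : ℝ) + 1) ^ k) ^ 2 * ((((ℓ : ℝ) + 1) ^ (blkV1 hN D f).1.1) ^ 2)⁻¹)
        * (Real.exp (2 * δ) * (Real.exp (1 / 2 * δ * (geomT D).dist y (blkV1 hN D f)) * Real.exp (-(1 / 2 * δ * dOmega D D' y.1.2 y'.1.2)))
          * Real.exp (-(1 / 4 * δ * (geomT D).dist (blkV1 hN D f) (blkV1 hN D v)))) :=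
        mul_le_mul_of_nonneg_left hexp (by positivity)
    _ = _ := by rw [hratio]; ring

/-- **(¬CT) PAIRS, THE KERNEL OF `{Ω′_j}`**: the term `c_f²·|(∂P[Ω′]∂*)(x, v)|·|g(v)|` is at most
`W′(y′(v))⁻¹·A·B·C_P·L²·e^{2δ}·e^{½δd(y,p)}·e^{−½δd(y,y′,Ω)}·e^{−¼δd′(p′, y′(v))}` (`p′ = y′(x)`) — (3.49)₄ for `P[Ω′]`, the profile of `g`,
the scale transfer (2.60) `(L^{2k}/L^{2j(p′)})e^{−¼δd′(p′,y′)} ≤ L²` in `{Ω′_j}`, and the witness chain.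
[cite: Balaban1985BackgroundPropagators, Thm 3.14 (3.154) p.427, (3.49) p.399; Balaban1984PropagatorsII, (2.60) p.234, (2.88) p.238] -/
theorem termD'_le (hMh : 1 ≤ Mh) (hP : ∀ μ, 1 ≤ P' μ) (hRM : 1 ≤ R * ((ℓ + 1) * Mh)) {δ CP A B cf : ℝ} (hδ : 0 ≤ δ) (hcf : cf ≠ 0)
    (hCP : 0 ≤ CP) (hA : 0 ≤ A) (hB : 0 ≤ B)
    (hthr : ((ℓ : ℝ) + 1) ^ 2 ≤ Real.exp (1 / 4 * δ * ((R : ℝ) * (((ℓ : ℝ) + 1) * Mh) - 1)))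
    (hPD' : ∀ (μ ν : Fin (d + 1)) (x x' : ↥(boxDom (N0 ℓ Mh k P'))),
      |dPd D' μ ν x x'| ≤ CP * ((((ℓ : ℝ) + 1) ^ D'.lev x.1) ^ 2)⁻¹ * (W D'.toDomains (blkOf D'.toDomains x'))⁻¹ *
        Real.exp (-(δ * (geomT D').dist (blkOf D'.toDomains x) (blkOf D'.toDomains x'))))
    {y : ↥(bset D.toDomains)} (hy : y.1.1 = k) {y' : ↥(bset D'.toDomains)} (hy' : y'.1.1 = k)
    {g : PBond (PV d ℓ m K hd hL) 0 → ℝ}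
    (hg : ∀ v, |g v| ≤ A * pref cf (blkV1 hN D' v) * Real.exp (-(δ * (geomT D').dist (blkV1 hN D' v) y')) * B)
    (f v : PBond (PV d ℓ m K hd hL) 0)
    (hw : ¬ ((D.lev (toBox hN f.src).1 = k ∧ D'.lev (toBox hN f.src).1 = k) ∧ (D.lev (toBox hN v.src).1 = k ∧ D'.lev (toBox hN v.src).1 = k))) :
    cf ^ 2 * |dPd D' f.dir v.dir (toBox hN f.src) (toBox hN v.src)| * |g v|
      ≤ (W D'.toDomains (blkV1 hN D' v))⁻¹ * (A * B * CP * ((ℓ : ℝ) + 1) ^ 2 * Real.exp (2 * δ)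
          * (Real.exp (1 / 2 * δ * (geomT D).dist y (blkV1 hN D f)) * Real.exp (-(1 / 2 * δ * dOmega D D' y.1.2 y'.1.2)))
          * Real.exp (-(1 / 4 * δ * (geomT D').dist (blkV1 hN D' f) (blkV1 hN D' v)))) := by
  have hd0 : ∀ s t : ↥(bset D.toDomains), 0 ≤ (geomT D).dist s t := (B6Geom246MultiLevelTorus.triangle_refl_nonneg_T D hMh hP).2.2
  have hd0' : ∀ s t : ↥(bset D'.toDomains), 0 ≤ (geomT D').dist s t :=
    (B6Geom246MultiLevelTorus.triangle_refl_nonneg_T D' hMh hP).2.2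
  have htri' := B8Ineq192MultiLevelTorus.triangleTB D' hMh hP
  have hL1 : (1 : ℝ) ≤ (ℓ : ℝ) + 1 := by linarith [(Nat.cast_nonneg ℓ : (0 : ℝ) ≤ ℓ)]
  set x := toBox hN f.src with hx
  set z := toBox hN v.src with hz
  have h1 := hPD' f.dir v.dir x z
  have h2 := hg v
  have hlev : D'.lev x.1 = (blkV1 hN D' f).1.1 := rfl
  rw [hlev] at h1
  have hWq : 0 < W D'.toDomains (blkV1 hN D' v) := W_pos _ _
  -- scale factors: `(L^{j′(v)})²/(L^{j′(x)})² ≤ L^{2k}/L^{2j′(x)}`, then the transfer in `{Ω′_j}`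
  have hpref : cf ^ 2 * pref cf (blkV1 hN D' v) ≤ (((ℓ : ℝ) + 1) ^ k) ^ 2 := by
    rw [sq_mul_pref D' hcf]; exact powLev_sq_le D' _
  have hratio : (((ℓ : ℝ) + 1) ^ k) ^ 2 * ((((ℓ : ℝ) + 1) ^ (blkV1 hN D' f).1.1) ^ 2)⁻¹
      = ((ℓ : ℝ) + 1) ^ (2 * k) / ((ℓ : ℝ) + 1) ^ (2 * (blkV1 hN D' f).1.1) := by
    rw [← pow_mul, ← pow_mul, mul_comm k 2, mul_comm (blkV1 hN D' f).1.1 2, div_eq_mul_inv]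
  have htr := transfer_top D' hMh hP hRM hδ hthr (blkV1 hN D' f) y' hy'
  -- the witness chain
  have hc := dOmega_le_chain D D' (witness_of_not_pairCT D D' hw) y.1.2 y'.1.2
  have t1 : tdistK (ℓ := ℓ) (Mh := Mh) (k := k) (P := P') y.1.2 (blk ((ℓ + 1) ^ k) x.1) ≤ (geomT D).dist y (blkV1 hN D f) + 1 := by
    rw [tdistK_comm]
    have h := tdistK_blk_le_of_top D hMh hP x hy
    rw [B8Ineq192MultiLevelTorus.symmT D] at h
    exact h
  have t2 : tdistK (ℓ := ℓ) (Mh := Mh) (k := k) (P := P') (blk ((ℓ + 1) ^ k) x.1) (blk ((ℓ + 1) ^ k) z.1)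
      ≤ (geomT D').dist (blkV1 hN D' f) (blkV1 hN D' v) + 2 := tdistK_blk_blk_le D' hMh hP x z
  have t3 : tdistK (ℓ := ℓ) (Mh := Mh) (k := k) (P := P') (blk ((ℓ + 1) ^ k) z.1) y'.1.2 ≤ (geomT D').dist (blkV1 hN D' v) y' + 1 :=
    tdistK_blk_le_of_top D' hMh hP z hy'
  have hchain : dOmega D D' y.1.2 y'.1.2
      ≤ (geomT D).dist y (blkV1 hN D f) + (geomT D').dist (blkV1 hN D' f) (blkV1 hN D' v) + (geomT D').dist (blkV1 hN D' v) y' + 4 := by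
    linarith
  have htri : (geomT D').dist (blkV1 hN D' f) y' ≤ (geomT D').dist (blkV1 hN D' f) (blkV1 hN D' v) + (geomT D').dist (blkV1 hN D' v) y' :=
    htri' _ _ _
  -- the exponent budget: a quarter to the transfer, a half to the chain, a quarter of `d′(p′, y′(v))` kept
  set a := (geomT D').dist (blkV1 hN D' f) (blkV1 hN D' v) with ha
  set b := (geomT D').dist (blkV1 hN D' v) y' with hb
  have ha0 : 0 ≤ a := hd0' _ _
  have hb0 : 0 ≤ b := hd0' _ _
  have hsplit : Real.exp (-(δ * a)) * Real.exp (-(δ * b))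
      = Real.exp (-(1 / 4 * δ * (a + b))) * Real.exp (-(1 / 2 * δ * (a + b))) * Real.exp (-(1 / 4 * δ * a)) * Real.exp (-(1 / 4 * δ * b)) := by
    rw [← Real.exp_add, ← Real.exp_add, ← Real.exp_add, ← Real.exp_add]
    congr 1; ring
  have hA' : ((ℓ : ℝ) + 1) ^ (2 * k) / ((ℓ : ℝ) + 1) ^ (2 * (blkV1 hN D' f).1.1) * Real.exp (-(1 / 4 * δ * (a + b))) ≤ ((ℓ : ℝ) + 1) ^ 2 := by
    refine le_trans (mul_le_mul_of_nonneg_left (Real.exp_le_exp.2 ?_) (by positivity)) htr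
    have := mul_le_mul_of_nonneg_left htri hδ
    linarith
  have hB' : Real.exp (-(1 / 2 * δ * (a + b)))
      ≤ Real.exp (2 * δ) * (Real.exp (1 / 2 * δ * (geomT D).dist y (blkV1 hN D f)) * Real.exp (-(1 / 2 * δ * dOmega D D' y.1.2 y'.1.2))) := by
    rw [← Real.exp_add, ← Real.exp_add]
    refine Real.exp_le_exp.2 ?_
    have e1 := mul_le_mul_of_nonneg_left hchain hδ
    rw [mul_add, mul_add, mul_add] at e1
    linarith
  have hC' : Real.exp (-(1 / 4 * δ * b)) ≤ 1 := Real.exp_le_one_iff.2 (by nlinarith)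
  have hkey : ((ℓ : ℝ) + 1) ^ (2 * k) / ((ℓ : ℝ) + 1) ^ (2 * (blkV1 hN D' f).1.1) * (Real.exp (-(δ * a)) * Real.exp (-(δ * b)))
      ≤ ((ℓ : ℝ) + 1) ^ 2 * (Real.exp (2 * δ) * (Real.exp (1 / 2 * δ * (geomT D).dist y (blkV1 hN D f))
          * Real.exp (-(1 / 2 * δ * dOmega D D' y.1.2 y'.1.2)))) * Real.exp (-(1 / 4 * δ * a)) * 1 := by
    rw [hsplit]
    calc ((ℓ : ℝ) + 1) ^ (2 * k) / ((ℓ : ℝ) + 1) ^ (2 * (blkV1 hN D' f).1.1)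
          * (Real.exp (-(1 / 4 * δ * (a + b))) * Real.exp (-(1 / 2 * δ * (a + b))) * Real.exp (-(1 / 4 * δ * a)) * Real.exp (-(1 / 4 * δ * b)))
        = (((ℓ : ℝ) + 1) ^ (2 * k) / ((ℓ : ℝ) + 1) ^ (2 * (blkV1 hN D' f).1.1) * Real.exp (-(1 / 4 * δ * (a + b))))
          * Real.exp (-(1 / 2 * δ * (a + b))) * Real.exp (-(1 / 4 * δ * a)) * Real.exp (-(1 / 4 * δ * b)) := by ring
      _ ≤ ((ℓ : ℝ) + 1) ^ 2 * (Real.exp (2 * δ) * (Real.exp (1 / 2 * δ * (geomT D).dist y (blkV1 hN D f))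
          * Real.exp (-(1 / 2 * δ * dOmega D D' y.1.2 y'.1.2)))) * Real.exp (-(1 / 4 * δ * a)) * 1 := by
          refine mul_le_mul ?_ hC' (by positivity) (by positivity)
          refine mul_le_mul_of_nonneg_right ?_ (by positivity)
          exact mul_le_mul hA' hB' (by positivity) (by positivity)
  have hR1 := le_trans (abs_nonneg _) h1
  calc cf ^ 2 * |dPd D' f.dir v.dir x z| * |g v|
      ≤ cf ^ 2 * (CP * ((((ℓ : ℝ) + 1) ^ (blkV1 hN D' f).1.1) ^ 2)⁻¹ * (W D'.toDomains (blkV1 hN D' v))⁻¹ * Real.exp (-(δ * a)))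
        * (A * pref cf (blkV1 hN D' v) * Real.exp (-(δ * b)) * B) :=
        mul_le_mul (mul_le_mul_of_nonneg_left h1 (sq_nonneg cf)) h2 (abs_nonneg _) (mul_nonneg (sq_nonneg cf) hR1)
    _ = (W D'.toDomains (blkV1 hN D' v))⁻¹ * (A * B * CP) * ((cf ^ 2 * pref cf (blkV1 hN D' v)) * ((((ℓ : ℝ) + 1) ^ (blkV1 hN D' f).1.1) ^ 2)⁻¹)
        * (Real.exp (-(δ * a)) * Real.exp (-(δ * b))) := by ring
    _ ≤ (W D'.toDomains (blkV1 hN D' v))⁻¹ * (A * B * CP) * ((((ℓ : ℝ) + 1) ^ k) ^ 2 * ((((ℓ : ℝ) + 1) ^ (blkV1 hN D' f).1.1) ^ 2)⁻¹)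
        * (Real.exp (-(δ * a)) * Real.exp (-(δ * b))) := by
        have h0 : 0 ≤ (W D'.toDomains (blkV1 hN D' v))⁻¹ * (A * B * CP) := by positivity
        exact mul_le_mul_of_nonneg_right (mul_le_mul_of_nonneg_left (mul_le_mul_of_nonneg_right hpref (by positivity)) h0)
          (by positivity)
    _ = (W D'.toDomains (blkV1 hN D' v))⁻¹ * (A * B * CP)
        * (((ℓ : ℝ) + 1) ^ (2 * k) / ((ℓ : ℝ) + 1) ^ (2 * (blkV1 hN D' f).1.1) * (Real.exp (-(δ * a)) * Real.exp (-(δ * b)))) := by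
        rw [hratio]; ring
    _ ≤ (W D'.toDomains (blkV1 hN D' v))⁻¹ * (A * B * CP)
        * (((ℓ : ℝ) + 1) ^ 2 * (Real.exp (2 * δ) * (Real.exp (1 / 2 * δ * (geomT D).dist y (blkV1 hN D f))
          * Real.exp (-(1 / 2 * δ * dOmega D D' y.1.2 y'.1.2)))) * Real.exp (-(1 / 4 * δ * a)) * 1) :=
        mul_le_mul_of_nonneg_left hkey (by positivity)
    _ = _ := by ring


/-- **THE `∂P∂*` LETTER BETWEEN THE TWO RESOLVENT FACTORS, AT ONE FINE BOND** (the three sums, each closed by (2.61) in its family after the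
fibre count of §3): with `p = y(x)` the block of `f` in `{Ω_j}`,
`|(V_P g)(f)| ≤ (d+1)·c·(C_Δ + C_P e^{2δ}(1 + L²))·A·B·(L^{2k}/L^{2j(p)})·e^{½δd(y,p)}·e^{−½δd(y,y′,Ω)}`.
[cite: Balaban1985BackgroundPropagators, Thm 3.14 (3.154) p.427; Balaban1984PropagatorsII, (2.22) p.226, (2.61) p.234, (2.88) p.238] -/
theorem abs_VP_apply_le (hMh : 1 ≤ Mh) (hP : ∀ μ, 1 ≤ P' μ) (hRM : 1 ≤ R * ((ℓ + 1) * Mh)) {δ c CΔ CP A B cf : ℝ} (hδ : 0 ≤ δ)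
    (hcf : cf ≠ 0) (hCΔ : 0 ≤ CΔ) (hCP : 0 ≤ CP) (hA : 0 ≤ A) (hB : 0 ≤ B) (hc : 0 ≤ c)
    (hthr : ((ℓ : ℝ) + 1) ^ 2 ≤ Real.exp (1 / 4 * δ * ((R : ℝ) * (((ℓ : ℝ) + 1) * Mh) - 1)))
    (h261 : Ineq261With c (geomT D) δ (1 / 4)) (h261' : Ineq261With c (geomT D') δ (1 / 4))
    (hΔ : ∀ (p q : ℕ × (Fin (d + 1) → ℤ)) (hpD : p ∈ bset D.toDomains) (hpD' : p ∈ bset D'.toDomains)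
      (hqD : q ∈ bset D.toDomains) (hqD' : q ∈ bset D'.toDomains), p.1 = k → q.1 = k →
      ∀ (x x' : ↥(boxDom (N0 ℓ Mh k P'))), blkOf D.toDomains x = ⟨p, hpD⟩ → blkOf D.toDomains x' = ⟨q, hqD⟩ →
      ∀ μ ν : Fin (d + 1), |dPd D μ ν x x' - dPd D' μ ν x x'|
        ≤ CΔ * ((((ℓ : ℝ) + 1) ^ k) ^ 2)⁻¹ * ((((ℓ : ℝ) + 1) ^ k) ^ (d + 1))⁻¹
          * Real.exp (-(δ * min ((geomT D).dist ⟨p, hpD⟩ ⟨q, hqD⟩) ((geomT D').dist ⟨p, hpD'⟩ ⟨q, hqD'⟩)))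
          * Real.exp (-(δ * dOmega D D' p.2 q.2)))
    (hPD : ∀ (μ ν : Fin (d + 1)) (x x' : ↥(boxDom (N0 ℓ Mh k P'))),
      |dPd D μ ν x x'| ≤ CP * ((((ℓ : ℝ) + 1) ^ D.lev x.1) ^ 2)⁻¹ * (W D.toDomains (blkOf D.toDomains x'))⁻¹ *
        Real.exp (-(δ * (geomT D).dist (blkOf D.toDomains x) (blkOf D.toDomains x'))))
    (hPD' : ∀ (μ ν : Fin (d + 1)) (x x' : ↥(boxDom (N0 ℓ Mh k P'))),
      |dPd D' μ ν x x'| ≤ CP * ((((ℓ : ℝ) + 1) ^ D'.lev x.1) ^ 2)⁻¹ * (W D'.toDomains (blkOf D'.toDomains x'))⁻¹ *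
        Real.exp (-(δ * (geomT D').dist (blkOf D'.toDomains x) (blkOf D'.toDomains x'))))
    {y : ↥(bset D.toDomains)} (hy : y.1.1 = k) {y' : ↥(bset D'.toDomains)} (hy' : y'.1.1 = k)
    {g : PBond (PV d ℓ m K hd hL) 0 → ℝ}
    (hg : ∀ v, |g v| ≤ A * pref cf (blkV1 hN D' v) * Real.exp (-(δ * (geomT D').dist (blkV1 hN D' v) y')) * B)
    (f : PBond (PV d ℓ m K hd hL) 0) :
    |VP hN D D' cf g f| ≤ ((d : ℝ) + 1) * c * (CΔ + CP * Real.exp (2 * δ) * (1 + ((ℓ : ℝ) + 1) ^ 2)) * A * B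
        * (((ℓ : ℝ) + 1) ^ (2 * k) / ((ℓ : ℝ) + 1) ^ (2 * (blkV1 hN D f).1.1)) * (Real.exp (1 / 2 * δ * (geomT D).dist y (blkV1 hN D f)) * Real.exp (-(1 / 2 * δ * dOmega D D' y.1.2 y'.1.2))) := by
  have hWq : ∀ q : ↥(bset D.toDomains), 0 < W D.toDomains q := fun q => W_pos _ _
  have hWq' : ∀ q : ↥(bset D'.toDomains), 0 < W D'.toDomains q := fun q => W_pos _ _
  have hρ1 : 1 ≤ (((ℓ : ℝ) + 1) ^ (2 * k) / ((ℓ : ℝ) + 1) ^ (2 * (blkV1 hN D f).1.1)) := one_le_ratio D _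
  have hρ0 : 0 ≤ (((ℓ : ℝ) + 1) ^ (2 * k) / ((ℓ : ℝ) + 1) ^ (2 * (blkV1 hN D f).1.1)) := le_trans zero_le_one hρ1
  have hE0 : 0 ≤ (Real.exp (1 / 2 * δ * (geomT D).dist y (blkV1 hN D f)) * Real.exp (-(1 / 2 * δ * dOmega D D' y.1.2 y'.1.2))) := by positivity
  -- the expansion in point masses and the splitting of the pairs
  rw [apply_eq_sum_single (VP hN D D' cf) g f]
  have hT : ∀ v, |VP hN D D' cf (Pi.single v (1 : ℝ)) f * g v|
      ≤ (if ((D.lev (toBox hN f.src).1 = k ∧ D'.lev (toBox hN f.src).1 = k) ∧ (D.lev (toBox hN v.src).1 = k ∧ D'.lev (toBox hN v.src).1 = k)) then cf ^ 2 * |dPd D f.dir v.dir (toBox hN f.src) (toBox hN v.src) - dPd D' f.dir v.dir (toBox hN f.src) (toBox hN v.src)| * |g v|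
          else 0)
        + (if ((D.lev (toBox hN f.src).1 = k ∧ D'.lev (toBox hN f.src).1 = k) ∧ (D.lev (toBox hN v.src).1 = k ∧ D'.lev (toBox hN v.src).1 = k)) then 0 else cf ^ 2 * |dPd D f.dir v.dir (toBox hN f.src) (toBox hN v.src)| * |g v|)
        + (if ((D.lev (toBox hN f.src).1 = k ∧ D'.lev (toBox hN f.src).1 = k) ∧ (D.lev (toBox hN v.src).1 = k ∧ D'.lev (toBox hN v.src).1 = k)) then 0 else cf ^ 2 * |dPd D' f.dir v.dir (toBox hN f.src) (toBox hN v.src)| * |g v|) := by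
    intro v
    rw [VP_single_apply, abs_mul, abs_mul, abs_of_nonneg (sq_nonneg cf)]
    by_cases hct : ((D.lev (toBox hN f.src).1 = k ∧ D'.lev (toBox hN f.src).1 = k) ∧ (D.lev (toBox hN v.src).1 = k ∧ D'.lev (toBox hN v.src).1 = k))
    · simp only [if_pos hct]
      linarith
    · simp only [if_neg hct]
      have hab := abs_sub (dPd D f.dir v.dir (toBox hN f.src) (toBox hN v.src)) (dPd D' f.dir v.dir (toBox hN f.src) (toBox hN v.src))
      have h0 : 0 ≤ cf ^ 2 * |g v| := by positivity
      calc cf ^ 2 * |dPd D f.dir v.dir (toBox hN f.src) (toBox hN v.src) - dPd D' f.dir v.dir (toBox hN f.src) (toBox hN v.src)| * |g v|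
          = (cf ^ 2 * |g v|) * |dPd D f.dir v.dir (toBox hN f.src) (toBox hN v.src) - dPd D' f.dir v.dir (toBox hN f.src) (toBox hN v.src)| := by
            ring
        _ ≤ (cf ^ 2 * |g v|) * (|dPd D f.dir v.dir (toBox hN f.src) (toBox hN v.src)| + |dPd D' f.dir v.dir (toBox hN f.src) (toBox hN v.src)|) :=
            mul_le_mul_of_nonneg_left hab h0
        _ = _ := by ring
  -- the three per-term bounds in fibre form
  have hF1 : ∀ v, (if ((D.lev (toBox hN f.src).1 = k ∧ D'.lev (toBox hN f.src).1 = k) ∧ (D.lev (toBox hN v.src).1 = k ∧ D'.lev (toBox hN v.src).1 = k)) then cf ^ 2 * |dPd D f.dir v.dir (toBox hN f.src) (toBox hN v.src) - dPd D' f.dir v.dir (toBox hN f.src) (toBox hN v.src)| * |g v|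
          else 0)
      ≤ (W D'.toDomains (blkV1 hN D' v))⁻¹ * (A * B * CΔ * (Real.exp (1 / 2 * δ * (geomT D).dist y (blkV1 hN D f)) * Real.exp (-(1 / 2 * δ * dOmega D D' y.1.2 y'.1.2))) * Real.exp (-(1 / 4 * δ * (geomT D').dist y' (blkV1 hN D' v)))) := by
    intro v
    by_cases hct : ((D.lev (toBox hN f.src).1 = k ∧ D'.lev (toBox hN f.src).1 = k) ∧ (D.lev (toBox hN v.src).1 = k ∧ D'.lev (toBox hN v.src).1 = k))
    · rw [if_pos hct]
      exact termCT_le hN D D' hMh hP hδ hcf hCΔ hA hB hΔ hy hy' hg f v hct.1 hct.2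
    · rw [if_neg hct]
      exact mul_nonneg (inv_nonneg.2 (hWq' _).le) (by positivity)
  have hF2 : ∀ v, (if ((D.lev (toBox hN f.src).1 = k ∧ D'.lev (toBox hN f.src).1 = k) ∧ (D.lev (toBox hN v.src).1 = k ∧ D'.lev (toBox hN v.src).1 = k)) then 0 else cf ^ 2 * |dPd D f.dir v.dir (toBox hN f.src) (toBox hN v.src)| * |g v|)
      ≤ (W D.toDomains (blkV1 hN D v))⁻¹ * (A * B * CP * Real.exp (2 * δ) * (((ℓ : ℝ) + 1) ^ (2 * k) / ((ℓ : ℝ) + 1) ^ (2 * (blkV1 hN D f).1.1)) * (Real.exp (1 / 2 * δ * (geomT D).dist y (blkV1 hN D f)) * Real.exp (-(1 / 2 * δ * dOmega D D' y.1.2 y'.1.2)))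
          * Real.exp (-(1 / 4 * δ * (geomT D).dist (blkV1 hN D f) (blkV1 hN D v)))) := by
    intro v
    by_cases hct : ((D.lev (toBox hN f.src).1 = k ∧ D'.lev (toBox hN f.src).1 = k) ∧ (D.lev (toBox hN v.src).1 = k ∧ D'.lev (toBox hN v.src).1 = k))
    · rw [if_pos hct]
      exact mul_nonneg (inv_nonneg.2 (hWq _).le) (by positivity)
    · rw [if_neg hct]
      exact termD_le hN D D' hMh hP hδ hcf hCP hA hB hPD hy hy' hg f v hct
  have hF3 : ∀ v, (if ((D.lev (toBox hN f.src).1 = k ∧ D'.lev (toBox hN f.src).1 = k) ∧ (D.lev (toBox hN v.src).1 = k ∧ D'.lev (toBox hN v.src).1 = k)) then 0 else cf ^ 2 * |dPd D' f.dir v.dir (toBox hN f.src) (toBox hN v.src)| * |g v|)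
      ≤ (W D'.toDomains (blkV1 hN D' v))⁻¹ * (A * B * CP * ((ℓ : ℝ) + 1) ^ 2 * Real.exp (2 * δ) * (Real.exp (1 / 2 * δ * (geomT D).dist y (blkV1 hN D f)) * Real.exp (-(1 / 2 * δ * dOmega D D' y.1.2 y'.1.2)))
          * Real.exp (-(1 / 4 * δ * (geomT D').dist (blkV1 hN D' f) (blkV1 hN D' v)))) := by
    intro v
    by_cases hct : ((D.lev (toBox hN f.src).1 = k ∧ D'.lev (toBox hN f.src).1 = k) ∧ (D.lev (toBox hN v.src).1 = k ∧ D'.lev (toBox hN v.src).1 = k))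
    · rw [if_pos hct]
      exact mul_nonneg (inv_nonneg.2 (hWq' _).le) (by positivity)
    · rw [if_neg hct]
      exact termD'_le hN D D' hMh hP hRM hδ hcf hCP hA hB hthr hPD' hy hy' hg f v hct
  have hS1 := sum_le_of_fibre_bound hN D' _ (fun q' => A * B * CΔ * (Real.exp (1 / 2 * δ * (geomT D).dist y (blkV1 hN D f)) * Real.exp (-(1 / 2 * δ * dOmega D D' y.1.2 y'.1.2))) * Real.exp (-(1 / 4 * δ * (geomT D').dist y' q')))
    (fun q' => by positivity) hF1
  have hS2 := sum_le_of_fibre_bound hN D _ (fun q => A * B * CP * Real.exp (2 * δ) * (((ℓ : ℝ) + 1) ^ (2 * k) / ((ℓ : ℝ) + 1) ^ (2 * (blkV1 hN D f).1.1)) * (Real.exp (1 / 2 * δ * (geomT D).dist y (blkV1 hN D f)) * Real.exp (-(1 / 2 * δ * dOmega D D' y.1.2 y'.1.2)))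
    * Real.exp (-(1 / 4 * δ * (geomT D).dist (blkV1 hN D f) q))) (fun q => by positivity) hF2
  have hS3 := sum_le_of_fibre_bound hN D' _ (fun q' => A * B * CP * ((ℓ : ℝ) + 1) ^ 2 * Real.exp (2 * δ) * (Real.exp (1 / 2 * δ * (geomT D).dist y (blkV1 hN D f)) * Real.exp (-(1 / 2 * δ * dOmega D D' y.1.2 y'.1.2)))
    * Real.exp (-(1 / 4 * δ * (geomT D').dist (blkV1 hN D' f) q'))) (fun q' => by positivity) hF3
  -- (2.61) in each family
  have hG1 : ∑ q' : ↥(bset D'.toDomains), A * B * CΔ * (Real.exp (1 / 2 * δ * (geomT D).dist y (blkV1 hN D f)) * Real.exp (-(1 / 2 * δ * dOmega D D' y.1.2 y'.1.2))) * Real.exp (-(1 / 4 * δ * (geomT D').dist y' q'))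
      ≤ A * B * CΔ * (Real.exp (1 / 2 * δ * (geomT D).dist y (blkV1 hN D f)) * Real.exp (-(1 / 2 * δ * dOmega D D' y.1.2 y'.1.2))) * c := by
    rw [← Finset.mul_sum]
    exact mul_le_mul_of_nonneg_left (h261' y') (by positivity)
  have hG2 : ∑ q : ↥(bset D.toDomains), A * B * CP * Real.exp (2 * δ) * (((ℓ : ℝ) + 1) ^ (2 * k) / ((ℓ : ℝ) + 1) ^ (2 * (blkV1 hN D f).1.1)) * (Real.exp (1 / 2 * δ * (geomT D).dist y (blkV1 hN D f)) * Real.exp (-(1 / 2 * δ * dOmega D D' y.1.2 y'.1.2)))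
      * Real.exp (-(1 / 4 * δ * (geomT D).dist (blkV1 hN D f) q)) ≤ A * B * CP * Real.exp (2 * δ) * (((ℓ : ℝ) + 1) ^ (2 * k) / ((ℓ : ℝ) + 1) ^ (2 * (blkV1 hN D f).1.1)) * (Real.exp (1 / 2 * δ * (geomT D).dist y (blkV1 hN D f)) * Real.exp (-(1 / 2 * δ * dOmega D D' y.1.2 y'.1.2))) * c := by
    rw [← Finset.mul_sum]
    exact mul_le_mul_of_nonneg_left (h261 (blkV1 hN D f)) (by positivity)
  have hG3 : ∑ q' : ↥(bset D'.toDomains), A * B * CP * ((ℓ : ℝ) + 1) ^ 2 * Real.exp (2 * δ) * (Real.exp (1 / 2 * δ * (geomT D).dist y (blkV1 hN D f)) * Real.exp (-(1 / 2 * δ * dOmega D D' y.1.2 y'.1.2)))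
      * Real.exp (-(1 / 4 * δ * (geomT D').dist (blkV1 hN D' f) q')) ≤ A * B * CP * ((ℓ : ℝ) + 1) ^ 2 * Real.exp (2 * δ) * (Real.exp (1 / 2 * δ * (geomT D).dist y (blkV1 hN D f)) * Real.exp (-(1 / 2 * δ * dOmega D D' y.1.2 y'.1.2))) * c := by
    rw [← Finset.mul_sum]
    exact mul_le_mul_of_nonneg_left (h261' (blkV1 hN D' f)) (by positivity)
  have hd1 : (0 : ℝ) ≤ (d : ℝ) + 1 := by positivity
  -- assembling
  refine (Finset.abs_sum_le_sum_abs _ _).trans ?_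
  refine (Finset.sum_le_sum fun v _ => hT v).trans ?_
  rw [Finset.sum_add_distrib, Finset.sum_add_distrib]
  have hfin : ((d : ℝ) + 1) * (A * B * CΔ * (Real.exp (1 / 2 * δ * (geomT D).dist y (blkV1 hN D f)) * Real.exp (-(1 / 2 * δ * dOmega D D' y.1.2 y'.1.2))) * c) + ((d : ℝ) + 1) * (A * B * CP * Real.exp (2 * δ) * (((ℓ : ℝ) + 1) ^ (2 * k) / ((ℓ : ℝ) + 1) ^ (2 * (blkV1 hN D f).1.1)) * (Real.exp (1 / 2 * δ * (geomT D).dist y (blkV1 hN D f)) * Real.exp (-(1 / 2 * δ * dOmega D D' y.1.2 y'.1.2))) * c)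
      + ((d : ℝ) + 1) * (A * B * CP * ((ℓ : ℝ) + 1) ^ 2 * Real.exp (2 * δ) * (Real.exp (1 / 2 * δ * (geomT D).dist y (blkV1 hN D f)) * Real.exp (-(1 / 2 * δ * dOmega D D' y.1.2 y'.1.2))) * c)
      ≤ ((d : ℝ) + 1) * c * (CΔ + CP * Real.exp (2 * δ) * (1 + ((ℓ : ℝ) + 1) ^ 2)) * A * B * (((ℓ : ℝ) + 1) ^ (2 * k) / ((ℓ : ℝ) + 1) ^ (2 * (blkV1 hN D f).1.1)) * (Real.exp (1 / 2 * δ * (geomT D).dist y (blkV1 hN D f)) * Real.exp (-(1 / 2 * δ * dOmega D D' y.1.2 y'.1.2))) := by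
    have hk0 : 0 ≤ ((d : ℝ) + 1) * c * A * B * (Real.exp (1 / 2 * δ * (geomT D).dist y (blkV1 hN D f)) * Real.exp (-(1 / 2 * δ * dOmega D D' y.1.2 y'.1.2))) * (CΔ + CP * Real.exp (2 * δ) * ((ℓ : ℝ) + 1) ^ 2) * ((((ℓ : ℝ) + 1) ^ (2 * k) / ((ℓ : ℝ) + 1) ^ (2 * (blkV1 hN D f).1.1)) - 1) := by
      have : 0 ≤ (((ℓ : ℝ) + 1) ^ (2 * k) / ((ℓ : ℝ) + 1) ^ (2 * (blkV1 hN D f).1.1)) - 1 := by linarith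
      positivity
    have e : ((d : ℝ) + 1) * c * (CΔ + CP * Real.exp (2 * δ) * (1 + ((ℓ : ℝ) + 1) ^ 2)) * A * B * (((ℓ : ℝ) + 1) ^ (2 * k) / ((ℓ : ℝ) + 1) ^ (2 * (blkV1 hN D f).1.1)) * (Real.exp (1 / 2 * δ * (geomT D).dist y (blkV1 hN D f)) * Real.exp (-(1 / 2 * δ * dOmega D D' y.1.2 y'.1.2)))
        - (((d : ℝ) + 1) * (A * B * CΔ * (Real.exp (1 / 2 * δ * (geomT D).dist y (blkV1 hN D f)) * Real.exp (-(1 / 2 * δ * dOmega D D' y.1.2 y'.1.2))) * c) + ((d : ℝ) + 1) * (A * B * CP * Real.exp (2 * δ) * (((ℓ : ℝ) + 1) ^ (2 * k) / ((ℓ : ℝ) + 1) ^ (2 * (blkV1 hN D f).1.1)) * (Real.exp (1 / 2 * δ * (geomT D).dist y (blkV1 hN D f)) * Real.exp (-(1 / 2 * δ * dOmega D D' y.1.2 y'.1.2))) * c)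
          + ((d : ℝ) + 1) * (A * B * CP * ((ℓ : ℝ) + 1) ^ 2 * Real.exp (2 * δ) * (Real.exp (1 / 2 * δ * (geomT D).dist y (blkV1 hN D f)) * Real.exp (-(1 / 2 * δ * dOmega D D' y.1.2 y'.1.2))) * c))
        = ((d : ℝ) + 1) * c * A * B * (Real.exp (1 / 2 * δ * (geomT D).dist y (blkV1 hN D f)) * Real.exp (-(1 / 2 * δ * dOmega D D' y.1.2 y'.1.2))) * (CΔ + CP * Real.exp (2 * δ) * ((ℓ : ℝ) + 1) ^ 2) * ((((ℓ : ℝ) + 1) ^ (2 * k) / ((ℓ : ℝ) + 1) ^ (2 * (blkV1 hN D f).1.1)) - 1) := by ring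
    linarith
  refine le_trans ?_ hfin
  exact add_le_add (add_le_add (hS1.trans (mul_le_mul_of_nonneg_left hG1 hd1)) (hS2.trans (mul_le_mul_of_nonneg_left hG2 hd1)))
    (hS3.trans (mul_le_mul_of_nonneg_left hG3 hd1))

end PPart


/-! ## §5  The `Q*aQ` letter between the two resolvent factors ((2.20)/(2.22)): the surviving index bonds charge only `Ωᶜ`

After FILE A's cancellation (`VQ_apply_eq`) only index bonds which are NOT common top index bonds survive, and such a bond charges only fine
bonds whose `k`-lattice point lies in `Ωᶜ` (`witness_of_not_isCT`); all fine bonds charged by one index bond lie in its tube (§2, torus diameter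
`≤ 2L^k`).  Hence the witness chain of §1 applies to every term of r05's column-mass bound `abs_QsE_apply_le`, and the level profiles are summed
by the geometric series of §3: `Σ_{j ≥ j(p)} L^{−2j} ≤ 2L^{−2j(p)}` for `{Ω_j}` (coverage `j ≥ j(p)`), `Σ_{j ≤ k} L^{2j}/L^{2k} ≤ 2` for `{Ω′_j}`
(coverage in `{Ω′_j}` + the transfer (2.60)). -/

section QPart

variable (hN : ∀ μ, N0 ℓ Mh k P' μ = (PV d ℓ m K hd hL).sitesPerDir 0) (D D' : TDomains d ℓ Mh k P' R) (hk : k ≤ m + K)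

/-- **THE INNER PROFILE THROUGH A TUBE WITNESS**: if the `k`-lattice point of `f` lies in `Ωᶜ` and `f′` is within torus distance `2L^k` of `f`, then
`|g(f′)| ≤ A·B·pref(y′(f′))·e^{(5/2)δ}·e^{½δd(y,p)}·e^{−½δd(y,y′,Ω)}·e^{−½δd′(y′(f′),y′)}` (chain `d(y,y′,Ω) ≤ (d(y,p)+1) + 3 + (d′(y′(f′),y′)+1)`).
[cite: Balaban1985BackgroundPropagators, Thm 3.14 (3.154) p.427; Balaban1984PropagatorsII, (2.136) p.247] -/
theorem gprof_tube (hMh : 1 ≤ Mh) (hP : ∀ μ, 1 ≤ P' μ) {δ A B cf : ℝ} (hδ : 0 ≤ δ) (hA : 0 ≤ A) (hB : 0 ≤ B)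
    {y : ↥(bset D.toDomains)} (hy : y.1.1 = k) {y' : ↥(bset D'.toDomains)} (hy' : y'.1.1 = k)
    {g : PBond (PV d ℓ m K hd hL) 0 → ℝ}
    (hg : ∀ v, |g v| ≤ A * pref cf (blkV1 hN D' v) * Real.exp (-(δ * (geomT D').dist (blkV1 hN D' v) y')) * B)
    (f f' : PBond (PV d ℓ m K hd hL) 0) (hwit : blk ((ℓ + 1) ^ k) (toBox hN f.src).1 ∈ OmegaC D D')
    (hdist : dist (toT (N0 ℓ Mh k P') (toR (toBox hN f.src).1)) (toT (N0 ℓ Mh k P') (toR (toBox hN f'.src).1)) ≤ 2 * (((ℓ + 1) ^ k : ℕ) : ℝ)) :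
    |g f'| ≤ A * B * pref cf (blkV1 hN D' f') * (Real.exp (5 / 2 * δ) * (Real.exp (1 / 2 * δ * (geomT D).dist y (blkV1 hN D f)) * Real.exp (-(1 / 2 * δ * dOmega D D' y.1.2 y'.1.2))))
      * Real.exp (-(1 / 2 * δ * (geomT D').dist (blkV1 hN D' f') y')) := by
  have hd0' : ∀ s t : ↥(bset D'.toDomains), 0 ≤ (geomT D').dist s t :=
    (B6Geom246MultiLevelTorus.triangle_refl_nonneg_T D' hMh hP).2.2
  have h2 := hg f'
  have hc := dOmega_le_chain D D' (β₂ := blk ((ℓ + 1) ^ k) (toBox hN f'.src).1) (Or.inl hwit) y.1.2 y'.1.2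
  have t1 : tdistK (ℓ := ℓ) (Mh := Mh) (k := k) (P := P') y.1.2 (blk ((ℓ + 1) ^ k) (toBox hN f.src).1) ≤ (geomT D).dist y (blkV1 hN D f) + 1 := by
    rw [tdistK_comm]
    have h := tdistK_blk_le_of_top D hMh hP (toBox hN f.src) hy
    rw [B8Ineq192MultiLevelTorus.symmT D] at h
    exact h
  have t2 : tdistK (ℓ := ℓ) (Mh := Mh) (k := k) (P := P') (blk ((ℓ + 1) ^ k) (toBox hN f.src).1) (blk ((ℓ + 1) ^ k) (toBox hN f'.src).1) ≤ 2 + 1 :=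
    tdistK_blk_blk_le_of_dist hdist
  have t3 : tdistK (ℓ := ℓ) (Mh := Mh) (k := k) (P := P') (blk ((ℓ + 1) ^ k) (toBox hN f'.src).1) y'.1.2 ≤ (geomT D').dist (blkV1 hN D' f') y' + 1 :=
    tdistK_blk_le_of_top D' hMh hP (toBox hN f'.src) hy'
  have hchain : dOmega D D' y.1.2 y'.1.2 ≤ (geomT D).dist y (blkV1 hN D f) + (geomT D').dist (blkV1 hN D' f') y' + 5 := by linarith
  have hexp : Real.exp (-(δ * (geomT D').dist (blkV1 hN D' f') y'))
      ≤ (Real.exp (5 / 2 * δ) * (Real.exp (1 / 2 * δ * (geomT D).dist y (blkV1 hN D f)) * Real.exp (-(1 / 2 * δ * dOmega D D' y.1.2 y'.1.2)))) * Real.exp (-(1 / 2 * δ * (geomT D').dist (blkV1 hN D' f') y')) := by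
    rw [← Real.exp_add, ← Real.exp_add, ← Real.exp_add]
    refine Real.exp_le_exp.2 ?_
    have e1 := mul_le_mul_of_nonneg_left hchain hδ
    have e2 := mul_nonneg hδ (hd0' (blkV1 hN D' f') y')
    rw [mul_add, mul_add] at e1
    linarith
  calc |g f'| ≤ A * pref cf (blkV1 hN D' f') * Real.exp (-(δ * (geomT D').dist (blkV1 hN D' f') y')) * B := h2
    _ = A * B * pref cf (blkV1 hN D' f') * Real.exp (-(δ * (geomT D').dist (blkV1 hN D' f') y')) := by ring
    _ ≤ A * B * pref cf (blkV1 hN D' f') * ((Real.exp (5 / 2 * δ) * (Real.exp (1 / 2 * δ * (geomT D).dist y (blkV1 hN D f)) * Real.exp (-(1 / 2 * δ * dOmega D D' y.1.2 y'.1.2))))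
        * Real.exp (-(1 / 2 * δ * (geomT D').dist (blkV1 hN D' f') y'))) :=
        mul_le_mul_of_nonneg_left hexp (mul_nonneg (mul_nonneg hA hB) (pref_nonneg _ _))
    _ = _ := by ring

/-- **THE SURVIVING INDEX BONDS OF `{Ω_j}`** (`Q*v` with the truncated weighted averages `v` of FILE A): at every fine bond `f` in the block `p` of `{Ω_j}`,
`|(Q*v)(f)| ≤ 2b₁·A·B·e^{(5/2)δ}·(L^{2k}/L^{2j(p)})·e^{½δd(y,p)}·e^{−½δd(y,y′,Ω)}` — column mass + coverage `j ≥ j(p)` + the weight band (2.16)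
+ the tube witness + `Σ_{j ≥ j(p)} L^{−2j} ≤ 2L^{−2j(p)}`.
[cite: Balaban1985BackgroundPropagators, Thm 3.14 (3.154) p.427; Balaban1984PropagatorsII, (2.16) p.225, (2.18)–(2.20) p.226, (2.3) p.224] -/
theorem abs_QsE_trunc_le (hk1 : 1 ≤ k) (hMh : 1 ≤ Mh) (hP : ∀ μ, 1 ≤ P' μ) {δ b₁ A B cf : ℝ} (hδ : 0 ≤ δ) (hcf : cf ≠ 0) (hb₁ : 0 ≤ b₁)
    (hA : 0 ≤ A) (hB : 0 ≤ B) {w : BondIdx (domT hN D hk) → ℝ} (hw0 : ∀ i, 0 ≤ w i)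
    (hwb : ∀ i, w i ≤ b₁ * cf ^ 2 * ((((ℓ : ℝ) + 1) ^ (i.1.1 : ℕ)) ^ (d + 1)) * (((((ℓ : ℝ) + 1) ^ (i.1.1 : ℕ)) ^ 2))⁻¹)
    {y : ↥(bset D.toDomains)} (hy : y.1.1 = k) {y' : ↥(bset D'.toDomains)} (hy' : y'.1.1 = k)
    {g : PBond (PV d ℓ m K hd hL) 0 → ℝ}
    (hg : ∀ v, |g v| ≤ A * pref cf (blkV1 hN D' v) * Real.exp (-(δ * (geomT D').dist (blkV1 hN D' v) y')) * B)
    (f : PBond (PV d ℓ m K hd hL) 0) :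
    |QsE (domT hN D hk) (trunc hN D D' hk w g) f| ≤ 2 * b₁ * A * B * Real.exp (5 / 2 * δ) * (((ℓ : ℝ) + 1) ^ (2 * k) / ((ℓ : ℝ) + 1) ^ (2 * (blkV1 hN D f).1.1)) * (Real.exp (1 / 2 * δ * (geomT D).dist y (blkV1 hN D f)) * Real.exp (-(1 / 2 * δ * dOmega D D' y.1.2 y'.1.2))) := by
  have hd0' : ∀ s t : ↥(bset D'.toDomains), 0 ≤ (geomT D').dist s t :=
    (B6Geom246MultiLevelTorus.triangle_refl_nonneg_T D' hMh hP).2.2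
  have hL2 : (2 : ℝ) ≤ (ℓ : ℝ) + 1 := by
    have h1 : (1 : ℝ) ≤ (ℓ : ℝ) := by exact_mod_cast (show 1 ≤ ℓ by have := hL.2; omega)
    linarith
  have hL0 : (0 : ℝ) < (ℓ : ℝ) + 1 := by linarith
  have hE0 : 0 ≤ Real.exp (5 / 2 * δ) * (Real.exp (1 / 2 * δ * (geomT D).dist y (blkV1 hN D f)) * Real.exp (-(1 / 2 * δ * dOmega D D' y.1.2 y'.1.2))) := by positivity
  -- the bound on `|g|` over the tube of a surviving index bond charging `f`
  have hM : ∀ i : BondIdx (domT hN D hk), ¬ IsCT hN D D' hk i.1 →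
      bondAvgIter (P := PV d ℓ m K hd hL) (i.1.1 : ℕ) (Pi.single f (1 : ℝ)) i.1.2 ≠ 0 →
      ∀ f', bondAvgIter (P := PV d ℓ m K hd hL) (i.1.1 : ℕ) (Pi.single f' (1 : ℝ)) i.1.2 ≠ 0 →
        |g f'| ≤ A * B * ((((ℓ : ℝ) + 1) ^ k) ^ 2 / cf ^ 2) * (Real.exp (5 / 2 * δ) * (Real.exp (1 / 2 * δ * (geomT D).dist y (blkV1 hN D f)) * Real.exp (-(1 / 2 * δ * dOmega D D' y.1.2 y'.1.2)))) := by
    intro i hct hq f' hq'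
    have hjk : (i.1.1 : ℕ) ≤ k := Nat.lt_succ_iff.1 i.1.1.isLt
    have hjm : (i.1.1 : ℕ) ≤ m + K := le_trans hjk hk
    have hwit := witness_of_not_isCT hN D D' hk hk1 i hct f hq
    have hloc := iterBlockOf_of_bondAvgIter_single_ne_zero (P := PV d ℓ m K hd hL)
      (show (i.1.1 : ℕ) ≤ (PV d ℓ m K hd hL).m + (PV d ℓ m K hd hL).K from hjm) hq
    have hloc' := iterBlockOf_of_bondAvgIter_single_ne_zero (P := PV d ℓ m K hd hL)
      (show (i.1.1 : ℕ) ≤ (PV d ℓ m K hd hL).m + (PV d ℓ m K hd hL).K from hjm) hq'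
    have hdist := dist_tube_le hN hjm hjk i.1.2 hloc hloc'
    have h := gprof_tube hN D D' hMh hP hδ hA hB hy hy' hg f f' hwit hdist
    have hpref : pref cf (blkV1 hN D' f') ≤ (((ℓ : ℝ) + 1) ^ k) ^ 2 / cf ^ 2 := by
      have h1 := powLev_sq_le D' (blkV1 hN D' f')
      rw [← sq_mul_pref D' hcf] at h1
      rw [le_div_iff₀ (by positivity), mul_comm]
      exact h1
    have hexp1 : Real.exp (-(1 / 2 * δ * (geomT D').dist (blkV1 hN D' f') y')) ≤ 1 :=
      Real.exp_le_one_iff.2 (neg_nonpos.2 (mul_nonneg (mul_nonneg (by norm_num) hδ) (hd0' _ _)))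
    calc |g f'| ≤ A * B * pref cf (blkV1 hN D' f') * (Real.exp (5 / 2 * δ) * (Real.exp (1 / 2 * δ * (geomT D).dist y (blkV1 hN D f)) * Real.exp (-(1 / 2 * δ * dOmega D D' y.1.2 y'.1.2))))
          * Real.exp (-(1 / 2 * δ * (geomT D').dist (blkV1 hN D' f') y')) := h
      _ ≤ A * B * ((((ℓ : ℝ) + 1) ^ k) ^ 2 / cf ^ 2) * (Real.exp (5 / 2 * δ) * (Real.exp (1 / 2 * δ * (geomT D).dist y (blkV1 hN D f)) * Real.exp (-(1 / 2 * δ * dOmega D D' y.1.2 y'.1.2)))) * 1 :=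
          mul_le_mul (mul_le_mul_of_nonneg_right (mul_le_mul_of_nonneg_left hpref (mul_nonneg hA hB)) hE0) hexp1
            (Real.exp_pos _).le (by positivity)
      _ = _ := mul_one _
  -- the level profile of the truncated weighted averages
  have hv : ∀ i : BondIdx (domT hN D hk), bondAvgIter (i.1.1 : ℕ) (Pi.single f (1 : ℝ)) i.1.2 ≠ 0 →
      |trunc hN D D' hk w g i| ≤ (fun j : ℕ => if (blkV1 hN D f).1.1 ≤ j then
        b₁ * A * B * (Real.exp (5 / 2 * δ) * (Real.exp (1 / 2 * δ * (geomT D).dist y (blkV1 hN D f)) * Real.exp (-(1 / 2 * δ * dOmega D D' y.1.2 y'.1.2)))) * (((ℓ : ℝ) + 1) ^ k) ^ 2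
          * ((((ℓ : ℝ) + 1) ^ j) ^ (d + 1) * ((((ℓ : ℝ) + 1) ^ j) ^ 2)⁻¹) else 0) i.1.1 := by
    intro i hq
    beta_reduce
    rw [trunc_apply]
    by_cases hct : IsCT hN D D' hk i.1
    · rw [if_pos hct, abs_zero]
      split_ifs
      · positivity
      · exact le_rfl
    · rw [if_neg hct]
      have hcov : (blkV1 hN D f).1.1 ≤ (i.1.1 : ℕ) := lev_le_of_bondAvgIter_single_ne_zero hN D hk i f hq
      rw [if_pos hcov]
      have hQ : |bondAvgIter (P := PV d ℓ m K hd hL) (i.1.1 : ℕ) g i.1.2|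
          ≤ A * B * ((((ℓ : ℝ) + 1) ^ k) ^ 2 / cf ^ 2) * (Real.exp (5 / 2 * δ) * (Real.exp (1 / 2 * δ * (geomT D).dist y (blkV1 hN D f)) * Real.exp (-(1 / 2 * δ * dOmega D D' y.1.2 y'.1.2)))) := by
        refine (abs_bondAvgIter_le_sum_qk (k := k) i.1 g).trans ?_
        have hle : ∀ f', qk (k := k) i.1 f' * |g f'| ≤ qk (k := k) i.1 f' * (A * B * ((((ℓ : ℝ) + 1) ^ k) ^ 2 / cf ^ 2) * (Real.exp (5 / 2 * δ) * (Real.exp (1 / 2 * δ * (geomT D).dist y (blkV1 hN D f)) * Real.exp (-(1 / 2 * δ * dOmega D D' y.1.2 y'.1.2))))) := by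
          intro f'
          by_cases hq' : bondAvgIter (P := PV d ℓ m K hd hL) (i.1.1 : ℕ) (Pi.single f' (1 : ℝ)) i.1.2 = 0
          · have h0 : qk (k := k) i.1 f' = 0 := hq'
            rw [h0, zero_mul, zero_mul]
          · exact mul_le_mul_of_nonneg_left (hM i hct hq f' hq') (qk_nonneg (k := k) i.1 f')
        refine (Finset.sum_le_sum fun f' _ => hle f').trans ?_
        rw [← Finset.sum_mul, sum_qk, one_mul]
      rw [abs_mul, abs_of_nonneg (hw0 i)]
      have hwb0 : 0 ≤ b₁ * cf ^ 2 * ((((ℓ : ℝ) + 1) ^ (i.1.1 : ℕ)) ^ (d + 1)) * (((((ℓ : ℝ) + 1) ^ (i.1.1 : ℕ)) ^ 2))⁻¹ := by positivity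
      calc w i * |bondAvgIter (P := PV d ℓ m K hd hL) (i.1.1 : ℕ) g i.1.2|
          ≤ (b₁ * cf ^ 2 * ((((ℓ : ℝ) + 1) ^ (i.1.1 : ℕ)) ^ (d + 1)) * (((((ℓ : ℝ) + 1) ^ (i.1.1 : ℕ)) ^ 2))⁻¹)
            * (A * B * ((((ℓ : ℝ) + 1) ^ k) ^ 2 / cf ^ 2) * (Real.exp (5 / 2 * δ) * (Real.exp (1 / 2 * δ * (geomT D).dist y (blkV1 hN D f)) * Real.exp (-(1 / 2 * δ * dOmega D D' y.1.2 y'.1.2))))) :=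
            mul_le_mul (hwb i) hQ (abs_nonneg _) hwb0
        _ = _ := by field_simp
  have hg0 : ∀ j : ℕ, 0 ≤ (fun j : ℕ => if (blkV1 hN D f).1.1 ≤ j then
        b₁ * A * B * (Real.exp (5 / 2 * δ) * (Real.exp (1 / 2 * δ * (geomT D).dist y (blkV1 hN D f)) * Real.exp (-(1 / 2 * δ * dOmega D D' y.1.2 y'.1.2)))) * (((ℓ : ℝ) + 1) ^ k) ^ 2
          * ((((ℓ : ℝ) + 1) ^ j) ^ (d + 1) * ((((ℓ : ℝ) + 1) ^ j) ^ 2)⁻¹) else 0) j := by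
    intro j
    beta_reduce
    split_ifs
    · positivity
    · exact le_rfl
  have h := abs_QsE_apply_le (domT hN D hk) (trunc hN D D' hk w g) f _ hg0 hv
  refine h.trans ?_
  rw [B8Prop3MultiLevelTorus.PV_L]
  show ∑ j ∈ Finset.range (k + 1), (fun j : ℕ => if (blkV1 hN D f).1.1 ≤ j then
        b₁ * A * B * (Real.exp (5 / 2 * δ) * (Real.exp (1 / 2 * δ * (geomT D).dist y (blkV1 hN D f)) * Real.exp (-(1 / 2 * δ * dOmega D D' y.1.2 y'.1.2)))) * (((ℓ : ℝ) + 1) ^ k) ^ 2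
          * ((((ℓ : ℝ) + 1) ^ j) ^ (d + 1) * ((((ℓ : ℝ) + 1) ^ j) ^ 2)⁻¹) else 0) j * ((((ℓ : ℝ) + 1) ^ (d + 1))⁻¹) ^ j ≤ _
  have hterm : ∀ j ∈ Finset.range (k + 1), (fun j : ℕ => if (blkV1 hN D f).1.1 ≤ j then
        b₁ * A * B * (Real.exp (5 / 2 * δ) * (Real.exp (1 / 2 * δ * (geomT D).dist y (blkV1 hN D f)) * Real.exp (-(1 / 2 * δ * dOmega D D' y.1.2 y'.1.2)))) * (((ℓ : ℝ) + 1) ^ k) ^ 2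
          * ((((ℓ : ℝ) + 1) ^ j) ^ (d + 1) * ((((ℓ : ℝ) + 1) ^ j) ^ 2)⁻¹) else 0) j * ((((ℓ : ℝ) + 1) ^ (d + 1))⁻¹) ^ j
      = b₁ * A * B * (Real.exp (5 / 2 * δ) * (Real.exp (1 / 2 * δ * (geomT D).dist y (blkV1 hN D f)) * Real.exp (-(1 / 2 * δ * dOmega D D' y.1.2 y'.1.2)))) * (((ℓ : ℝ) + 1) ^ k) ^ 2
          * (if (blkV1 hN D f).1.1 ≤ j then ((((ℓ : ℝ) + 1) ^ 2)⁻¹) ^ j else 0) := by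
    intro j _
    beta_reduce
    split_ifs
    · have e1 : (((ℓ : ℝ) + 1) ^ j) ^ (d + 1) * ((((ℓ : ℝ) + 1) ^ (d + 1))⁻¹) ^ j = 1 := by
        rw [← pow_mul, inv_pow, ← pow_mul, mul_comm j (d + 1), mul_inv_cancel₀ (by positivity)]
      have e2 : ((((ℓ : ℝ) + 1) ^ j) ^ 2)⁻¹ = ((((ℓ : ℝ) + 1) ^ 2)⁻¹) ^ j := by
        rw [← pow_mul, mul_comm j 2, pow_mul, inv_pow]
      calc b₁ * A * B * (Real.exp (5 / 2 * δ) * (Real.exp (1 / 2 * δ * (geomT D).dist y (blkV1 hN D f)) * Real.exp (-(1 / 2 * δ * dOmega D D' y.1.2 y'.1.2)))) * (((ℓ : ℝ) + 1) ^ k) ^ 2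
            * ((((ℓ : ℝ) + 1) ^ j) ^ (d + 1) * ((((ℓ : ℝ) + 1) ^ j) ^ 2)⁻¹) * ((((ℓ : ℝ) + 1) ^ (d + 1))⁻¹) ^ j
          = b₁ * A * B * (Real.exp (5 / 2 * δ) * (Real.exp (1 / 2 * δ * (geomT D).dist y (blkV1 hN D f)) * Real.exp (-(1 / 2 * δ * dOmega D D' y.1.2 y'.1.2)))) * (((ℓ : ℝ) + 1) ^ k) ^ 2 * ((((ℓ : ℝ) + 1) ^ j) ^ 2)⁻¹
            * ((((ℓ : ℝ) + 1) ^ j) ^ (d + 1) * ((((ℓ : ℝ) + 1) ^ (d + 1))⁻¹) ^ j) := by ring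
        _ = _ := by rw [e1, mul_one, e2]
    · rw [zero_mul, mul_zero]
  rw [Finset.sum_congr rfl hterm, ← Finset.mul_sum]
  have hr0 : (0 : ℝ) ≤ (((ℓ : ℝ) + 1) ^ 2)⁻¹ := by positivity
  have hr : (((ℓ : ℝ) + 1) ^ 2)⁻¹ ≤ 1 / 2 := by
    rw [inv_eq_one_div]
    have h4 : (4 : ℝ) ≤ ((ℓ : ℝ) + 1) ^ 2 := by nlinarith
    exact (one_div_le_one_div_of_le (by norm_num) h4).trans (by norm_num)
  have hsum := sum_ite_pow_le hr0 hr (blkV1 hN D f).1.1 (k + 1)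
  have hC0 : 0 ≤ b₁ * A * B * (Real.exp (5 / 2 * δ) * (Real.exp (1 / 2 * δ * (geomT D).dist y (blkV1 hN D f)) * Real.exp (-(1 / 2 * δ * dOmega D D' y.1.2 y'.1.2)))) * (((ℓ : ℝ) + 1) ^ k) ^ 2 := by positivity
  refine (mul_le_mul_of_nonneg_left hsum hC0).trans (le_of_eq ?_)
  have e3 : (((ℓ : ℝ) + 1) ^ k) ^ 2 * ((((ℓ : ℝ) + 1) ^ 2)⁻¹) ^ (blkV1 hN D f).1.1 = (((ℓ : ℝ) + 1) ^ (2 * k) / ((ℓ : ℝ) + 1) ^ (2 * (blkV1 hN D f).1.1)) := by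
    rw [inv_pow, ← pow_mul, ← pow_mul, mul_comm k 2, div_eq_mul_inv]
  rw [← e3]
  ring

/-- `a^j/a^k = (a⁻¹)^{k−j}` for `j ≤ k`. [folklore] -/
private theorem pow_div_pow_eq_inv_pow {a : ℝ} (ha : a ≠ 0) {j n : ℕ} (h : j ≤ n) : a ^ j / a ^ n = (a⁻¹) ^ (n - j) := by
  obtain ⟨i, rfl⟩ := Nat.exists_eq_add_of_le h
  rw [Nat.add_sub_cancel_left, pow_add, inv_pow]
  field_simp

/-- **THE SURVIVING INDEX BONDS OF `{Ω′_j}`** (`Q′*v′`): at every fine bond `f` in the block `p` of `{Ω_j}`,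
`|(Q′*v′)(f)| ≤ 2b₁·A·B·L²·e^{(5/2)δ}·e^{½δd(y,p)}·e^{−½δd(y,y′,Ω)}` — column mass + coverage in `{Ω′_j}` + the transfer (2.60) in `{Ω′_j}`
+ the weight band + the tube witness + `Σ_{j ≤ k} L^{2j}/L^{2k} ≤ 2`.
[cite: Balaban1985BackgroundPropagators, Thm 3.14 (3.154) p.427; Balaban1984PropagatorsII, (2.16) p.225, (2.18)–(2.20) p.226, (2.60) p.234] -/
theorem abs_QsE_trunc'_le (hk1 : 1 ≤ k) (hMh : 1 ≤ Mh) (hP : ∀ μ, 1 ≤ P' μ) (hRM : 1 ≤ R * ((ℓ + 1) * Mh)) {δ b₁ A B cf : ℝ}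
    (hδ : 0 ≤ δ) (hcf : cf ≠ 0) (hb₁ : 0 ≤ b₁) (hA : 0 ≤ A) (hB : 0 ≤ B)
    (hthr : ((ℓ : ℝ) + 1) ^ 2 ≤ Real.exp (1 / 4 * δ * ((R : ℝ) * (((ℓ : ℝ) + 1) * Mh) - 1)))
    {w' : BondIdx (domT hN D' hk) → ℝ} (hw0' : ∀ i', 0 ≤ w' i')
    (hwb' : ∀ i', w' i' ≤ b₁ * cf ^ 2 * ((((ℓ : ℝ) + 1) ^ (i'.1.1 : ℕ)) ^ (d + 1)) * (((((ℓ : ℝ) + 1) ^ (i'.1.1 : ℕ)) ^ 2))⁻¹)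
    {y : ↥(bset D.toDomains)} (hy : y.1.1 = k) {y' : ↥(bset D'.toDomains)} (hy' : y'.1.1 = k)
    {g : PBond (PV d ℓ m K hd hL) 0 → ℝ}
    (hg : ∀ v, |g v| ≤ A * pref cf (blkV1 hN D' v) * Real.exp (-(δ * (geomT D').dist (blkV1 hN D' v) y')) * B)
    (f : PBond (PV d ℓ m K hd hL) 0) :
    |QsE (domT hN D' hk) (trunc' hN D D' hk w' g) f| ≤ 2 * b₁ * A * B * ((ℓ : ℝ) + 1) ^ 2 * Real.exp (5 / 2 * δ) * (Real.exp (1 / 2 * δ * (geomT D).dist y (blkV1 hN D f)) * Real.exp (-(1 / 2 * δ * dOmega D D' y.1.2 y'.1.2))) := by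
  have hd0' : ∀ s t : ↥(bset D'.toDomains), 0 ≤ (geomT D').dist s t :=
    (B6Geom246MultiLevelTorus.triangle_refl_nonneg_T D' hMh hP).2.2
  have hL2 : (2 : ℝ) ≤ (ℓ : ℝ) + 1 := by
    have h1 : (1 : ℝ) ≤ (ℓ : ℝ) := by exact_mod_cast (show 1 ≤ ℓ by have := hL.2; omega)
    linarith
  have hL0 : (0 : ℝ) < (ℓ : ℝ) + 1 := by linarith
  have hL1 : (1 : ℝ) ≤ (ℓ : ℝ) + 1 := by linarith
  have hE0 : 0 ≤ Real.exp (5 / 2 * δ) * (Real.exp (1 / 2 * δ * (geomT D).dist y (blkV1 hN D f)) * Real.exp (-(1 / 2 * δ * dOmega D D' y.1.2 y'.1.2))) := by positivity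
  -- the bound on `c_f²|g|` over the tube of a surviving index bond of `{Ω′_j}` charging `f`, with the transfer in `{Ω′_j}`
  have hM : ∀ i' : BondIdx (domT hN D' hk), ¬ IsCT hN D D' hk i'.1 →
      bondAvgIter (P := PV d ℓ m K hd hL) (i'.1.1 : ℕ) (Pi.single f (1 : ℝ)) i'.1.2 ≠ 0 →
      ∀ f', bondAvgIter (P := PV d ℓ m K hd hL) (i'.1.1 : ℕ) (Pi.single f' (1 : ℝ)) i'.1.2 ≠ 0 →
        cf ^ 2 * |g f'| ≤ A * B * (((ℓ : ℝ) + 1) ^ 2 * ((((ℓ : ℝ) + 1) ^ (i'.1.1 : ℕ)) ^ 2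
          * (((ℓ : ℝ) + 1) ^ (2 * (i'.1.1 : ℕ)) / ((ℓ : ℝ) + 1) ^ (2 * k)))) * (Real.exp (5 / 2 * δ) * (Real.exp (1 / 2 * δ * (geomT D).dist y (blkV1 hN D f)) * Real.exp (-(1 / 2 * δ * dOmega D D' y.1.2 y'.1.2)))) := by
    intro i' hct hq f' hq'
    have hjk : (i'.1.1 : ℕ) ≤ k := Nat.lt_succ_iff.1 i'.1.1.isLt
    have hjm : (i'.1.1 : ℕ) ≤ m + K := le_trans hjk hk
    have hwit := witness_of_not_isCT' hN D D' hk hk1 i' hct f hq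
    have hloc := iterBlockOf_of_bondAvgIter_single_ne_zero (P := PV d ℓ m K hd hL)
      (show (i'.1.1 : ℕ) ≤ (PV d ℓ m K hd hL).m + (PV d ℓ m K hd hL).K from hjm) hq
    have hloc' := iterBlockOf_of_bondAvgIter_single_ne_zero (P := PV d ℓ m K hd hL)
      (show (i'.1.1 : ℕ) ≤ (PV d ℓ m K hd hL).m + (PV d ℓ m K hd hL).K from hjm) hq'
    have hdist := dist_tube_le hN hjm hjk i'.1.2 hloc hloc'
    have h := gprof_tube hN D D' hMh hP hδ hA hB hy hy' hg f f' hwit hdist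
    -- coverage in `{Ω′_j}` and the transfer
    have hcov' : (blkV1 hN D' f').1.1 ≤ (i'.1.1 : ℕ) := lev_le_of_bondAvgIter_single_ne_zero hN D' hk i' f' hq'
    have htr := transfer_top D' hMh hP hRM hδ hthr (blkV1 hN D' f') y' hy'
    have hpos : (0 : ℝ) < ((ℓ : ℝ) + 1) ^ (2 * k) / ((ℓ : ℝ) + 1) ^ (2 * (blkV1 hN D' f').1.1) := by positivity
    have hexpq : Real.exp (-(1 / 4 * δ * (geomT D').dist (blkV1 hN D' f') y'))
        ≤ ((ℓ : ℝ) + 1) ^ 2 * (((ℓ : ℝ) + 1) ^ (2 * (blkV1 hN D' f').1.1) / ((ℓ : ℝ) + 1) ^ (2 * k)) := by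
      rw [mul_comm] at htr
      have h1 := (le_div_iff₀ hpos).2 htr
      refine h1.trans (le_of_eq ?_)
      rw [div_div_eq_mul_div]
      field_simp
    have hexph : Real.exp (-(1 / 2 * δ * (geomT D').dist (blkV1 hN D' f') y'))
        ≤ Real.exp (-(1 / 4 * δ * (geomT D').dist (blkV1 hN D' f') y')) :=
      Real.exp_le_exp.2 (by nlinarith [hd0' (blkV1 hN D' f') y'])
    have hpref : cf ^ 2 * pref cf (blkV1 hN D' f') = (((ℓ : ℝ) + 1) ^ (blkV1 hN D' f').1.1) ^ 2 := sq_mul_pref D' hcf _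
    have hsc1 : (((ℓ : ℝ) + 1) ^ (blkV1 hN D' f').1.1) ^ 2 ≤ (((ℓ : ℝ) + 1) ^ (i'.1.1 : ℕ)) ^ 2 :=
      pow_le_pow_left₀ (by positivity) (pow_le_pow_right₀ hL1 hcov') 2
    have hsc2 : ((ℓ : ℝ) + 1) ^ (2 * (blkV1 hN D' f').1.1) / ((ℓ : ℝ) + 1) ^ (2 * k)
        ≤ ((ℓ : ℝ) + 1) ^ (2 * (i'.1.1 : ℕ)) / ((ℓ : ℝ) + 1) ^ (2 * k) :=
      div_le_div_of_nonneg_right (pow_le_pow_right₀ hL1 (by omega)) (by positivity)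
    calc cf ^ 2 * |g f'| ≤ cf ^ 2 * (A * B * pref cf (blkV1 hN D' f') * (Real.exp (5 / 2 * δ) * (Real.exp (1 / 2 * δ * (geomT D).dist y (blkV1 hN D f)) * Real.exp (-(1 / 2 * δ * dOmega D D' y.1.2 y'.1.2))))
          * Real.exp (-(1 / 2 * δ * (geomT D').dist (blkV1 hN D' f') y'))) := mul_le_mul_of_nonneg_left h (sq_nonneg cf)
      _ = A * B * ((cf ^ 2 * pref cf (blkV1 hN D' f')) * Real.exp (-(1 / 2 * δ * (geomT D').dist (blkV1 hN D' f') y')))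
          * (Real.exp (5 / 2 * δ) * (Real.exp (1 / 2 * δ * (geomT D).dist y (blkV1 hN D f)) * Real.exp (-(1 / 2 * δ * dOmega D D' y.1.2 y'.1.2)))) := by ring
      _ ≤ A * B * ((((ℓ : ℝ) + 1) ^ (i'.1.1 : ℕ)) ^ 2 * (((ℓ : ℝ) + 1) ^ 2 * (((ℓ : ℝ) + 1) ^ (2 * (i'.1.1 : ℕ)) / ((ℓ : ℝ) + 1) ^ (2 * k))))
          * (Real.exp (5 / 2 * δ) * (Real.exp (1 / 2 * δ * (geomT D).dist y (blkV1 hN D f)) * Real.exp (-(1 / 2 * δ * dOmega D D' y.1.2 y'.1.2)))) := by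
          refine mul_le_mul_of_nonneg_right (mul_le_mul_of_nonneg_left ?_ (mul_nonneg hA hB)) hE0
          rw [hpref]
          refine mul_le_mul hsc1 (hexph.trans (hexpq.trans ?_)) (Real.exp_pos _).le (by positivity)
          exact mul_le_mul_of_nonneg_left hsc2 (by positivity)
      _ = _ := by ring
  -- the level profile of the truncated weighted averages of `{Ω′_j}`
  have hv : ∀ i' : BondIdx (domT hN D' hk), bondAvgIter (i'.1.1 : ℕ) (Pi.single f (1 : ℝ)) i'.1.2 ≠ 0 →
      |trunc' hN D D' hk w' g i'| ≤ (fun j : ℕ => b₁ * A * B * ((ℓ : ℝ) + 1) ^ 2 * (Real.exp (5 / 2 * δ) * (Real.exp (1 / 2 * δ * (geomT D).dist y (blkV1 hN D f)) * Real.exp (-(1 / 2 * δ * dOmega D D' y.1.2 y'.1.2))))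
        * ((((ℓ : ℝ) + 1) ^ j) ^ (d + 1) * (((ℓ : ℝ) + 1) ^ (2 * j) / ((ℓ : ℝ) + 1) ^ (2 * k)))) i'.1.1 := by
    intro i' hq
    beta_reduce
    rw [trunc'_apply]
    by_cases hct : IsCT hN D D' hk i'.1
    · rw [if_pos hct, abs_zero]
      positivity
    · rw [if_neg hct]
      have hQ : cf ^ 2 * |bondAvgIter (P := PV d ℓ m K hd hL) (i'.1.1 : ℕ) g i'.1.2|
          ≤ A * B * (((ℓ : ℝ) + 1) ^ 2 * ((((ℓ : ℝ) + 1) ^ (i'.1.1 : ℕ)) ^ 2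
            * (((ℓ : ℝ) + 1) ^ (2 * (i'.1.1 : ℕ)) / ((ℓ : ℝ) + 1) ^ (2 * k)))) * (Real.exp (5 / 2 * δ) * (Real.exp (1 / 2 * δ * (geomT D).dist y (blkV1 hN D f)) * Real.exp (-(1 / 2 * δ * dOmega D D' y.1.2 y'.1.2)))) := by
        have h1 := abs_bondAvgIter_le_sum_qk (k := k) i'.1 g
        have hle : ∀ f', qk (k := k) i'.1 f' * (cf ^ 2 * |g f'|) ≤ qk (k := k) i'.1 f' * (A * B * (((ℓ : ℝ) + 1) ^ 2
            * ((((ℓ : ℝ) + 1) ^ (i'.1.1 : ℕ)) ^ 2 * (((ℓ : ℝ) + 1) ^ (2 * (i'.1.1 : ℕ)) / ((ℓ : ℝ) + 1) ^ (2 * k))))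
            * (Real.exp (5 / 2 * δ) * (Real.exp (1 / 2 * δ * (geomT D).dist y (blkV1 hN D f)) * Real.exp (-(1 / 2 * δ * dOmega D D' y.1.2 y'.1.2))))) := by
          intro f'
          by_cases hq' : bondAvgIter (P := PV d ℓ m K hd hL) (i'.1.1 : ℕ) (Pi.single f' (1 : ℝ)) i'.1.2 = 0
          · have h0 : qk (k := k) i'.1 f' = 0 := hq'
            rw [h0, zero_mul, zero_mul]
          · exact mul_le_mul_of_nonneg_left (hM i' hct hq f' hq') (qk_nonneg (k := k) i'.1 f')
        calc cf ^ 2 * |bondAvgIter (P := PV d ℓ m K hd hL) (i'.1.1 : ℕ) g i'.1.2|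
            ≤ cf ^ 2 * ∑ f', qk (k := k) i'.1 f' * |g f'| := mul_le_mul_of_nonneg_left h1 (sq_nonneg cf)
          _ = ∑ f', qk (k := k) i'.1 f' * (cf ^ 2 * |g f'|) := by
              rw [Finset.mul_sum]
              exact Finset.sum_congr rfl fun f' _ => by ring
          _ ≤ _ := Finset.sum_le_sum fun f' _ => hle f'
          _ = _ := by rw [← Finset.sum_mul, sum_qk, one_mul]
      rw [abs_mul, abs_of_nonneg (hw0' i')]
      have hb0 : 0 ≤ b₁ * (((ℓ : ℝ) + 1) ^ (i'.1.1 : ℕ)) ^ (d + 1) * ((((ℓ : ℝ) + 1) ^ (i'.1.1 : ℕ)) ^ 2)⁻¹ := by positivity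
      have hne : (((ℓ : ℝ) + 1) ^ (i'.1.1 : ℕ)) ^ 2 ≠ 0 := by positivity
      calc w' i' * |bondAvgIter (P := PV d ℓ m K hd hL) (i'.1.1 : ℕ) g i'.1.2|
          ≤ (b₁ * cf ^ 2 * ((((ℓ : ℝ) + 1) ^ (i'.1.1 : ℕ)) ^ (d + 1)) * (((((ℓ : ℝ) + 1) ^ (i'.1.1 : ℕ)) ^ 2))⁻¹)
            * |bondAvgIter (P := PV d ℓ m K hd hL) (i'.1.1 : ℕ) g i'.1.2| := mul_le_mul_of_nonneg_right (hwb' i') (abs_nonneg _)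
        _ = b₁ * (((ℓ : ℝ) + 1) ^ (i'.1.1 : ℕ)) ^ (d + 1) * ((((ℓ : ℝ) + 1) ^ (i'.1.1 : ℕ)) ^ 2)⁻¹
            * (cf ^ 2 * |bondAvgIter (P := PV d ℓ m K hd hL) (i'.1.1 : ℕ) g i'.1.2|) := by ring
        _ ≤ b₁ * (((ℓ : ℝ) + 1) ^ (i'.1.1 : ℕ)) ^ (d + 1) * ((((ℓ : ℝ) + 1) ^ (i'.1.1 : ℕ)) ^ 2)⁻¹
            * (A * B * (((ℓ : ℝ) + 1) ^ 2 * ((((ℓ : ℝ) + 1) ^ (i'.1.1 : ℕ)) ^ 2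
              * (((ℓ : ℝ) + 1) ^ (2 * (i'.1.1 : ℕ)) / ((ℓ : ℝ) + 1) ^ (2 * k)))) * (Real.exp (5 / 2 * δ) * (Real.exp (1 / 2 * δ * (geomT D).dist y (blkV1 hN D f)) * Real.exp (-(1 / 2 * δ * dOmega D D' y.1.2 y'.1.2))))) :=
            mul_le_mul_of_nonneg_left hQ hb0
        _ = b₁ * A * B * ((ℓ : ℝ) + 1) ^ 2 * (Real.exp (5 / 2 * δ) * (Real.exp (1 / 2 * δ * (geomT D).dist y (blkV1 hN D f)) * Real.exp (-(1 / 2 * δ * dOmega D D' y.1.2 y'.1.2))))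
            * ((((ℓ : ℝ) + 1) ^ (i'.1.1 : ℕ)) ^ (d + 1) * (((ℓ : ℝ) + 1) ^ (2 * (i'.1.1 : ℕ)) / ((ℓ : ℝ) + 1) ^ (2 * k)))
            * (((((ℓ : ℝ) + 1) ^ (i'.1.1 : ℕ)) ^ 2)⁻¹ * (((ℓ : ℝ) + 1) ^ (i'.1.1 : ℕ)) ^ 2) := by ring
        _ = _ := by rw [inv_mul_cancel₀ hne, mul_one]
  have hg0 : ∀ j : ℕ, 0 ≤ (fun j : ℕ => b₁ * A * B * ((ℓ : ℝ) + 1) ^ 2 * (Real.exp (5 / 2 * δ) * (Real.exp (1 / 2 * δ * (geomT D).dist y (blkV1 hN D f)) * Real.exp (-(1 / 2 * δ * dOmega D D' y.1.2 y'.1.2))))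
        * ((((ℓ : ℝ) + 1) ^ j) ^ (d + 1) * (((ℓ : ℝ) + 1) ^ (2 * j) / ((ℓ : ℝ) + 1) ^ (2 * k)))) j := by
    intro j
    beta_reduce
    positivity
  have h := abs_QsE_apply_le (domT hN D' hk) (trunc' hN D D' hk w' g) f _ hg0 hv
  refine h.trans ?_
  rw [B8Prop3MultiLevelTorus.PV_L]
  show ∑ j ∈ Finset.range (k + 1), (fun j : ℕ => b₁ * A * B * ((ℓ : ℝ) + 1) ^ 2 * (Real.exp (5 / 2 * δ) * (Real.exp (1 / 2 * δ * (geomT D).dist y (blkV1 hN D f)) * Real.exp (-(1 / 2 * δ * dOmega D D' y.1.2 y'.1.2))))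
        * ((((ℓ : ℝ) + 1) ^ j) ^ (d + 1) * (((ℓ : ℝ) + 1) ^ (2 * j) / ((ℓ : ℝ) + 1) ^ (2 * k)))) j
        * ((((ℓ : ℝ) + 1) ^ (d + 1))⁻¹) ^ j ≤ _
  have hterm : ∀ j ∈ Finset.range (k + 1), (fun j : ℕ => b₁ * A * B * ((ℓ : ℝ) + 1) ^ 2 * (Real.exp (5 / 2 * δ) * (Real.exp (1 / 2 * δ * (geomT D).dist y (blkV1 hN D f)) * Real.exp (-(1 / 2 * δ * dOmega D D' y.1.2 y'.1.2))))
        * ((((ℓ : ℝ) + 1) ^ j) ^ (d + 1) * (((ℓ : ℝ) + 1) ^ (2 * j) / ((ℓ : ℝ) + 1) ^ (2 * k)))) j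
        * ((((ℓ : ℝ) + 1) ^ (d + 1))⁻¹) ^ j
      = b₁ * A * B * ((ℓ : ℝ) + 1) ^ 2 * (Real.exp (5 / 2 * δ) * (Real.exp (1 / 2 * δ * (geomT D).dist y (blkV1 hN D f)) * Real.exp (-(1 / 2 * δ * dOmega D D' y.1.2 y'.1.2)))) * ((((ℓ : ℝ) + 1) ^ 2)⁻¹) ^ (k - j) := by
    intro j hj
    have hjk : j ≤ k := Nat.lt_succ_iff.1 (Finset.mem_range.1 hj)
    beta_reduce
    have e1 : (((ℓ : ℝ) + 1) ^ j) ^ (d + 1) * ((((ℓ : ℝ) + 1) ^ (d + 1))⁻¹) ^ j = 1 := by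
      rw [← pow_mul, inv_pow, ← pow_mul, mul_comm j (d + 1), mul_inv_cancel₀ (by positivity)]
    have e2 : ((ℓ : ℝ) + 1) ^ (2 * j) / ((ℓ : ℝ) + 1) ^ (2 * k) = ((((ℓ : ℝ) + 1) ^ 2)⁻¹) ^ (k - j) := by
      rw [pow_mul, pow_mul]
      exact pow_div_pow_eq_inv_pow (pow_ne_zero _ hL0.ne') hjk
    calc b₁ * A * B * ((ℓ : ℝ) + 1) ^ 2 * (Real.exp (5 / 2 * δ) * (Real.exp (1 / 2 * δ * (geomT D).dist y (blkV1 hN D f)) * Real.exp (-(1 / 2 * δ * dOmega D D' y.1.2 y'.1.2))))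
          * ((((ℓ : ℝ) + 1) ^ j) ^ (d + 1) * (((ℓ : ℝ) + 1) ^ (2 * j) / ((ℓ : ℝ) + 1) ^ (2 * k))) * ((((ℓ : ℝ) + 1) ^ (d + 1))⁻¹) ^ j
        = b₁ * A * B * ((ℓ : ℝ) + 1) ^ 2 * (Real.exp (5 / 2 * δ) * (Real.exp (1 / 2 * δ * (geomT D).dist y (blkV1 hN D f)) * Real.exp (-(1 / 2 * δ * dOmega D D' y.1.2 y'.1.2)))) * (((ℓ : ℝ) + 1) ^ (2 * j) / ((ℓ : ℝ) + 1) ^ (2 * k))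
          * ((((ℓ : ℝ) + 1) ^ j) ^ (d + 1) * ((((ℓ : ℝ) + 1) ^ (d + 1))⁻¹) ^ j) := by ring
      _ = _ := by rw [e1, mul_one, e2]
  rw [Finset.sum_congr rfl hterm, ← Finset.mul_sum]
  have hr0 : (0 : ℝ) ≤ (((ℓ : ℝ) + 1) ^ 2)⁻¹ := by positivity
  have hr : (((ℓ : ℝ) + 1) ^ 2)⁻¹ ≤ 1 / 2 := by
    rw [inv_eq_one_div]
    have h4 : (4 : ℝ) ≤ ((ℓ : ℝ) + 1) ^ 2 := by nlinarith
    exact (one_div_le_one_div_of_le (by norm_num) h4).trans (by norm_num)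
  have hsum := sum_pow_sub_le hr0 hr k
  have hC0 : 0 ≤ b₁ * A * B * ((ℓ : ℝ) + 1) ^ 2 * (Real.exp (5 / 2 * δ) * (Real.exp (1 / 2 * δ * (geomT D).dist y (blkV1 hN D f)) * Real.exp (-(1 / 2 * δ * dOmega D D' y.1.2 y'.1.2)))) := by positivity
  refine (mul_le_mul_of_nonneg_left hsum hC0).trans (le_of_eq ?_)
  ring

end QPart


/-! ## §6  The engine: the two letters under the majorant of the outer factor, and the combination with the plain decay -/

section Engine

variable (hN : ∀ μ, N0 ℓ Mh k P' μ = (PV d ℓ m K hd hL).sitesPerDir 0) (D D' : TDomains d ℓ Mh k P' R) (hk : k ≤ m + K)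

/-- **THE TWO LETTERS TOGETHER, AT ONE FINE BOND**: `|((V_P + V_Q)g)(f)| ≤ Θ·A·B·(L^{2k}/L^{2j(p)})·e^{½δd(y,p)}·e^{−½δd(y,y′,Ω)}` with
`Θ = (d+1)c(C_Δ + C_P e^{2δ}(1+L²)) + 2b₁e^{(5/2)δ}(1+L²)`. [cite: Balaban1985BackgroundPropagators, Thm 3.14 (3.154) p.427; Balaban1984PropagatorsII, (2.19)–(2.22) p.226] -/
theorem abs_V_apply_le (hk1 : 1 ≤ k) (hMh : 1 ≤ Mh) (hP : ∀ μ, 1 ≤ P' μ) (hRM : 1 ≤ R * ((ℓ + 1) * Mh))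
    {δ c CΔ CP b₁ A B cf : ℝ} (hδ : 0 ≤ δ) (hcf : cf ≠ 0) (hCΔ : 0 ≤ CΔ) (hCP : 0 ≤ CP) (hb₁ : 0 ≤ b₁) (hA : 0 ≤ A) (hB : 0 ≤ B)
    (hc : 0 ≤ c) (hthr : ((ℓ : ℝ) + 1) ^ 2 ≤ Real.exp (1 / 4 * δ * ((R : ℝ) * (((ℓ : ℝ) + 1) * Mh) - 1)))
    (h261 : Ineq261With c (geomT D) δ (1 / 4)) (h261' : Ineq261With c (geomT D') δ (1 / 4))
    (hΔ : ∀ (p q : ℕ × (Fin (d + 1) → ℤ)) (hpD : p ∈ bset D.toDomains) (hpD' : p ∈ bset D'.toDomains)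
      (hqD : q ∈ bset D.toDomains) (hqD' : q ∈ bset D'.toDomains), p.1 = k → q.1 = k →
      ∀ (x x' : ↥(boxDom (N0 ℓ Mh k P'))), blkOf D.toDomains x = ⟨p, hpD⟩ → blkOf D.toDomains x' = ⟨q, hqD⟩ →
      ∀ μ ν : Fin (d + 1), |dPd D μ ν x x' - dPd D' μ ν x x'|
        ≤ CΔ * ((((ℓ : ℝ) + 1) ^ k) ^ 2)⁻¹ * ((((ℓ : ℝ) + 1) ^ k) ^ (d + 1))⁻¹
          * Real.exp (-(δ * min ((geomT D).dist ⟨p, hpD⟩ ⟨q, hqD⟩) ((geomT D').dist ⟨p, hpD'⟩ ⟨q, hqD'⟩)))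
          * Real.exp (-(δ * dOmega D D' p.2 q.2)))
    (hPD : ∀ (μ ν : Fin (d + 1)) (x x' : ↥(boxDom (N0 ℓ Mh k P'))),
      |dPd D μ ν x x'| ≤ CP * ((((ℓ : ℝ) + 1) ^ D.lev x.1) ^ 2)⁻¹ * (W D.toDomains (blkOf D.toDomains x'))⁻¹ *
        Real.exp (-(δ * (geomT D).dist (blkOf D.toDomains x) (blkOf D.toDomains x'))))
    (hPD' : ∀ (μ ν : Fin (d + 1)) (x x' : ↥(boxDom (N0 ℓ Mh k P'))),
      |dPd D' μ ν x x'| ≤ CP * ((((ℓ : ℝ) + 1) ^ D'.lev x.1) ^ 2)⁻¹ * (W D'.toDomains (blkOf D'.toDomains x'))⁻¹ *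
        Real.exp (-(δ * (geomT D').dist (blkOf D'.toDomains x) (blkOf D'.toDomains x'))))
    {w : BondIdx (domT hN D hk) → ℝ} {w' : BondIdx (domT hN D' hk) → ℝ} (hw0 : ∀ i, 0 ≤ w i) (hw0' : ∀ i', 0 ≤ w' i')
    (hwb : ∀ i, w i ≤ b₁ * cf ^ 2 * ((((ℓ : ℝ) + 1) ^ (i.1.1 : ℕ)) ^ (d + 1)) * (((((ℓ : ℝ) + 1) ^ (i.1.1 : ℕ)) ^ 2))⁻¹)
    (hwb' : ∀ i', w' i' ≤ b₁ * cf ^ 2 * ((((ℓ : ℝ) + 1) ^ (i'.1.1 : ℕ)) ^ (d + 1)) * (((((ℓ : ℝ) + 1) ^ (i'.1.1 : ℕ)) ^ 2))⁻¹)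
    (hww : ∀ (i : BondIdx (domT hN D hk)) (i' : BondIdx (domT hN D' hk)), i.1 = i'.1 → w i = w' i')
    {y : ↥(bset D.toDomains)} (hy : y.1.1 = k) {y' : ↥(bset D'.toDomains)} (hy' : y'.1.1 = k)
    {g : PBond (PV d ℓ m K hd hL) 0 → ℝ}
    (hg : ∀ v, |g v| ≤ A * pref cf (blkV1 hN D' v) * Real.exp (-(δ * (geomT D').dist (blkV1 hN D' v) y')) * B)
    (f : PBond (PV d ℓ m K hd hL) 0) :
    |(VP hN D D' cf + VQ hN D D' hk w w') g f| ≤ (((d : ℝ) + 1) * c * (CΔ + CP * Real.exp (2 * δ) * (1 + ((ℓ : ℝ) + 1) ^ 2)) + 2 * b₁ * Real.exp (5 / 2 * δ) * (1 + ((ℓ : ℝ) + 1) ^ 2)) * A * B * (((ℓ : ℝ) + 1) ^ (2 * k) / ((ℓ : ℝ) + 1) ^ (2 * (blkV1 hN D f).1.1)) * (Real.exp (1 / 2 * δ * (geomT D).dist y (blkV1 hN D f)) * Real.exp (-(1 / 2 * δ * dOmega D D' y.1.2 y'.1.2))) := by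
  have hVP := abs_VP_apply_le hN D D' hMh hP hRM hδ hcf hCΔ hCP hA hB hc hthr h261 h261' hΔ hPD hPD' hy hy' hg f
  have hQ1 := abs_QsE_trunc_le hN D D' hk hk1 hMh hP hδ hcf hb₁ hA hB hw0 hwb hy hy' hg f
  have hQ2 := abs_QsE_trunc'_le hN D D' hk hk1 hMh hP hRM hδ hcf hb₁ hA hB hthr hw0' hwb' hy hy' hg f
  have hρ1 : 1 ≤ (((ℓ : ℝ) + 1) ^ (2 * k) / ((ℓ : ℝ) + 1) ^ (2 * (blkV1 hN D f).1.1)) := one_le_ratio D _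
  have hVQ : |VQ hN D D' hk w w' g f| ≤ 2 * b₁ * A * B * ((ℓ : ℝ) + 1) ^ 2 * Real.exp (5 / 2 * δ) * (Real.exp (1 / 2 * δ * (geomT D).dist y (blkV1 hN D f)) * Real.exp (-(1 / 2 * δ * dOmega D D' y.1.2 y'.1.2)))
      + 2 * b₁ * A * B * Real.exp (5 / 2 * δ) * (((ℓ : ℝ) + 1) ^ (2 * k) / ((ℓ : ℝ) + 1) ^ (2 * (blkV1 hN D f).1.1)) * (Real.exp (1 / 2 * δ * (geomT D).dist y (blkV1 hN D f)) * Real.exp (-(1 / 2 * δ * dOmega D D' y.1.2 y'.1.2))) := by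
    rw [VQ_apply_eq hN D D' hk hww g f]
    exact (abs_sub _ _).trans (add_le_add hQ2 hQ1)
  rw [LinearMap.add_apply, Pi.add_apply]
  refine (abs_add_le _ _).trans ((add_le_add hVP hVQ).trans ?_)
  have h1 : 2 * b₁ * A * B * ((ℓ : ℝ) + 1) ^ 2 * Real.exp (5 / 2 * δ) * (Real.exp (1 / 2 * δ * (geomT D).dist y (blkV1 hN D f)) * Real.exp (-(1 / 2 * δ * dOmega D D' y.1.2 y'.1.2)))
      ≤ 2 * b₁ * A * B * ((ℓ : ℝ) + 1) ^ 2 * Real.exp (5 / 2 * δ) * (Real.exp (1 / 2 * δ * (geomT D).dist y (blkV1 hN D f)) * Real.exp (-(1 / 2 * δ * dOmega D D' y.1.2 y'.1.2))) * (((ℓ : ℝ) + 1) ^ (2 * k) / ((ℓ : ℝ) + 1) ^ (2 * (blkV1 hN D f).1.1)) :=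
    le_mul_of_one_le_right (by positivity) hρ1
  have e : (((d : ℝ) + 1) * c * (CΔ + CP * Real.exp (2 * δ) * (1 + ((ℓ : ℝ) + 1) ^ 2)) + 2 * b₁ * Real.exp (5 / 2 * δ) * (1 + ((ℓ : ℝ) + 1) ^ 2)) * A * B * (((ℓ : ℝ) + 1) ^ (2 * k) / ((ℓ : ℝ) + 1) ^ (2 * (blkV1 hN D f).1.1)) * (Real.exp (1 / 2 * δ * (geomT D).dist y (blkV1 hN D f)) * Real.exp (-(1 / 2 * δ * dOmega D D' y.1.2 y'.1.2)))
      = ((d : ℝ) + 1) * c * (CΔ + CP * Real.exp (2 * δ) * (1 + ((ℓ : ℝ) + 1) ^ 2)) * A * B * (((ℓ : ℝ) + 1) ^ (2 * k) / ((ℓ : ℝ) + 1) ^ (2 * (blkV1 hN D f).1.1)) * (Real.exp (1 / 2 * δ * (geomT D).dist y (blkV1 hN D f)) * Real.exp (-(1 / 2 * δ * dOmega D D' y.1.2 y'.1.2)))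
        + (2 * b₁ * A * B * ((ℓ : ℝ) + 1) ^ 2 * Real.exp (5 / 2 * δ) * (Real.exp (1 / 2 * δ * (geomT D).dist y (blkV1 hN D f)) * Real.exp (-(1 / 2 * δ * dOmega D D' y.1.2 y'.1.2))) * (((ℓ : ℝ) + 1) ^ (2 * k) / ((ℓ : ℝ) + 1) ^ (2 * (blkV1 hN D f).1.1))
          + 2 * b₁ * A * B * Real.exp (5 / 2 * δ) * (((ℓ : ℝ) + 1) ^ (2 * k) / ((ℓ : ℝ) + 1) ^ (2 * (blkV1 hN D f).1.1)) * (Real.exp (1 / 2 * δ * (geomT D).dist y (blkV1 hN D f)) * Real.exp (-(1 / 2 * δ * dOmega D D' y.1.2 y'.1.2)))) := by ring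
  rw [e]
  linarith

/-- **THE ENGINE OF (3.154) FOR `G[Ω]·(V_P + V_Q)·G[Ω′]μ`**: under the majorant (2.136)₁ of the outer factor `G[Ω]` and the profile of the inner
output `g = G[Ω′]μ` (`supp μ ⊂ B(y′)`, `|μ| ≤ B`), at every fine bond `x ∈ B(y)` (top block of `{Ω_j}`):
`|(G[Ω](V_P + V_Q)g)(x)| ≤ Θ·L²·c·A²·B·pref(y)·e^{−½δd(y,y′,Ω)}` — the block decomposition of `(V_P + V_Q)g` against the majorant
(`abs_le_sum_of_hasMajorant`), the transfer `(L^{2k}/L^{2j(p)})e^{−¼δd(y,p)} ≤ L²` ((2.60)) and (2.61) for the last sum over `p`.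
[cite: Balaban1985BackgroundPropagators, Thm 3.14 (3.154) p.427; Balaban1984PropagatorsII, (2.60)–(2.61) p.234, (2.136) p.247] -/
theorem engine (hk1 : 1 ≤ k) (hMh : 1 ≤ Mh) (hP : ∀ μ, 1 ≤ P' μ) (hRM : 1 ≤ R * ((ℓ + 1) * Mh))
    {δ c CΔ CP b₁ A B cf : ℝ} (hδ : 0 ≤ δ) (hcf : cf ≠ 0) (hCΔ : 0 ≤ CΔ) (hCP : 0 ≤ CP) (hb₁ : 0 ≤ b₁) (hA : 0 ≤ A) (hB : 0 ≤ B)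
    (hc : 0 ≤ c) (hthr : ((ℓ : ℝ) + 1) ^ 2 ≤ Real.exp (1 / 4 * δ * ((R : ℝ) * (((ℓ : ℝ) + 1) * Mh) - 1)))
    (h261 : Ineq261With c (geomT D) δ (1 / 4)) (h261' : Ineq261With c (geomT D') δ (1 / 4))
    (hΔ : ∀ (p q : ℕ × (Fin (d + 1) → ℤ)) (hpD : p ∈ bset D.toDomains) (hpD' : p ∈ bset D'.toDomains)
      (hqD : q ∈ bset D.toDomains) (hqD' : q ∈ bset D'.toDomains), p.1 = k → q.1 = k →
      ∀ (x x' : ↥(boxDom (N0 ℓ Mh k P'))), blkOf D.toDomains x = ⟨p, hpD⟩ → blkOf D.toDomains x' = ⟨q, hqD⟩ →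
      ∀ μ ν : Fin (d + 1), |dPd D μ ν x x' - dPd D' μ ν x x'|
        ≤ CΔ * ((((ℓ : ℝ) + 1) ^ k) ^ 2)⁻¹ * ((((ℓ : ℝ) + 1) ^ k) ^ (d + 1))⁻¹
          * Real.exp (-(δ * min ((geomT D).dist ⟨p, hpD⟩ ⟨q, hqD⟩) ((geomT D').dist ⟨p, hpD'⟩ ⟨q, hqD'⟩)))
          * Real.exp (-(δ * dOmega D D' p.2 q.2)))
    (hPD : ∀ (μ ν : Fin (d + 1)) (x x' : ↥(boxDom (N0 ℓ Mh k P'))),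
      |dPd D μ ν x x'| ≤ CP * ((((ℓ : ℝ) + 1) ^ D.lev x.1) ^ 2)⁻¹ * (W D.toDomains (blkOf D.toDomains x'))⁻¹ *
        Real.exp (-(δ * (geomT D).dist (blkOf D.toDomains x) (blkOf D.toDomains x'))))
    (hPD' : ∀ (μ ν : Fin (d + 1)) (x x' : ↥(boxDom (N0 ℓ Mh k P'))),
      |dPd D' μ ν x x'| ≤ CP * ((((ℓ : ℝ) + 1) ^ D'.lev x.1) ^ 2)⁻¹ * (W D'.toDomains (blkOf D'.toDomains x'))⁻¹ *
        Real.exp (-(δ * (geomT D').dist (blkOf D'.toDomains x) (blkOf D'.toDomains x'))))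
    {w : BondIdx (domT hN D hk) → ℝ} {w' : BondIdx (domT hN D' hk) → ℝ} (hw0 : ∀ i, 0 ≤ w i) (hw0' : ∀ i', 0 ≤ w' i')
    (hwb : ∀ i, w i ≤ b₁ * cf ^ 2 * ((((ℓ : ℝ) + 1) ^ (i.1.1 : ℕ)) ^ (d + 1)) * (((((ℓ : ℝ) + 1) ^ (i.1.1 : ℕ)) ^ 2))⁻¹)
    (hwb' : ∀ i', w' i' ≤ b₁ * cf ^ 2 * ((((ℓ : ℝ) + 1) ^ (i'.1.1 : ℕ)) ^ (d + 1)) * (((((ℓ : ℝ) + 1) ^ (i'.1.1 : ℕ)) ^ 2))⁻¹)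
    (hww : ∀ (i : BondIdx (domT hN D hk)) (i' : BondIdx (domT hN D' hk)), i.1 = i'.1 → w i = w' i')
    {GD : Module.End ℝ (PBond (PV d ℓ m K hd hL) 0 → ℝ)}
    (hG : HasMajorant (g := geomT D) (blkV1 hN D) GD (fun a b => A * pref cf a * Real.exp (-(δ * (geomT D).dist a b))))
    {y : ↥(bset D.toDomains)} (hy : y.1.1 = k) {y' : ↥(bset D'.toDomains)} (hy' : y'.1.1 = k)
    {g : PBond (PV d ℓ m K hd hL) 0 → ℝ}
    (hg : ∀ v, |g v| ≤ A * pref cf (blkV1 hN D' v) * Real.exp (-(δ * (geomT D').dist (blkV1 hN D' v) y')) * B)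
    (x : PBond (PV d ℓ m K hd hL) 0) (hx : blkV1 hN D x = y) :
    |GD ((VP hN D D' cf + VQ hN D D' hk w w') g) x|
      ≤ (((d : ℝ) + 1) * c * (CΔ + CP * Real.exp (2 * δ) * (1 + ((ℓ : ℝ) + 1) ^ 2)) + 2 * b₁ * Real.exp (5 / 2 * δ) * (1 + ((ℓ : ℝ) + 1) ^ 2)) * ((ℓ : ℝ) + 1) ^ 2 * c * A ^ 2 * B * pref cf y * Real.exp (-(1 / 2 * δ * dOmega D D' y.1.2 y'.1.2)) := by
  have hsymm := B8Ineq192MultiLevelTorus.symmT D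
  -- the per-block bound of §4–§5
  have hU := abs_le_sum_of_hasMajorant (g := geomT D) (blkV1 hN D) hG ((VP hN D D' cf + VQ hN D D' hk w w') g)
    (fun p => (((d : ℝ) + 1) * c * (CΔ + CP * Real.exp (2 * δ) * (1 + ((ℓ : ℝ) + 1) ^ 2)) + 2 * b₁ * Real.exp (5 / 2 * δ) * (1 + ((ℓ : ℝ) + 1) ^ 2)) * A * B * (((ℓ : ℝ) + 1) ^ (2 * k) / ((ℓ : ℝ) + 1) ^ (2 * p.1.1))
      * (Real.exp (1 / 2 * δ * (geomT D).dist y p) * Real.exp (-(1 / 2 * δ * dOmega D D' y.1.2 y'.1.2))))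
    (fun p => by positivity) (fun f => abs_V_apply_le hN D D' hk hk1 hMh hP hRM hδ hcf hCΔ hCP hb₁ hA hB hc hthr h261 h261' hΔ hPD hPD' hw0 hw0' hwb hwb' hww hy hy' hg f) x
  refine hU.trans ?_
  rw [hx]
  -- each block term: the transfer (2.60) in `{Ω_j}`
  have hterm : ∀ p : ↥(bset D.toDomains),
      A * pref cf y * Real.exp (-(δ * (geomT D).dist y p))
        * ((((d : ℝ) + 1) * c * (CΔ + CP * Real.exp (2 * δ) * (1 + ((ℓ : ℝ) + 1) ^ 2)) + 2 * b₁ * Real.exp (5 / 2 * δ) * (1 + ((ℓ : ℝ) + 1) ^ 2)) * A * B * (((ℓ : ℝ) + 1) ^ (2 * k) / ((ℓ : ℝ) + 1) ^ (2 * p.1.1))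
          * (Real.exp (1 / 2 * δ * (geomT D).dist y p) * Real.exp (-(1 / 2 * δ * dOmega D D' y.1.2 y'.1.2))))
      ≤ (((d : ℝ) + 1) * c * (CΔ + CP * Real.exp (2 * δ) * (1 + ((ℓ : ℝ) + 1) ^ 2)) + 2 * b₁ * Real.exp (5 / 2 * δ) * (1 + ((ℓ : ℝ) + 1) ^ 2)) * ((ℓ : ℝ) + 1) ^ 2 * A ^ 2 * B * pref cf y * Real.exp (-(1 / 2 * δ * dOmega D D' y.1.2 y'.1.2))
        * Real.exp (-(1 / 4 * δ * (geomT D).dist y p)) := by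
    intro p
    have htr := transfer_top D hMh hP hRM hδ hthr p y hy
    rw [hsymm p y] at htr
    have hsplit : Real.exp (-(δ * (geomT D).dist y p)) * Real.exp (1 / 2 * δ * (geomT D).dist y p)
        = Real.exp (-(1 / 4 * δ * (geomT D).dist y p)) * Real.exp (-(1 / 4 * δ * (geomT D).dist y p)) := by
      rw [← Real.exp_add, ← Real.exp_add]
      congr 1; ring
    calc A * pref cf y * Real.exp (-(δ * (geomT D).dist y p))
          * ((((d : ℝ) + 1) * c * (CΔ + CP * Real.exp (2 * δ) * (1 + ((ℓ : ℝ) + 1) ^ 2)) + 2 * b₁ * Real.exp (5 / 2 * δ) * (1 + ((ℓ : ℝ) + 1) ^ 2)) * A * B * (((ℓ : ℝ) + 1) ^ (2 * k) / ((ℓ : ℝ) + 1) ^ (2 * p.1.1))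
            * (Real.exp (1 / 2 * δ * (geomT D).dist y p) * Real.exp (-(1 / 2 * δ * dOmega D D' y.1.2 y'.1.2))))
        = (((d : ℝ) + 1) * c * (CΔ + CP * Real.exp (2 * δ) * (1 + ((ℓ : ℝ) + 1) ^ 2)) + 2 * b₁ * Real.exp (5 / 2 * δ) * (1 + ((ℓ : ℝ) + 1) ^ 2)) * A ^ 2 * B * pref cf y * Real.exp (-(1 / 2 * δ * dOmega D D' y.1.2 y'.1.2))
          * ((((ℓ : ℝ) + 1) ^ (2 * k) / ((ℓ : ℝ) + 1) ^ (2 * p.1.1))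
            * (Real.exp (-(δ * (geomT D).dist y p)) * Real.exp (1 / 2 * δ * (geomT D).dist y p))) := by ring
      _ = (((d : ℝ) + 1) * c * (CΔ + CP * Real.exp (2 * δ) * (1 + ((ℓ : ℝ) + 1) ^ 2)) + 2 * b₁ * Real.exp (5 / 2 * δ) * (1 + ((ℓ : ℝ) + 1) ^ 2)) * A ^ 2 * B * pref cf y * Real.exp (-(1 / 2 * δ * dOmega D D' y.1.2 y'.1.2))
          * ((((ℓ : ℝ) + 1) ^ (2 * k) / ((ℓ : ℝ) + 1) ^ (2 * p.1.1) * Real.exp (-(1 / 4 * δ * (geomT D).dist y p)))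
            * Real.exp (-(1 / 4 * δ * (geomT D).dist y p))) := by rw [hsplit]; ring
      _ ≤ (((d : ℝ) + 1) * c * (CΔ + CP * Real.exp (2 * δ) * (1 + ((ℓ : ℝ) + 1) ^ 2)) + 2 * b₁ * Real.exp (5 / 2 * δ) * (1 + ((ℓ : ℝ) + 1) ^ 2)) * A ^ 2 * B * pref cf y * Real.exp (-(1 / 2 * δ * dOmega D D' y.1.2 y'.1.2))
          * (((ℓ : ℝ) + 1) ^ 2 * Real.exp (-(1 / 4 * δ * (geomT D).dist y p))) := by
          have h0 : 0 ≤ (((d : ℝ) + 1) * c * (CΔ + CP * Real.exp (2 * δ) * (1 + ((ℓ : ℝ) + 1) ^ 2)) + 2 * b₁ * Real.exp (5 / 2 * δ) * (1 + ((ℓ : ℝ) + 1) ^ 2)) * A ^ 2 * B * pref cf y * Real.exp (-(1 / 2 * δ * dOmega D D' y.1.2 y'.1.2)) := by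
            have := pref_nonneg cf y
            positivity
          exact mul_le_mul_of_nonneg_left (mul_le_mul_of_nonneg_right htr (Real.exp_pos _).le) h0
      _ = _ := by ring
  refine (Finset.sum_le_sum fun p _ => hterm p).trans ?_
  rw [← Finset.mul_sum]
  have h0 : 0 ≤ (((d : ℝ) + 1) * c * (CΔ + CP * Real.exp (2 * δ) * (1 + ((ℓ : ℝ) + 1) ^ 2)) + 2 * b₁ * Real.exp (5 / 2 * δ) * (1 + ((ℓ : ℝ) + 1) ^ 2)) * ((ℓ : ℝ) + 1) ^ 2 * A ^ 2 * B * pref cf y * Real.exp (-(1 / 2 * δ * dOmega D D' y.1.2 y'.1.2)) := by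
    have := pref_nonneg cf y
    positivity
  calc (((d : ℝ) + 1) * c * (CΔ + CP * Real.exp (2 * δ) * (1 + ((ℓ : ℝ) + 1) ^ 2)) + 2 * b₁ * Real.exp (5 / 2 * δ) * (1 + ((ℓ : ℝ) + 1) ^ 2)) * ((ℓ : ℝ) + 1) ^ 2 * A ^ 2 * B * pref cf y * Real.exp (-(1 / 2 * δ * dOmega D D' y.1.2 y'.1.2))
        * ∑ p : ↥(bset D.toDomains), Real.exp (-(1 / 4 * δ * (geomT D).dist y p))
      ≤ (((d : ℝ) + 1) * c * (CΔ + CP * Real.exp (2 * δ) * (1 + ((ℓ : ℝ) + 1) ^ 2)) + 2 * b₁ * Real.exp (5 / 2 * δ) * (1 + ((ℓ : ℝ) + 1) ^ 2)) * ((ℓ : ℝ) + 1) ^ 2 * A ^ 2 * B * pref cf y * Real.exp (-(1 / 2 * δ * dOmega D D' y.1.2 y'.1.2)) * c :=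
        mul_le_mul_of_nonneg_left (h261 y) h0
    _ = _ := by ring

/-- the support datum of the inner factor moves between the two block maps on a common top block.
[cite: Balaban1984PropagatorsII, (2.45) p.231, dictionary] -/
theorem blockSupp_transfer_V1 {p : ℕ × (Fin (d + 1) → ℤ)} (hp : p ∈ bset D.toDomains) (hp' : p ∈ bset D'.toDomains)
    {μ : PBond (PV d ℓ m K hd hL) 0 → ℝ} {B : ℝ} (h : BlockSupp (g := geomT D') (blkV1 hN D') μ ⟨p, hp'⟩ B) :
    BlockSupp (g := geomT D) (blkV1 hN D) μ ⟨p, hp⟩ B where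
  nonneg := h.nonneg
  bound := fun v hv => h.bound v ((blkOf_eq_iff_blkOf_eq D D' hp hp' (toBox hN v.src)).1 hv)
  off := fun v hv => h.off v fun h' => hv ((blkOf_eq_iff_blkOf_eq D D' hp hp' (toBox hN v.src)).2 h')

/-- **THE PLAIN-DECAY HALF**: `|(Gμ)(x) − (G′μ)(x)| ≤ 2A·pref(y)·e^{−δ·min(d(y,y′), d′(y,y′))}·B` for `x ∈ B(y)`, `supp μ ⊂ B(y′)`, `y, y′`
common top blocks — each term by its own majorant. [cite: Balaban1985BackgroundPropagators, Thm 3.14 (3.153) p.427; Balaban1984PropagatorsII, (2.136) p.247] -/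
theorem trivial_bound_V1 {δ A cf : ℝ} (hδ : 0 ≤ δ) (hA : 0 ≤ A)
    {GD GD' : Module.End ℝ (PBond (PV d ℓ m K hd hL) 0 → ℝ)}
    (hG : HasMajorant (g := geomT D) (blkV1 hN D) GD (fun a b => A * pref cf a * Real.exp (-(δ * (geomT D).dist a b))))
    (hG' : HasMajorant (g := geomT D') (blkV1 hN D') GD' (fun a b => A * pref cf a * Real.exp (-(δ * (geomT D').dist a b))))
    {y : ↥(bset D.toDomains)} (hyD' : y.1 ∈ bset D'.toDomains) {y' : ↥(bset D'.toDomains)} (hy'D : y'.1 ∈ bset D.toDomains)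
    {μ : PBond (PV d ℓ m K hd hL) 0 → ℝ} {B : ℝ} (hμ : BlockSupp (g := geomT D') (blkV1 hN D') μ y' B)
    (x : PBond (PV d ℓ m K hd hL) 0) (hx : blkV1 hN D x = y) :
    |GD μ x - GD' μ x| ≤ 2 * A * (pref cf y * B)
      * Real.exp (-(δ * min ((geomT D).dist y ⟨y'.1, hy'D⟩) ((geomT D').dist ⟨y.1, hyD'⟩ y'))) := by
  have hBn : 0 ≤ B := hμ.nonneg
  have hμD : BlockSupp (g := geomT D) (blkV1 hN D) μ ⟨y'.1, hy'D⟩ B := blockSupp_transfer_V1 hN D D' hy'D y'.2 hμ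
  have hx' : blkV1 hN D' x = ⟨y.1, hyD'⟩ := (blkOf_eq_iff_blkOf_eq D D' y.2 hyD' (toBox hN x.src)).1 hx
  have h1 : |GD μ x| ≤ A * pref cf y * Real.exp (-(δ * (geomT D).dist y ⟨y'.1, hy'D⟩)) * B := by
    have h := hG ⟨y'.1, hy'D⟩ μ B hμD x
    rw [hx] at h
    exact h
  have h2 : |GD' μ x| ≤ A * pref cf y * Real.exp (-(δ * (geomT D').dist ⟨y.1, hyD'⟩ y')) * B := by
    have h := hG' y' μ B hμ x
    rw [hx'] at h
    exact h
  have hp0 := pref_nonneg cf y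
  have hmin1 := min_le_left ((geomT D).dist y ⟨y'.1, hy'D⟩) ((geomT D').dist ⟨y.1, hyD'⟩ y')
  have hmin2 := min_le_right ((geomT D).dist y ⟨y'.1, hy'D⟩) ((geomT D').dist ⟨y.1, hyD'⟩ y')
  have he1 : Real.exp (-(δ * (geomT D).dist y ⟨y'.1, hy'D⟩))
      ≤ Real.exp (-(δ * min ((geomT D).dist y ⟨y'.1, hy'D⟩) ((geomT D').dist ⟨y.1, hyD'⟩ y'))) :=
    Real.exp_le_exp.2 (by have := mul_le_mul_of_nonneg_left hmin1 hδ; linarith)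
  have he2 : Real.exp (-(δ * (geomT D').dist ⟨y.1, hyD'⟩ y'))
      ≤ Real.exp (-(δ * min ((geomT D).dist y ⟨y'.1, hy'D⟩) ((geomT D').dist ⟨y.1, hyD'⟩ y'))) :=
    Real.exp_le_exp.2 (by have := mul_le_mul_of_nonneg_left hmin2 hδ; linarith)
  have hmax : Real.exp (-(δ * (geomT D).dist y ⟨y'.1, hy'D⟩)) + Real.exp (-(δ * (geomT D').dist ⟨y.1, hyD'⟩ y'))
      ≤ 2 * Real.exp (-(δ * min ((geomT D).dist y ⟨y'.1, hy'D⟩) ((geomT D').dist ⟨y.1, hyD'⟩ y'))) := by linarith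
  calc |GD μ x - GD' μ x| ≤ |GD μ x| + |GD' μ x| := abs_sub _ _
    _ ≤ A * pref cf y * Real.exp (-(δ * (geomT D).dist y ⟨y'.1, hy'D⟩)) * B
        + A * pref cf y * Real.exp (-(δ * (geomT D').dist ⟨y.1, hyD'⟩ y')) * B := add_le_add h1 h2
    _ = A * (pref cf y * B) * (Real.exp (-(δ * (geomT D).dist y ⟨y'.1, hy'D⟩)) + Real.exp (-(δ * (geomT D').dist ⟨y.1, hyD'⟩ y'))) := by
        ring
    _ ≤ A * (pref cf y * B) * (2 * Real.exp (-(δ * min ((geomT D).dist y ⟨y'.1, hy'D⟩) ((geomT D').dist ⟨y.1, hyD'⟩ y')))) :=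
        mul_le_mul_of_nonneg_left hmax (by positivity)
    _ = _ := by ring

/-- **THEOREM 3.14 (3.154) AT U = 1 FOR A PAIR OF OPERATORS WITH THE (2.136)₁ MAJORANTS AND THE RESOLVENT IDENTITY THROUGH THE TWO
LETTERS** (the abstract form the assembly instantiates with `G = Δ_a⁻¹[Ω]`, `G′ = Δ_a⁻¹[Ω′]` of Sect. A): for `x ∈ B(y)`, `supp μ ⊂ B(y′)`, `|μ| ≤ B`,
`y, y′` common top blocks,
`|(Gμ)(x) − (G′μ)(x)| ≤ √(2A)·√(ΘL²cA²)·pref(y)·B·e^{−½δ·min(d(y,y′), d′(y,y′))}·e^{−¼δ·d(y,y′,Ω)}`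
— the geometric mean (`combined_bound`) of the plain-decay half (`trivial_bound_V1`) and the `Ω`-half (`engine`), print's «after adjusting a
definition of δ₀». [cite: Balaban1985BackgroundPropagators, Thm 3.14 (3.153)–(3.154) pp.426–427; Balaban1984PropagatorsII, (2.22) p.226, Prop. 2.6 (2.136) p.247] -/
theorem resolvent_diff_bound (hk1 : 1 ≤ k) (hMh : 1 ≤ Mh) (hP : ∀ μ, 1 ≤ P' μ) (hRM : 1 ≤ R * ((ℓ + 1) * Mh))
    {δ c CΔ CP b₁ A B cf : ℝ} (hδ : 0 ≤ δ) (hcf : cf ≠ 0) (hCΔ : 0 ≤ CΔ) (hCP : 0 ≤ CP) (hb₁ : 0 ≤ b₁) (hA : 0 ≤ A) (hB : 0 ≤ B)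
    (hc : 0 ≤ c) (hthr : ((ℓ : ℝ) + 1) ^ 2 ≤ Real.exp (1 / 4 * δ * ((R : ℝ) * (((ℓ : ℝ) + 1) * Mh) - 1)))
    (h261 : Ineq261With c (geomT D) δ (1 / 4)) (h261' : Ineq261With c (geomT D') δ (1 / 4))
    (hΔ : ∀ (p q : ℕ × (Fin (d + 1) → ℤ)) (hpD : p ∈ bset D.toDomains) (hpD' : p ∈ bset D'.toDomains)
      (hqD : q ∈ bset D.toDomains) (hqD' : q ∈ bset D'.toDomains), p.1 = k → q.1 = k →
      ∀ (x x' : ↥(boxDom (N0 ℓ Mh k P'))), blkOf D.toDomains x = ⟨p, hpD⟩ → blkOf D.toDomains x' = ⟨q, hqD⟩ →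
      ∀ μ ν : Fin (d + 1), |dPd D μ ν x x' - dPd D' μ ν x x'|
        ≤ CΔ * ((((ℓ : ℝ) + 1) ^ k) ^ 2)⁻¹ * ((((ℓ : ℝ) + 1) ^ k) ^ (d + 1))⁻¹
          * Real.exp (-(δ * min ((geomT D).dist ⟨p, hpD⟩ ⟨q, hqD⟩) ((geomT D').dist ⟨p, hpD'⟩ ⟨q, hqD'⟩)))
          * Real.exp (-(δ * dOmega D D' p.2 q.2)))
    (hPD : ∀ (μ ν : Fin (d + 1)) (x x' : ↥(boxDom (N0 ℓ Mh k P'))),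
      |dPd D μ ν x x'| ≤ CP * ((((ℓ : ℝ) + 1) ^ D.lev x.1) ^ 2)⁻¹ * (W D.toDomains (blkOf D.toDomains x'))⁻¹ *
        Real.exp (-(δ * (geomT D).dist (blkOf D.toDomains x) (blkOf D.toDomains x'))))
    (hPD' : ∀ (μ ν : Fin (d + 1)) (x x' : ↥(boxDom (N0 ℓ Mh k P'))),
      |dPd D' μ ν x x'| ≤ CP * ((((ℓ : ℝ) + 1) ^ D'.lev x.1) ^ 2)⁻¹ * (W D'.toDomains (blkOf D'.toDomains x'))⁻¹ *
        Real.exp (-(δ * (geomT D').dist (blkOf D'.toDomains x) (blkOf D'.toDomains x'))))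
    {w : BondIdx (domT hN D hk) → ℝ} {w' : BondIdx (domT hN D' hk) → ℝ} (hw0 : ∀ i, 0 ≤ w i) (hw0' : ∀ i', 0 ≤ w' i')
    (hwb : ∀ i, w i ≤ b₁ * cf ^ 2 * ((((ℓ : ℝ) + 1) ^ (i.1.1 : ℕ)) ^ (d + 1)) * (((((ℓ : ℝ) + 1) ^ (i.1.1 : ℕ)) ^ 2))⁻¹)
    (hwb' : ∀ i', w' i' ≤ b₁ * cf ^ 2 * ((((ℓ : ℝ) + 1) ^ (i'.1.1 : ℕ)) ^ (d + 1)) * (((((ℓ : ℝ) + 1) ^ (i'.1.1 : ℕ)) ^ 2))⁻¹)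
    (hww : ∀ (i : BondIdx (domT hN D hk)) (i' : BondIdx (domT hN D' hk)), i.1 = i'.1 → w i = w' i')
    {GD GD' : Module.End ℝ (PBond (PV d ℓ m K hd hL) 0 → ℝ)}
    (hG : HasMajorant (g := geomT D) (blkV1 hN D) GD (fun a b => A * pref cf a * Real.exp (-(δ * (geomT D).dist a b))))
    (hG' : HasMajorant (g := geomT D') (blkV1 hN D') GD' (fun a b => A * pref cf a * Real.exp (-(δ * (geomT D').dist a b))))
    (hres : GD - GD' = GD ∘ₗ (VP hN D D' cf + VQ hN D D' hk w w') ∘ₗ GD')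
    {y : ↥(bset D.toDomains)} (hy : y.1.1 = k) (hyD' : y.1 ∈ bset D'.toDomains)
    {y' : ↥(bset D'.toDomains)} (hy' : y'.1.1 = k) (hy'D : y'.1 ∈ bset D.toDomains)
    {μ : PBond (PV d ℓ m K hd hL) 0 → ℝ} (hμ : BlockSupp (g := geomT D') (blkV1 hN D') μ y' B)
    (x : PBond (PV d ℓ m K hd hL) 0) (hx : blkV1 hN D x = y) :
    |GD μ x - GD' μ x| ≤ Real.sqrt (2 * A) * Real.sqrt ((((d : ℝ) + 1) * c * (CΔ + CP * Real.exp (2 * δ) * (1 + ((ℓ : ℝ) + 1) ^ 2)) + 2 * b₁ * Real.exp (5 / 2 * δ) * (1 + ((ℓ : ℝ) + 1) ^ 2)) * ((ℓ : ℝ) + 1) ^ 2 * c * A ^ 2) * (pref cf y * B)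
      * Real.exp (-(1 / 2 * δ * min ((geomT D).dist y ⟨y'.1, hy'D⟩) ((geomT D').dist ⟨y.1, hyD'⟩ y')))
      * Real.exp (-(1 / 4 * δ * dOmega D D' y.1.2 y'.1.2)) := by
  have hg : ∀ v, |GD' μ v| ≤ A * pref cf (blkV1 hN D' v) * Real.exp (-(δ * (geomT D').dist (blkV1 hN D' v) y')) * B :=
    fun v => hG' y' μ B hμ v
  have hEq : GD μ x - GD' μ x = GD ((VP hN D D' cf + VQ hN D D' hk w w') (GD' μ)) x := by
    have h := congrFun (LinearMap.congr_fun hres μ) x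
    rw [LinearMap.sub_apply, Pi.sub_apply, LinearMap.comp_apply, LinearMap.comp_apply] at h
    exact h
  have h1 := trivial_bound_V1 hN D D' hδ hA hG hG' hyD' hy'D hμ x hx
  have h2 := engine hN D D' hk hk1 hMh hP hRM hδ hcf hCΔ hCP hb₁ hA hB hc hthr h261 h261' hΔ hPD hPD' hw0 hw0' hwb hwb' hww hG hy hy' hg x hx
  rw [← hEq] at h2
  have h2' : |GD μ x - GD' μ x| ≤ ((((d : ℝ) + 1) * c * (CΔ + CP * Real.exp (2 * δ) * (1 + ((ℓ : ℝ) + 1) ^ 2)) + 2 * b₁ * Real.exp (5 / 2 * δ) * (1 + ((ℓ : ℝ) + 1) ^ 2)) * ((ℓ : ℝ) + 1) ^ 2 * c * A ^ 2) * (pref cf y * B)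
      * Real.exp (-(1 / 2 * δ * dOmega D D' y.1.2 y'.1.2)) := le_of_le_of_eq h2 (by ring)
  have hp0 := pref_nonneg cf y
  exact B9Thm314GpFlatMultiLevelTorus.combined_bound (by positivity) (by positivity) (by positivity) h1 h2'

end Engine


open B6Geom246MultiLevelTorus (triangle_refl_nonneg_T)
open B6RandomWalk (hasMajorant_mono delta3 delta3_pos)

open B6GradLegKLevelV1 (DV)
open B6SectAVectorModelV1 (GE)
open B9Thm314GpFlatMultiLevelTorus (consts_260_261)
open B6Prop26GradKLevelV1 (prop26_2136_grad_kLevel_unconditional_pad_V1)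
open B9Thm314PFlatMultiLevelTorus (thm314_P_flat_multiLevelTorus)
open B9Thm314GFlatV1Kernel (VP VQ onFun_GE_sub dPd_le member4_eq_dPd w_le_of_band)

/-! ## §7  The engine with a general outer prefactor (for the other members of (2.136)) -/

section General

variable (hN : ∀ μ, N0 ℓ Mh k P' μ = (PV d ℓ m K hd hL).sitesPerDir 0) (D D' : TDomains d ℓ Mh k P' R) (hk : k ≤ m + K)

/-- **THE ENGINE FOR AN OUTER FACTOR WITH A GENERAL PREFACTOR `φ`** (for (2.136)₂: `T = ∇G`, `φ(y) = L^{j(y)}η`): under a majorant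
`A′·φ(y)·e^{−δd}` of `T` and the profile of the inner output `g = G[Ω′]μ`, `|(T(V_P + V_Q)g)(x)| ≤ ΘL²c·A′A·B·φ(y)·e^{−½δd(y,y′,Ω)}` for `x ∈ B(y)`.
[cite: Balaban1985BackgroundPropagators, Thm 3.14 (3.154) p.427; Balaban1984PropagatorsII, (2.60)–(2.61) p.234, (2.136) p.247] -/
theorem engine_gen (hk1 : 1 ≤ k) (hMh : 1 ≤ Mh) (hP : ∀ μ, 1 ≤ P' μ) (hRM : 1 ≤ R * ((ℓ + 1) * Mh))
    {δ c CΔ CP b₁ A B cf : ℝ} (hδ : 0 ≤ δ) (hcf : cf ≠ 0) (hCΔ : 0 ≤ CΔ) (hCP : 0 ≤ CP) (hb₁ : 0 ≤ b₁) (hA : 0 ≤ A) (hB : 0 ≤ B)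
    (hc : 0 ≤ c) (hthr : ((ℓ : ℝ) + 1) ^ 2 ≤ Real.exp (1 / 4 * δ * ((R : ℝ) * (((ℓ : ℝ) + 1) * Mh) - 1)))
    (h261 : Ineq261With c (geomT D) δ (1 / 4)) (h261' : Ineq261With c (geomT D') δ (1 / 4))
    (hΔ : ∀ (p q : ℕ × (Fin (d + 1) → ℤ)) (hpD : p ∈ bset D.toDomains) (hpD' : p ∈ bset D'.toDomains)
      (hqD : q ∈ bset D.toDomains) (hqD' : q ∈ bset D'.toDomains), p.1 = k → q.1 = k →
      ∀ (x x' : ↥(boxDom (N0 ℓ Mh k P'))), blkOf D.toDomains x = ⟨p, hpD⟩ → blkOf D.toDomains x' = ⟨q, hqD⟩ →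
      ∀ μ ν : Fin (d + 1), |dPd D μ ν x x' - dPd D' μ ν x x'|
        ≤ CΔ * ((((ℓ : ℝ) + 1) ^ k) ^ 2)⁻¹ * ((((ℓ : ℝ) + 1) ^ k) ^ (d + 1))⁻¹
          * Real.exp (-(δ * min ((geomT D).dist ⟨p, hpD⟩ ⟨q, hqD⟩) ((geomT D').dist ⟨p, hpD'⟩ ⟨q, hqD'⟩)))
          * Real.exp (-(δ * dOmega D D' p.2 q.2)))
    (hPD : ∀ (μ ν : Fin (d + 1)) (x x' : ↥(boxDom (N0 ℓ Mh k P'))),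
      |dPd D μ ν x x'| ≤ CP * ((((ℓ : ℝ) + 1) ^ D.lev x.1) ^ 2)⁻¹ * (W D.toDomains (blkOf D.toDomains x'))⁻¹ *
        Real.exp (-(δ * (geomT D).dist (blkOf D.toDomains x) (blkOf D.toDomains x'))))
    (hPD' : ∀ (μ ν : Fin (d + 1)) (x x' : ↥(boxDom (N0 ℓ Mh k P'))),
      |dPd D' μ ν x x'| ≤ CP * ((((ℓ : ℝ) + 1) ^ D'.lev x.1) ^ 2)⁻¹ * (W D'.toDomains (blkOf D'.toDomains x'))⁻¹ *
        Real.exp (-(δ * (geomT D').dist (blkOf D'.toDomains x) (blkOf D'.toDomains x'))))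
    {w : BondIdx (domT hN D hk) → ℝ} {w' : BondIdx (domT hN D' hk) → ℝ} (hw0 : ∀ i, 0 ≤ w i) (hw0' : ∀ i', 0 ≤ w' i')
    (hwb : ∀ i, w i ≤ b₁ * cf ^ 2 * ((((ℓ : ℝ) + 1) ^ (i.1.1 : ℕ)) ^ (d + 1)) * (((((ℓ : ℝ) + 1) ^ (i.1.1 : ℕ)) ^ 2))⁻¹)
    (hwb' : ∀ i', w' i' ≤ b₁ * cf ^ 2 * ((((ℓ : ℝ) + 1) ^ (i'.1.1 : ℕ)) ^ (d + 1)) * (((((ℓ : ℝ) + 1) ^ (i'.1.1 : ℕ)) ^ 2))⁻¹)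
    (hww : ∀ (i : BondIdx (domT hN D hk)) (i' : BondIdx (domT hN D' hk)), i.1 = i'.1 → w i = w' i')
    {T : Module.End ℝ (PBond (PV d ℓ m K hd hL) 0 → ℝ)} {A' : ℝ} (hA' : 0 ≤ A') {φ : ↥(bset D.toDomains) → ℝ} (hφ : ∀ a, 0 ≤ φ a)
    (hT : HasMajorant (g := geomT D) (blkV1 hN D) T (fun a b => A' * φ a * Real.exp (-(δ * (geomT D).dist a b))))
    {y : ↥(bset D.toDomains)} (hy : y.1.1 = k) {y' : ↥(bset D'.toDomains)} (hy' : y'.1.1 = k)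
    {g : PBond (PV d ℓ m K hd hL) 0 → ℝ}
    (hg : ∀ v, |g v| ≤ A * pref cf (blkV1 hN D' v) * Real.exp (-(δ * (geomT D').dist (blkV1 hN D' v) y')) * B)
    (x : PBond (PV d ℓ m K hd hL) 0) (hx : blkV1 hN D x = y) :
    |T ((VP hN D D' cf + VQ hN D D' hk w w') g) x|
      ≤ (((d : ℝ) + 1) * c * (CΔ + CP * Real.exp (2 * δ) * (1 + ((ℓ : ℝ) + 1) ^ 2)) + 2 * b₁ * Real.exp (5 / 2 * δ) * (1 + ((ℓ : ℝ) + 1) ^ 2)) * ((ℓ : ℝ) + 1) ^ 2 * c * (A' * A) * B * φ y * Real.exp (-(1 / 2 * δ * dOmega D D' y.1.2 y'.1.2)) := by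
  have hsymm := B8Ineq192MultiLevelTorus.symmT D
  have hU := abs_le_sum_of_hasMajorant (g := geomT D) (blkV1 hN D) hT ((VP hN D D' cf + VQ hN D D' hk w w') g)
    (fun p => (((d : ℝ) + 1) * c * (CΔ + CP * Real.exp (2 * δ) * (1 + ((ℓ : ℝ) + 1) ^ 2)) + 2 * b₁ * Real.exp (5 / 2 * δ) * (1 + ((ℓ : ℝ) + 1) ^ 2)) * A * B * (((ℓ : ℝ) + 1) ^ (2 * k) / ((ℓ : ℝ) + 1) ^ (2 * p.1.1))
      * (Real.exp (1 / 2 * δ * (geomT D).dist y p) * Real.exp (-(1 / 2 * δ * dOmega D D' y.1.2 y'.1.2))))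
    (fun p => by positivity) (fun f => abs_V_apply_le hN D D' hk hk1 hMh hP hRM hδ hcf hCΔ hCP hb₁ hA hB hc hthr h261 h261' hΔ hPD hPD' hw0 hw0' hwb hwb' hww hy hy' hg f) x
  refine hU.trans ?_
  rw [hx]
  have hφy := hφ y
  have hterm : ∀ p : ↥(bset D.toDomains),
      A' * φ y * Real.exp (-(δ * (geomT D).dist y p))
        * ((((d : ℝ) + 1) * c * (CΔ + CP * Real.exp (2 * δ) * (1 + ((ℓ : ℝ) + 1) ^ 2)) + 2 * b₁ * Real.exp (5 / 2 * δ) * (1 + ((ℓ : ℝ) + 1) ^ 2)) * A * B * (((ℓ : ℝ) + 1) ^ (2 * k) / ((ℓ : ℝ) + 1) ^ (2 * p.1.1))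
          * (Real.exp (1 / 2 * δ * (geomT D).dist y p) * Real.exp (-(1 / 2 * δ * dOmega D D' y.1.2 y'.1.2))))
      ≤ (((d : ℝ) + 1) * c * (CΔ + CP * Real.exp (2 * δ) * (1 + ((ℓ : ℝ) + 1) ^ 2)) + 2 * b₁ * Real.exp (5 / 2 * δ) * (1 + ((ℓ : ℝ) + 1) ^ 2)) * ((ℓ : ℝ) + 1) ^ 2 * (A' * A) * B * φ y * Real.exp (-(1 / 2 * δ * dOmega D D' y.1.2 y'.1.2))
        * Real.exp (-(1 / 4 * δ * (geomT D).dist y p)) := by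
    intro p
    have htr := transfer_top D hMh hP hRM hδ hthr p y hy
    rw [hsymm p y] at htr
    have hsplit : Real.exp (-(δ * (geomT D).dist y p)) * Real.exp (1 / 2 * δ * (geomT D).dist y p)
        = Real.exp (-(1 / 4 * δ * (geomT D).dist y p)) * Real.exp (-(1 / 4 * δ * (geomT D).dist y p)) := by
      rw [← Real.exp_add, ← Real.exp_add]
      congr 1; ring
    calc A' * φ y * Real.exp (-(δ * (geomT D).dist y p))
          * ((((d : ℝ) + 1) * c * (CΔ + CP * Real.exp (2 * δ) * (1 + ((ℓ : ℝ) + 1) ^ 2)) + 2 * b₁ * Real.exp (5 / 2 * δ) * (1 + ((ℓ : ℝ) + 1) ^ 2)) * A * B * (((ℓ : ℝ) + 1) ^ (2 * k) / ((ℓ : ℝ) + 1) ^ (2 * p.1.1))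
            * (Real.exp (1 / 2 * δ * (geomT D).dist y p) * Real.exp (-(1 / 2 * δ * dOmega D D' y.1.2 y'.1.2))))
        = (((d : ℝ) + 1) * c * (CΔ + CP * Real.exp (2 * δ) * (1 + ((ℓ : ℝ) + 1) ^ 2)) + 2 * b₁ * Real.exp (5 / 2 * δ) * (1 + ((ℓ : ℝ) + 1) ^ 2)) * (A' * A) * B * φ y * Real.exp (-(1 / 2 * δ * dOmega D D' y.1.2 y'.1.2))
          * ((((ℓ : ℝ) + 1) ^ (2 * k) / ((ℓ : ℝ) + 1) ^ (2 * p.1.1))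
            * (Real.exp (-(δ * (geomT D).dist y p)) * Real.exp (1 / 2 * δ * (geomT D).dist y p))) := by ring
      _ = (((d : ℝ) + 1) * c * (CΔ + CP * Real.exp (2 * δ) * (1 + ((ℓ : ℝ) + 1) ^ 2)) + 2 * b₁ * Real.exp (5 / 2 * δ) * (1 + ((ℓ : ℝ) + 1) ^ 2)) * (A' * A) * B * φ y * Real.exp (-(1 / 2 * δ * dOmega D D' y.1.2 y'.1.2))
          * ((((ℓ : ℝ) + 1) ^ (2 * k) / ((ℓ : ℝ) + 1) ^ (2 * p.1.1) * Real.exp (-(1 / 4 * δ * (geomT D).dist y p)))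
            * Real.exp (-(1 / 4 * δ * (geomT D).dist y p))) := by rw [hsplit]; ring
      _ ≤ (((d : ℝ) + 1) * c * (CΔ + CP * Real.exp (2 * δ) * (1 + ((ℓ : ℝ) + 1) ^ 2)) + 2 * b₁ * Real.exp (5 / 2 * δ) * (1 + ((ℓ : ℝ) + 1) ^ 2)) * (A' * A) * B * φ y * Real.exp (-(1 / 2 * δ * dOmega D D' y.1.2 y'.1.2))
          * (((ℓ : ℝ) + 1) ^ 2 * Real.exp (-(1 / 4 * δ * (geomT D).dist y p))) := by
          have h0 : 0 ≤ (((d : ℝ) + 1) * c * (CΔ + CP * Real.exp (2 * δ) * (1 + ((ℓ : ℝ) + 1) ^ 2)) + 2 * b₁ * Real.exp (5 / 2 * δ) * (1 + ((ℓ : ℝ) + 1) ^ 2)) * (A' * A) * B * φ y * Real.exp (-(1 / 2 * δ * dOmega D D' y.1.2 y'.1.2)) := by positivity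
          exact mul_le_mul_of_nonneg_left (mul_le_mul_of_nonneg_right htr (Real.exp_pos _).le) h0
      _ = _ := by ring
  refine (Finset.sum_le_sum fun p _ => hterm p).trans ?_
  rw [← Finset.mul_sum]
  have h0 : 0 ≤ (((d : ℝ) + 1) * c * (CΔ + CP * Real.exp (2 * δ) * (1 + ((ℓ : ℝ) + 1) ^ 2)) + 2 * b₁ * Real.exp (5 / 2 * δ) * (1 + ((ℓ : ℝ) + 1) ^ 2)) * ((ℓ : ℝ) + 1) ^ 2 * (A' * A) * B * φ y * Real.exp (-(1 / 2 * δ * dOmega D D' y.1.2 y'.1.2)) := by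
    positivity
  calc (((d : ℝ) + 1) * c * (CΔ + CP * Real.exp (2 * δ) * (1 + ((ℓ : ℝ) + 1) ^ 2)) + 2 * b₁ * Real.exp (5 / 2 * δ) * (1 + ((ℓ : ℝ) + 1) ^ 2)) * ((ℓ : ℝ) + 1) ^ 2 * (A' * A) * B * φ y * Real.exp (-(1 / 2 * δ * dOmega D D' y.1.2 y'.1.2))
        * ∑ p : ↥(bset D.toDomains), Real.exp (-(1 / 4 * δ * (geomT D).dist y p))
      ≤ (((d : ℝ) + 1) * c * (CΔ + CP * Real.exp (2 * δ) * (1 + ((ℓ : ℝ) + 1) ^ 2)) + 2 * b₁ * Real.exp (5 / 2 * δ) * (1 + ((ℓ : ℝ) + 1) ^ 2)) * ((ℓ : ℝ) + 1) ^ 2 * (A' * A) * B * φ y * Real.exp (-(1 / 2 * δ * dOmega D D' y.1.2 y'.1.2)) * c :=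
        mul_le_mul_of_nonneg_left (h261 y) h0
    _ = _ := by ring

/-- **THE PLAIN-DECAY HALF WITH GENERAL PREFACTORS**: `|(Tμ)(x) − (T′μ)(x)| ≤ 2A′·φ(y)·B·e^{−δ·min(d(y,y′), d′(y,y′))}` when `T`, `T′` carry majorants
`A′φe^{−δd}`, `A′φ′e^{−δd′}` and `φ′ = φ` on the common top block `y ∋ x`. [cite: Balaban1985BackgroundPropagators, Thm 3.14 (3.153) p.427; Balaban1984PropagatorsII, (2.136) p.247] -/
theorem trivial_bound_gen {δ A' : ℝ} (hδ : 0 ≤ δ) (hA' : 0 ≤ A')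
    {T T' : Module.End ℝ (PBond (PV d ℓ m K hd hL) 0 → ℝ)} {φ : ↥(bset D.toDomains) → ℝ} {φ' : ↥(bset D'.toDomains) → ℝ}
    (hφ0 : ∀ a, 0 ≤ φ a)
    (hT : HasMajorant (g := geomT D) (blkV1 hN D) T (fun a b => A' * φ a * Real.exp (-(δ * (geomT D).dist a b))))
    (hT' : HasMajorant (g := geomT D') (blkV1 hN D') T' (fun a b => A' * φ' a * Real.exp (-(δ * (geomT D').dist a b))))
    {y : ↥(bset D.toDomains)} (hyD' : y.1 ∈ bset D'.toDomains) {y' : ↥(bset D'.toDomains)} (hy'D : y'.1 ∈ bset D.toDomains)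
    (hφ : φ' ⟨y.1, hyD'⟩ = φ y)
    {μ : PBond (PV d ℓ m K hd hL) 0 → ℝ} {B : ℝ} (hμ : BlockSupp (g := geomT D') (blkV1 hN D') μ y' B)
    (x : PBond (PV d ℓ m K hd hL) 0) (hx : blkV1 hN D x = y) :
    |T μ x - T' μ x| ≤ 2 * A' * (φ y * B)
      * Real.exp (-(δ * min ((geomT D).dist y ⟨y'.1, hy'D⟩) ((geomT D').dist ⟨y.1, hyD'⟩ y'))) := by
  have hBn : 0 ≤ B := hμ.nonneg
  have hμD : BlockSupp (g := geomT D) (blkV1 hN D) μ ⟨y'.1, hy'D⟩ B := blockSupp_transfer_V1 hN D D' hy'D y'.2 hμ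
  have hx' : blkV1 hN D' x = ⟨y.1, hyD'⟩ := (blkOf_eq_iff_blkOf_eq D D' y.2 hyD' (toBox hN x.src)).1 hx
  have h1 : |T μ x| ≤ A' * φ y * Real.exp (-(δ * (geomT D).dist y ⟨y'.1, hy'D⟩)) * B := by
    have h := hT ⟨y'.1, hy'D⟩ μ B hμD x
    rw [hx] at h
    exact h
  have h2 : |T' μ x| ≤ A' * φ y * Real.exp (-(δ * (geomT D').dist ⟨y.1, hyD'⟩ y')) * B := by
    have h := hT' y' μ B hμ x
    rw [hx'] at h
    have h' : |T' μ x| ≤ A' * φ' ⟨y.1, hyD'⟩ * Real.exp (-(δ * (geomT D').dist ⟨y.1, hyD'⟩ y')) * B := h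
    rw [hφ] at h'
    exact h'
  have hp0 := hφ0 y
  have hmin1 := min_le_left ((geomT D).dist y ⟨y'.1, hy'D⟩) ((geomT D').dist ⟨y.1, hyD'⟩ y')
  have hmin2 := min_le_right ((geomT D).dist y ⟨y'.1, hy'D⟩) ((geomT D').dist ⟨y.1, hyD'⟩ y')
  have he1 : Real.exp (-(δ * (geomT D).dist y ⟨y'.1, hy'D⟩))
      ≤ Real.exp (-(δ * min ((geomT D).dist y ⟨y'.1, hy'D⟩) ((geomT D').dist ⟨y.1, hyD'⟩ y'))) :=
    Real.exp_le_exp.2 (by have := mul_le_mul_of_nonneg_left hmin1 hδ; linarith)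
  have he2 : Real.exp (-(δ * (geomT D').dist ⟨y.1, hyD'⟩ y'))
      ≤ Real.exp (-(δ * min ((geomT D).dist y ⟨y'.1, hy'D⟩) ((geomT D').dist ⟨y.1, hyD'⟩ y'))) :=
    Real.exp_le_exp.2 (by have := mul_le_mul_of_nonneg_left hmin2 hδ; linarith)
  have hmax : Real.exp (-(δ * (geomT D).dist y ⟨y'.1, hy'D⟩)) + Real.exp (-(δ * (geomT D').dist ⟨y.1, hyD'⟩ y'))
      ≤ 2 * Real.exp (-(δ * min ((geomT D).dist y ⟨y'.1, hy'D⟩) ((geomT D').dist ⟨y.1, hyD'⟩ y'))) := by linarith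
  calc |T μ x - T' μ x| ≤ |T μ x| + |T' μ x| := abs_sub _ _
    _ ≤ A' * φ y * Real.exp (-(δ * (geomT D).dist y ⟨y'.1, hy'D⟩)) * B
        + A' * φ y * Real.exp (-(δ * (geomT D').dist ⟨y.1, hyD'⟩ y')) * B := add_le_add h1 h2
    _ = A' * (φ y * B) * (Real.exp (-(δ * (geomT D).dist y ⟨y'.1, hy'D⟩)) + Real.exp (-(δ * (geomT D').dist ⟨y.1, hyD'⟩ y'))) := by
        ring
    _ ≤ A' * (φ y * B) * (2 * Real.exp (-(δ * min ((geomT D).dist y ⟨y'.1, hy'D⟩) ((geomT D').dist ⟨y.1, hyD'⟩ y')))) :=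
        mul_le_mul_of_nonneg_left hmax (by positivity)
    _ = _ := by ring

/-- **THE ABSTRACT THEOREM WITH A GENERAL OUTER PREFACTOR**: for operators `T, T′` carrying majorants `A′φe^{−δd}`, `A′φ′e^{−δd′}` (`φ′ = φ` on the
common top block `y`), an inner operator `G′` carrying the (2.136)₁ majorant `A·pref·e^{−δd′}`, and the identity `T − T′ = T(V_P + V_Q)G′`:
`|(Tμ)(x) − (T′μ)(x)| ≤ √(2A′)·√(ΘL²cA′A)·φ(y)·B·e^{−½δ·min(d,d′)(y,y′)}·e^{−¼δ·d(y,y′,Ω)}`.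
[cite: Balaban1985BackgroundPropagators, Thm 3.14 (3.153)–(3.154) pp.426–427; Balaban1984PropagatorsII, (2.22) p.226, Prop. 2.6 (2.136) p.247] -/
theorem resolvent_diff_bound_gen (hk1 : 1 ≤ k) (hMh : 1 ≤ Mh) (hP : ∀ μ, 1 ≤ P' μ) (hRM : 1 ≤ R * ((ℓ + 1) * Mh))
    {δ c CΔ CP b₁ A B cf : ℝ} (hδ : 0 ≤ δ) (hcf : cf ≠ 0) (hCΔ : 0 ≤ CΔ) (hCP : 0 ≤ CP) (hb₁ : 0 ≤ b₁) (hA : 0 ≤ A) (hB : 0 ≤ B)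
    (hc : 0 ≤ c) (hthr : ((ℓ : ℝ) + 1) ^ 2 ≤ Real.exp (1 / 4 * δ * ((R : ℝ) * (((ℓ : ℝ) + 1) * Mh) - 1)))
    (h261 : Ineq261With c (geomT D) δ (1 / 4)) (h261' : Ineq261With c (geomT D') δ (1 / 4))
    (hΔ : ∀ (p q : ℕ × (Fin (d + 1) → ℤ)) (hpD : p ∈ bset D.toDomains) (hpD' : p ∈ bset D'.toDomains)
      (hqD : q ∈ bset D.toDomains) (hqD' : q ∈ bset D'.toDomains), p.1 = k → q.1 = k →
      ∀ (x x' : ↥(boxDom (N0 ℓ Mh k P'))), blkOf D.toDomains x = ⟨p, hpD⟩ → blkOf D.toDomains x' = ⟨q, hqD⟩ →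
      ∀ μ ν : Fin (d + 1), |dPd D μ ν x x' - dPd D' μ ν x x'|
        ≤ CΔ * ((((ℓ : ℝ) + 1) ^ k) ^ 2)⁻¹ * ((((ℓ : ℝ) + 1) ^ k) ^ (d + 1))⁻¹
          * Real.exp (-(δ * min ((geomT D).dist ⟨p, hpD⟩ ⟨q, hqD⟩) ((geomT D').dist ⟨p, hpD'⟩ ⟨q, hqD'⟩)))
          * Real.exp (-(δ * dOmega D D' p.2 q.2)))
    (hPD : ∀ (μ ν : Fin (d + 1)) (x x' : ↥(boxDom (N0 ℓ Mh k P'))),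
      |dPd D μ ν x x'| ≤ CP * ((((ℓ : ℝ) + 1) ^ D.lev x.1) ^ 2)⁻¹ * (W D.toDomains (blkOf D.toDomains x'))⁻¹ *
        Real.exp (-(δ * (geomT D).dist (blkOf D.toDomains x) (blkOf D.toDomains x'))))
    (hPD' : ∀ (μ ν : Fin (d + 1)) (x x' : ↥(boxDom (N0 ℓ Mh k P'))),
      |dPd D' μ ν x x'| ≤ CP * ((((ℓ : ℝ) + 1) ^ D'.lev x.1) ^ 2)⁻¹ * (W D'.toDomains (blkOf D'.toDomains x'))⁻¹ *
        Real.exp (-(δ * (geomT D').dist (blkOf D'.toDomains x) (blkOf D'.toDomains x'))))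
    {w : BondIdx (domT hN D hk) → ℝ} {w' : BondIdx (domT hN D' hk) → ℝ} (hw0 : ∀ i, 0 ≤ w i) (hw0' : ∀ i', 0 ≤ w' i')
    (hwb : ∀ i, w i ≤ b₁ * cf ^ 2 * ((((ℓ : ℝ) + 1) ^ (i.1.1 : ℕ)) ^ (d + 1)) * (((((ℓ : ℝ) + 1) ^ (i.1.1 : ℕ)) ^ 2))⁻¹)
    (hwb' : ∀ i', w' i' ≤ b₁ * cf ^ 2 * ((((ℓ : ℝ) + 1) ^ (i'.1.1 : ℕ)) ^ (d + 1)) * (((((ℓ : ℝ) + 1) ^ (i'.1.1 : ℕ)) ^ 2))⁻¹)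
    (hww : ∀ (i : BondIdx (domT hN D hk)) (i' : BondIdx (domT hN D' hk)), i.1 = i'.1 → w i = w' i')
    {T T' GD' : Module.End ℝ (PBond (PV d ℓ m K hd hL) 0 → ℝ)} {A' : ℝ} (hA' : 0 ≤ A')
    {φ : ↥(bset D.toDomains) → ℝ} {φ' : ↥(bset D'.toDomains) → ℝ} (hφ0 : ∀ a, 0 ≤ φ a)
    (hT : HasMajorant (g := geomT D) (blkV1 hN D) T (fun a b => A' * φ a * Real.exp (-(δ * (geomT D).dist a b))))
    (hT' : HasMajorant (g := geomT D') (blkV1 hN D') T' (fun a b => A' * φ' a * Real.exp (-(δ * (geomT D').dist a b))))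
    (hG' : HasMajorant (g := geomT D') (blkV1 hN D') GD' (fun a b => A * pref cf a * Real.exp (-(δ * (geomT D').dist a b))))
    (hres : T - T' = T ∘ₗ (VP hN D D' cf + VQ hN D D' hk w w') ∘ₗ GD')
    {y : ↥(bset D.toDomains)} (hy : y.1.1 = k) (hyD' : y.1 ∈ bset D'.toDomains)
    {y' : ↥(bset D'.toDomains)} (hy' : y'.1.1 = k) (hy'D : y'.1 ∈ bset D.toDomains) (hφ : φ' ⟨y.1, hyD'⟩ = φ y)
    {μ : PBond (PV d ℓ m K hd hL) 0 → ℝ} (hμ : BlockSupp (g := geomT D') (blkV1 hN D') μ y' B)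
    (x : PBond (PV d ℓ m K hd hL) 0) (hx : blkV1 hN D x = y) :
    |T μ x - T' μ x| ≤ Real.sqrt (2 * A') * Real.sqrt ((((d : ℝ) + 1) * c * (CΔ + CP * Real.exp (2 * δ) * (1 + ((ℓ : ℝ) + 1) ^ 2)) + 2 * b₁ * Real.exp (5 / 2 * δ) * (1 + ((ℓ : ℝ) + 1) ^ 2)) * ((ℓ : ℝ) + 1) ^ 2 * c * (A' * A)) * (φ y * B)
      * Real.exp (-(1 / 2 * δ * min ((geomT D).dist y ⟨y'.1, hy'D⟩) ((geomT D').dist ⟨y.1, hyD'⟩ y')))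
      * Real.exp (-(1 / 4 * δ * dOmega D D' y.1.2 y'.1.2)) := by
  have hg : ∀ v, |GD' μ v| ≤ A * pref cf (blkV1 hN D' v) * Real.exp (-(δ * (geomT D').dist (blkV1 hN D' v) y')) * B :=
    fun v => hG' y' μ B hμ v
  have hEq : T μ x - T' μ x = T ((VP hN D D' cf + VQ hN D D' hk w w') (GD' μ)) x := by
    have h := congrFun (LinearMap.congr_fun hres μ) x
    rw [LinearMap.sub_apply, Pi.sub_apply, LinearMap.comp_apply, LinearMap.comp_apply] at h
    exact h
  have h1 := trivial_bound_gen hN D D' hδ hA' hφ0 hT hT' hyD' hy'D hφ hμ x hx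
  have h2 := engine_gen hN D D' hk hk1 hMh hP hRM hδ hcf hCΔ hCP hb₁ hA hB hc hthr h261 h261' hΔ hPD hPD' hw0 hw0' hwb hwb' hww hA' hφ0 hT hy hy' hg x hx
  rw [← hEq] at h2
  have h2' : |T μ x - T' μ x| ≤ ((((d : ℝ) + 1) * c * (CΔ + CP * Real.exp (2 * δ) * (1 + ((ℓ : ℝ) + 1) ^ 2)) + 2 * b₁ * Real.exp (5 / 2 * δ) * (1 + ((ℓ : ℝ) + 1) ^ 2)) * ((ℓ : ℝ) + 1) ^ 2 * c * (A' * A)) * (φ y * B)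
      * Real.exp (-(1 / 2 * δ * dOmega D D' y.1.2 y'.1.2)) := le_of_le_of_eq h2 (by ring)
  have hp0 := hφ0 y
  exact B9Thm314GpFlatMultiLevelTorus.combined_bound (by positivity) (by positivity) (by positivity) h1 h2'

end General

/-! ## §8  THEOREM 3.14 AT `U = 1`: the (2.136)₁ member for `G = Δ_a⁻¹` (assembly) -/

/-- **THEOREM 3.14 AT `U = 1` — THE (2.136)₁ MEMBER WITH THE FACTOR (3.154) FOR THE GENUINE `k`-LEVEL `G = Δ_a⁻¹` OF TWO NESTED FAMILIES ON THE V1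
TORUS**: `|(G[Ω]μ)(x) − (G[Ω′]μ)(x)| ≤ C·(L^k/c_f)²·B·e^{−δ·min(d(y,y′), d′(y,y′))}·e^{−δ·d(y,y′,Ω)}` for `x ∈ B(y)`, `supp μ ⊂ B(y′)`, `|μ| ≤ B`,
`y, y′ ∈ Ω^{(k)}` common top blocks, `Ω = Ω_k ∩ Ω′_k`.
[cite: Balaban1985BackgroundPropagators, Thm 3.14 (3.153)–(3.154) pp.426–427; Balaban1984PropagatorsII, Prop. 2.6 (2.136) p.247, (2.19)–(2.22) p.226] -/
theorem thm314_G_flat_V1 (d ℓ : ℕ) (hd : 1 ≤ d + 1) (hL : Odd (ℓ + 1) ∧ 1 < ℓ + 1) {b₀ b₁ : ℝ} (hb₀ : 0 < b₀) (hb₁ : b₀ ≤ b₁) :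
    ∃ δ C M₀ : ℝ, ∃ N₀ : ℕ, 0 < δ ∧ 0 < C ∧ 0 < M₀ ∧ 0 < N₀ ∧
      ∀ (m K : ℕ) {Mh k R : ℕ} {P' : Fin (d + 1) → ℕ}
        (hN : ∀ μ, N0 ℓ Mh k P' μ = (PV d ℓ m K hd hL).sitesPerDir 0) (D D' : TDomains d ℓ Mh k P' R) (hk : k ≤ m + K),
        1 ≤ k → ∀ {a : ℕ}, Mh = (ℓ + 1) ^ a → 8 ≤ Mh → 2 * (ℓ + 1) ^ 2 ≤ R → (∀ μ, 5 * (ℓ + 1) ≤ P' μ) → 4 ≤ ℓ →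
        M₀ ≤ ((ℓ : ℝ) + 1) * Mh → N₀ + 1 ≤ R * ((ℓ + 1) * Mh) →
        ∀ {cf : ℝ} (hcf : cf ≠ 0) {w : BondIdx (domT hN D hk) → ℝ} (hw : ∀ i, 0 < w i)
          {w' : BondIdx (domT hN D' hk) → ℝ} (hw' : ∀ i', 0 < w' i'),
        GlobalBand b₀ b₁ cf w → GlobalBand b₀ b₁ cf w' →
        (∀ (i : BondIdx (domT hN D hk)) (i' : BondIdx (domT hN D' hk)), i.1 = i'.1 → w i = w' i') →
        ∀ (y : ↥(bset D.toDomains)) (hyD' : y.1 ∈ bset D'.toDomains) (y' : ↥(bset D'.toDomains)) (hy'D : y'.1 ∈ bset D.toDomains),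
        y.1.1 = k → y'.1.1 = k →
        ∀ (μ : PBond (PV d ℓ m K hd hL) 0 → ℝ) (B : ℝ), BlockSupp (g := geomT D') (blkV1 hN D') μ y' B →
        ∀ x : PBond (PV d ℓ m K hd hL) 0, blkV1 hN D x = y →
          |onFun (GE (domT hN D hk) hcf hw) μ x - onFun (GE (domT hN D' hk) hcf hw') μ x|
            ≤ C * (pref cf y * B)
              * Real.exp (-(δ * min ((geomT D).dist y ⟨y'.1, hy'D⟩) ((geomT D').dist ⟨y.1, hyD'⟩ y')))
              * Real.exp (-(δ * dOmega D D' y.1.2 y'.1.2)) := by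
  have hℓ : 1 ≤ ℓ := by have := hL.2; omega
  have hL1 : (1 : ℝ) ≤ (ℓ : ℝ) + 1 := by linarith [(Nat.cast_nonneg ℓ : (0 : ℝ) ≤ ℓ)]
  -- (2.136)₁ for `G = Δ_a⁻¹` (p38), at `α = ½`, `σ = σ₁`
  obtain ⟨σ₁, hσ₁, hT1⟩ := prop26_2136_grad_kLevel_unconditional_pad_V1 d ℓ hd hL hb₀ hb₁
  obtain ⟨A, M₂, hA, hM₂, hG1⟩ := hT1 σ₁ hσ₁ le_rfl (1 / 2) (by norm_num) (by norm_num)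
  have hδG0 : 0 < delta3 (1 / 2) (2 * σ₁) := delta3_pos (by norm_num) (by linarith)
  -- the two-family (3.49)₄ difference (gen 19) and the one-family (3.49)₄ (FILE 1) at the printed weights
  have hL2 : (1 : ℝ) < (((ℓ : ℝ) + 1)) ^ 2 := by
    have : (2 : ℝ) ≤ (ℓ : ℝ) + 1 := by
      have : (1 : ℝ) ≤ ℓ := by exact_mod_cast hℓ
      linarith
    nlinarith
  have hamin : 0 < 1 - ((((ℓ : ℝ) + 1)) ^ 2)⁻¹ := by rw [sub_pos]; exact inv_lt_one_of_one_lt₀ hL2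
  obtain ⟨hwin, hrec⟩ := B6Prop22KLevelCensus.KIdx.aPrinted_windows hℓ
  obtain ⟨δ₅, C₅, M₅, N₅, hδ₅, hC₅, hM₅, hN₅, h5⟩ :=
    thm314_P_flat_multiLevelTorus d ℓ hℓ (1 - ((((ℓ : ℝ) + 1)) ^ 2)⁻¹) 1 1 1 hamin one_pos
  obtain ⟨ρ, BP, MP, NP, hρ, hBP, hMP, hNP, hPk⟩ := dPd_le d ℓ hℓ
  -- the common rate and the thresholds of (2.60)/(2.61)
  obtain ⟨δ, hδ0, hδG, hδ5, hδρ⟩ : ∃ δ : ℝ, 0 < δ ∧ δ ≤ delta3 (1 / 2) (2 * σ₁) ∧ δ ≤ δ₅ ∧ δ ≤ ρ :=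
    ⟨min (delta3 (1 / 2) (2 * σ₁)) (min δ₅ ρ), lt_min hδG0 (lt_min hδ₅ hρ), min_le_left _ _,
      (min_le_right _ _).trans (min_le_left _ _), (min_le_right _ _).trans (min_le_right _ _)⟩
  obtain ⟨Nc, c, hNc, hc, hcon⟩ := consts_260_261 d ℓ hδ0
  have hb₁0 : 0 ≤ b₁ := hb₀.le.trans hb₁
  refine ⟨δ / 4, (Real.sqrt (2 * A) * Real.sqrt ((((d : ℝ) + 1) * c * (C₅ + BP * Real.exp (2 * δ) * (1 + ((ℓ : ℝ) + 1) ^ 2)) + 2 * b₁ * Real.exp (5 / 2 * δ) * (1 + ((ℓ : ℝ) + 1) ^ 2)) * ((ℓ : ℝ) + 1) ^ 2 * c * A ^ 2) + 1), max M₂ (max M₅ MP), max Nc (max N₅ NP), by positivity, by positivity, lt_max_of_lt_left hM₂,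
    lt_max_of_lt_left hNc, ?_⟩
  intro m K Mh k R P' hN D D' hk hk1 a hMha hM8 hR2 hP5 hℓ4 hM hRN cf hcf w hw w' hw' hwb hwb' hww y hyD' y' hy'D hy hy' μ B hμ x hx
  -- sizes
  have hMh1 : 1 ≤ Mh := by omega
  have hMh3 : 3 ≤ Mh := by omega
  have hP1 : ∀ μ, 1 ≤ P' μ := fun μ => le_trans (by omega) (hP5 μ)
  have hP4 : ∀ μ, 4 ≤ P' μ := fun μ => le_trans (by omega) (hP5 μ)
  have hR2' : 2 * (ℓ + 1) ≤ R := le_trans (Nat.mul_le_mul_left 2 (by rw [pow_two]; exact Nat.le_mul_self _)) hR2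
  have hRM1 : 1 ≤ R * ((ℓ + 1) * Mh) := le_trans (Nat.le_add_left 1 _) hRN
  have hM2' : M₂ ≤ ((ℓ : ℝ) + 1) * Mh := (le_max_left _ _).trans hM
  have hM5' : M₅ ≤ ((ℓ : ℝ) + 1) * Mh := ((le_max_left _ _).trans (le_max_right _ _)).trans hM
  have hMP' : MP ≤ ((ℓ : ℝ) + 1) * Mh := ((le_max_right _ _).trans (le_max_right _ _)).trans hM
  have hNc' : Nc + 1 ≤ R * ((ℓ + 1) * Mh) := le_trans (Nat.succ_le_succ (le_max_left _ _)) hRN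
  have hN5' : N₅ + 1 ≤ R * ((ℓ + 1) * Mh) := le_trans (Nat.succ_le_succ ((le_max_left _ _).trans (le_max_right _ _))) hRN
  have hNP' : NP + 1 ≤ R * ((ℓ + 1) * Mh) := le_trans (Nat.succ_le_succ ((le_max_right _ _).trans (le_max_right _ _))) hRN
  obtain ⟨hthr, h261⟩ := hcon k Mh R P' hMh1 hP1 hNc'
  have hd0 : ∀ s t : ↥(bset D.toDomains), 0 ≤ (geomT D).dist s t := (triangle_refl_nonneg_T D hMh1 hP1).2.2
  have hd0' : ∀ s t : ↥(bset D'.toDomains), 0 ≤ (geomT D').dist s t := (triangle_refl_nonneg_T D' hMh1 hP1).2.2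
  -- the (2.136)₁ majorants of the two operators at the common rate
  have hGD := (hG1 m K hN D hk hk1 hMha hM8 hR2 hP5 hℓ4 hM2' hcf hw hwb).1
  have hGD' := (hG1 m K hN D' hk hk1 hMha hM8 hR2 hP5 hℓ4 hM2' hcf hw' hwb').1
  have hG : HasMajorant (g := geomT D) (blkV1 hN D) (onFun (GE (domT hN D hk) hcf hw))
      (fun a b => A * pref cf a * Real.exp (-(δ * (geomT D).dist a b))) :=
    hasMajorant_mono (g := geomT D) (blkV1 hN D) hGD fun a b =>
      mul_le_mul_of_nonneg_left (Real.exp_le_exp.2 (neg_le_neg (mul_le_mul_of_nonneg_right hδG (hd0 a b))))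
        (mul_nonneg hA (pref_nonneg _ _))
  have hG' : HasMajorant (g := geomT D') (blkV1 hN D') (onFun (GE (domT hN D' hk) hcf hw'))
      (fun a b => A * pref cf a * Real.exp (-(δ * (geomT D').dist a b))) :=
    hasMajorant_mono (g := geomT D') (blkV1 hN D') hGD' fun a b =>
      mul_le_mul_of_nonneg_left (Real.exp_le_exp.2 (neg_le_neg (mul_le_mul_of_nonneg_right hδG (hd0' a b))))
        (mul_nonneg hA (pref_nonneg _ _))
  -- the two-family (3.49)₄ difference at the common rate
  have hΔ : ∀ (p q : ℕ × (Fin (d + 1) → ℤ)) (hpD : p ∈ bset D.toDomains) (hpD' : p ∈ bset D'.toDomains)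
      (hqD : q ∈ bset D.toDomains) (hqD' : q ∈ bset D'.toDomains), p.1 = k → q.1 = k →
      ∀ (x x' : ↥(boxDom (N0 ℓ Mh k P'))), blkOf D.toDomains x = ⟨p, hpD⟩ → blkOf D.toDomains x' = ⟨q, hqD⟩ →
      ∀ μ ν : Fin (d + 1), |dPd D μ ν x x' - dPd D' μ ν x x'|
        ≤ C₅ * ((((ℓ : ℝ) + 1) ^ k) ^ 2)⁻¹ * ((((ℓ : ℝ) + 1) ^ k) ^ (d + 1))⁻¹
          * Real.exp (-(δ * min ((geomT D).dist ⟨p, hpD⟩ ⟨q, hqD⟩) ((geomT D').dist ⟨p, hpD'⟩ ⟨q, hqD'⟩)))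
          * Real.exp (-(δ * dOmega D D' p.2 q.2)) := by
    intro p q hpD hpD' hqD hqD' hp hq x₁ x₂ hx₁ hx₂ μ₁ ν₁
    obtain ⟨-, -, -, h4⟩ := h5 k Mh R hMh3 hM5' hR2' hN5' P' hP1 hP4 D D' (aPrinted ℓ 1) (fun _ => 1) hwin
      (fun i _ => ⟨le_rfl, le_rfl⟩) hrec p q hpD hpD' hqD hqD' hp hq x₁ x₂ hx₁ hx₂
    have h := h4 μ₁ ν₁
    rw [member4_eq_dPd, member4_eq_dPd] at h
    refine h.trans ?_
    have h0 : 0 ≤ C₅ * ((((ℓ : ℝ) + 1) ^ k) ^ 2)⁻¹ * ((((ℓ : ℝ) + 1) ^ k) ^ (d + 1))⁻¹ := by positivity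
    have hm0 : 0 ≤ min ((geomT D).dist ⟨p, hpD⟩ ⟨q, hqD⟩) ((geomT D').dist ⟨p, hpD'⟩ ⟨q, hqD'⟩) := le_min (hd0 _ _) (hd0' _ _)
    have hΩ0 : 0 ≤ dOmega D D' p.2 q.2 := dOmega_nonneg D D' _ _
    have e1 : Real.exp (-(δ₅ * min ((geomT D).dist ⟨p, hpD⟩ ⟨q, hqD⟩) ((geomT D').dist ⟨p, hpD'⟩ ⟨q, hqD'⟩)))
        ≤ Real.exp (-(δ * min ((geomT D).dist ⟨p, hpD⟩ ⟨q, hqD⟩) ((geomT D').dist ⟨p, hpD'⟩ ⟨q, hqD'⟩))) :=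
      Real.exp_le_exp.2 (neg_le_neg (mul_le_mul_of_nonneg_right hδ5 hm0))
    have e2 : Real.exp (-(δ₅ * dOmega D D' p.2 q.2)) ≤ Real.exp (-(δ * dOmega D D' p.2 q.2)) :=
      Real.exp_le_exp.2 (neg_le_neg (mul_le_mul_of_nonneg_right hδ5 hΩ0))
    exact mul_le_mul (mul_le_mul_of_nonneg_left e1 h0) e2 (Real.exp_pos _).le (mul_nonneg h0 (Real.exp_pos _).le)
  -- the one-family (3.49)₄ bounds at the common rate
  have hPD : ∀ (μ ν : Fin (d + 1)) (x x' : ↥(boxDom (N0 ℓ Mh k P'))),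
      |dPd D μ ν x x'| ≤ BP * ((((ℓ : ℝ) + 1) ^ D.lev x.1) ^ 2)⁻¹ * (W D.toDomains (blkOf D.toDomains x'))⁻¹ *
        Real.exp (-(δ * (geomT D).dist (blkOf D.toDomains x) (blkOf D.toDomains x'))) := by
    intro μ₁ ν₁ x₁ x₂
    refine (hPk k Mh R hMh3 hMP' hR2' hNP' P' hP4 D μ₁ ν₁ x₁ x₂).trans ?_
    have hW0 : 0 < W D.toDomains (blkOf D.toDomains x₂) := W_pos _ _
    exact mul_le_mul_of_nonneg_left (Real.exp_le_exp.2 (neg_le_neg (mul_le_mul_of_nonneg_right hδρ (hd0 _ _)))) (by positivity)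
  have hPD' : ∀ (μ ν : Fin (d + 1)) (x x' : ↥(boxDom (N0 ℓ Mh k P'))),
      |dPd D' μ ν x x'| ≤ BP * ((((ℓ : ℝ) + 1) ^ D'.lev x.1) ^ 2)⁻¹ * (W D'.toDomains (blkOf D'.toDomains x'))⁻¹ *
        Real.exp (-(δ * (geomT D').dist (blkOf D'.toDomains x) (blkOf D'.toDomains x'))) := by
    intro μ₁ ν₁ x₁ x₂
    refine (hPk k Mh R hMh3 hMP' hR2' hNP' P' hP4 D' μ₁ ν₁ x₁ x₂).trans ?_
    have hW0 : 0 < W D'.toDomains (blkOf D'.toDomains x₂) := W_pos _ _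
    exact mul_le_mul_of_nonneg_left (Real.exp_le_exp.2 (neg_le_neg (mul_le_mul_of_nonneg_right hδρ (hd0' _ _)))) (by positivity)
  -- the weights
  have hw0 : ∀ i, 0 ≤ w i := fun i => (hw i).le
  have hw0' : ∀ i', 0 ≤ w' i' := fun i' => (hw' i').le
  have hwB := fun i => w_le_of_band hN D hk hcf hwb i
  have hwB' := fun i' => w_le_of_band hN D' hk hcf hwb' i'
  -- FILE 2's abstract theorem
  have hmain := resolvent_diff_bound hN D D' hk hk1 hMh1 hP1 hRM1 hδ0.le hcf hC₅.le hBP.le hb₁0 hA hμ.nonneg hc hthr (h261 D) (h261 D')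
    hΔ hPD hPD' hw0 hw0' hwB hwB' hww hG hG' (onFun_GE_sub hN D D' hk hℓ hMh1 hP1 hcf hw hw') hy hyD' hy' hy'D hμ x hx
  refine hmain.trans ?_
  -- the rates `½δ`, `¼δ` weakened to `δ/4`, the constant enlarged by `1`
  have hF : 0 ≤ pref cf y * B := mul_nonneg (pref_nonneg _ _) hμ.nonneg
  have hm0 : 0 ≤ min ((geomT D).dist y ⟨y'.1, hy'D⟩) ((geomT D').dist ⟨y.1, hyD'⟩ y') := le_min (hd0 _ _) (hd0' _ _)
  have e1 : Real.exp (-(1 / 2 * δ * min ((geomT D).dist y ⟨y'.1, hy'D⟩) ((geomT D').dist ⟨y.1, hyD'⟩ y')))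
      ≤ Real.exp (-(δ / 4 * min ((geomT D).dist y ⟨y'.1, hy'D⟩) ((geomT D').dist ⟨y.1, hyD'⟩ y'))) :=
    Real.exp_le_exp.2 (by nlinarith [mul_nonneg hδ0.le hm0])
  have e2 : Real.exp (-(1 / 4 * δ * dOmega D D' y.1.2 y'.1.2)) = Real.exp (-(δ / 4 * dOmega D D' y.1.2 y'.1.2)) := by
    congr 1; ring
  have hK0 : 0 ≤ Real.sqrt (2 * A) * Real.sqrt ((((d : ℝ) + 1) * c * (C₅ + BP * Real.exp (2 * δ) * (1 + ((ℓ : ℝ) + 1) ^ 2)) + 2 * b₁ * Real.exp (5 / 2 * δ) * (1 + ((ℓ : ℝ) + 1) ^ 2)) * ((ℓ : ℝ) + 1) ^ 2 * c * A ^ 2) :=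
    mul_nonneg (Real.sqrt_nonneg _) (Real.sqrt_nonneg _)
  have hK1 : Real.sqrt (2 * A) * Real.sqrt ((((d : ℝ) + 1) * c * (C₅ + BP * Real.exp (2 * δ) * (1 + ((ℓ : ℝ) + 1) ^ 2)) + 2 * b₁ * Real.exp (5 / 2 * δ) * (1 + ((ℓ : ℝ) + 1) ^ 2)) * ((ℓ : ℝ) + 1) ^ 2 * c * A ^ 2) ≤ (Real.sqrt (2 * A) * Real.sqrt ((((d : ℝ) + 1) * c * (C₅ + BP * Real.exp (2 * δ) * (1 + ((ℓ : ℝ) + 1) ^ 2)) + 2 * b₁ * Real.exp (5 / 2 * δ) * (1 + ((ℓ : ℝ) + 1) ^ 2)) * ((ℓ : ℝ) + 1) ^ 2 * c * A ^ 2) + 1) := le_add_of_nonneg_right zero_le_one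
  rw [e2]
  exact mul_le_mul (mul_le_mul (mul_le_mul_of_nonneg_right hK1 hF) e1 (Real.exp_pos _).le
    (mul_nonneg (hK0.trans hK1) hF)) le_rfl (Real.exp_pos _).le
    (mul_nonneg (mul_nonneg (hK0.trans hK1) hF) (Real.exp_pos _).le)


/-! ## §9  THEOREM 3.14 AT `U = 1`: the (2.136)₂ member (`∇G`) for `G = Δ_a⁻¹` (assembly) -/

/-- **THEOREM 3.14 AT `U = 1` — THE (2.136)₂ MEMBER (`∇G`) WITH THE FACTOR (3.154) FOR THE GENUINE `k`-LEVEL `G = Δ_a⁻¹` OF TWO NESTED FAMILIES ON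
THE V1 TORUS**: `|(∇_ν(G[Ω] − G[Ω′])μ)(x)| ≤ C·(L^k·|c_f|⁻¹)·B·e^{−δ·min(d(y,y′), d′(y,y′))}·e^{−δ·d(y,y′,Ω)}` for `x ∈ B(y)`, `supp μ ⊂ B(y′)`,
`|μ| ≤ B`, `y, y′ ∈ Ω^{(k)}` common top blocks (p38's (2.136)₂ majorant of `∇G` as the outer factor, §1's general engine).
[cite: Balaban1985BackgroundPropagators, Thm 3.14 (3.153)–(3.154) pp.426–427; Balaban1984PropagatorsII, Prop. 2.6 (2.136) p.247, (2.19)–(2.22) p.226] -/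
theorem thm314_gradG_flat_V1 (d ℓ : ℕ) (hd : 1 ≤ d + 1) (hL : Odd (ℓ + 1) ∧ 1 < ℓ + 1) {b₀ b₁ : ℝ} (hb₀ : 0 < b₀) (hb₁ : b₀ ≤ b₁) :
    ∃ δ C M₀ : ℝ, ∃ N₀ : ℕ, 0 < δ ∧ 0 < C ∧ 0 < M₀ ∧ 0 < N₀ ∧
      ∀ (m K : ℕ) {Mh k R : ℕ} {P' : Fin (d + 1) → ℕ}
        (hN : ∀ μ, N0 ℓ Mh k P' μ = (PV d ℓ m K hd hL).sitesPerDir 0) (D D' : TDomains d ℓ Mh k P' R) (hk : k ≤ m + K),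
        1 ≤ k → ∀ {a : ℕ}, Mh = (ℓ + 1) ^ a → 8 ≤ Mh → 2 * (ℓ + 1) ^ 2 ≤ R → (∀ μ, 5 * (ℓ + 1) ≤ P' μ) → 4 ≤ ℓ →
        M₀ ≤ ((ℓ : ℝ) + 1) * Mh → N₀ + 1 ≤ R * ((ℓ + 1) * Mh) →
        ∀ {cf : ℝ} (hcf : cf ≠ 0) {w : BondIdx (domT hN D hk) → ℝ} (hw : ∀ i, 0 < w i)
          {w' : BondIdx (domT hN D' hk) → ℝ} (hw' : ∀ i', 0 < w' i'),
        GlobalBand b₀ b₁ cf w → GlobalBand b₀ b₁ cf w' →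
        (∀ (i : BondIdx (domT hN D hk)) (i' : BondIdx (domT hN D' hk)), i.1 = i'.1 → w i = w' i') →
        ∀ (y : ↥(bset D.toDomains)) (hyD' : y.1 ∈ bset D'.toDomains) (y' : ↥(bset D'.toDomains)) (hy'D : y'.1 ∈ bset D.toDomains),
        y.1.1 = k → y'.1.1 = k →
        ∀ (μ : PBond (PV d ℓ m K hd hL) 0 → ℝ) (B : ℝ), BlockSupp (g := geomT D') (blkV1 hN D') μ y' B →
        ∀ (ν : Fin (d + 1)) (x : PBond (PV d ℓ m K hd hL) 0), blkV1 hN D x = y →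
          |(DV ν cf ∘ₗ onFun (GE (domT hN D hk) hcf hw)) μ x - (DV ν cf ∘ₗ onFun (GE (domT hN D' hk) hcf hw')) μ x|
            ≤ C * ((geomT D).len y * |cf|⁻¹ * B)
              * Real.exp (-(δ * min ((geomT D).dist y ⟨y'.1, hy'D⟩) ((geomT D').dist ⟨y.1, hyD'⟩ y')))
              * Real.exp (-(δ * dOmega D D' y.1.2 y'.1.2)) := by
  have hℓ : 1 ≤ ℓ := by have := hL.2; omega
  have hL1 : (1 : ℝ) ≤ (ℓ : ℝ) + 1 := by linarith [(Nat.cast_nonneg ℓ : (0 : ℝ) ≤ ℓ)]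
  -- (2.136)₁ for `G = Δ_a⁻¹` (p38), at `α = ½`, `σ = σ₁`
  obtain ⟨σ₁, hσ₁, hT1⟩ := prop26_2136_grad_kLevel_unconditional_pad_V1 d ℓ hd hL hb₀ hb₁
  obtain ⟨A, M₂, hA, hM₂, hG1⟩ := hT1 σ₁ hσ₁ le_rfl (1 / 2) (by norm_num) (by norm_num)
  have hδG0 : 0 < delta3 (1 / 2) (2 * σ₁) := delta3_pos (by norm_num) (by linarith)
  -- the two-family (3.49)₄ difference (gen 19) and the one-family (3.49)₄ (FILE 1) at the printed weights
  have hL2 : (1 : ℝ) < (((ℓ : ℝ) + 1)) ^ 2 := by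
    have : (2 : ℝ) ≤ (ℓ : ℝ) + 1 := by
      have : (1 : ℝ) ≤ ℓ := by exact_mod_cast hℓ
      linarith
    nlinarith
  have hamin : 0 < 1 - ((((ℓ : ℝ) + 1)) ^ 2)⁻¹ := by rw [sub_pos]; exact inv_lt_one_of_one_lt₀ hL2
  obtain ⟨hwin, hrec⟩ := B6Prop22KLevelCensus.KIdx.aPrinted_windows hℓ
  obtain ⟨δ₅, C₅, M₅, N₅, hδ₅, hC₅, hM₅, hN₅, h5⟩ :=
    thm314_P_flat_multiLevelTorus d ℓ hℓ (1 - ((((ℓ : ℝ) + 1)) ^ 2)⁻¹) 1 1 1 hamin one_pos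
  obtain ⟨ρ, BP, MP, NP, hρ, hBP, hMP, hNP, hPk⟩ := dPd_le d ℓ hℓ
  -- the common rate and the thresholds of (2.60)/(2.61)
  obtain ⟨δ, hδ0, hδG, hδ5, hδρ⟩ : ∃ δ : ℝ, 0 < δ ∧ δ ≤ delta3 (1 / 2) (2 * σ₁) ∧ δ ≤ δ₅ ∧ δ ≤ ρ :=
    ⟨min (delta3 (1 / 2) (2 * σ₁)) (min δ₅ ρ), lt_min hδG0 (lt_min hδ₅ hρ), min_le_left _ _,
      (min_le_right _ _).trans (min_le_left _ _), (min_le_right _ _).trans (min_le_right _ _)⟩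
  obtain ⟨Nc, c, hNc, hc, hcon⟩ := consts_260_261 d ℓ hδ0
  have hb₁0 : 0 ≤ b₁ := hb₀.le.trans hb₁
  refine ⟨δ / 4, (Real.sqrt (2 * A) * Real.sqrt ((((d : ℝ) + 1) * c * (C₅ + BP * Real.exp (2 * δ) * (1 + ((ℓ : ℝ) + 1) ^ 2)) + 2 * b₁ * Real.exp (5 / 2 * δ) * (1 + ((ℓ : ℝ) + 1) ^ 2)) * ((ℓ : ℝ) + 1) ^ 2 * c * (A * A)) + 1), max M₂ (max M₅ MP), max Nc (max N₅ NP), by positivity, by positivity, lt_max_of_lt_left hM₂,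
    lt_max_of_lt_left hNc, ?_⟩
  intro m K Mh k R P' hN D D' hk hk1 a hMha hM8 hR2 hP5 hℓ4 hM hRN cf hcf w hw w' hw' hwb hwb' hww y hyD' y' hy'D hy hy' μ B hμ ν x hx
  -- sizes
  have hMh1 : 1 ≤ Mh := by omega
  have hMh3 : 3 ≤ Mh := by omega
  have hP1 : ∀ μ, 1 ≤ P' μ := fun μ => le_trans (by omega) (hP5 μ)
  have hP4 : ∀ μ, 4 ≤ P' μ := fun μ => le_trans (by omega) (hP5 μ)
  have hR2' : 2 * (ℓ + 1) ≤ R := le_trans (Nat.mul_le_mul_left 2 (by rw [pow_two]; exact Nat.le_mul_self _)) hR2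
  have hRM1 : 1 ≤ R * ((ℓ + 1) * Mh) := le_trans (Nat.le_add_left 1 _) hRN
  have hM2' : M₂ ≤ ((ℓ : ℝ) + 1) * Mh := (le_max_left _ _).trans hM
  have hM5' : M₅ ≤ ((ℓ : ℝ) + 1) * Mh := ((le_max_left _ _).trans (le_max_right _ _)).trans hM
  have hMP' : MP ≤ ((ℓ : ℝ) + 1) * Mh := ((le_max_right _ _).trans (le_max_right _ _)).trans hM
  have hNc' : Nc + 1 ≤ R * ((ℓ + 1) * Mh) := le_trans (Nat.succ_le_succ (le_max_left _ _)) hRN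
  have hN5' : N₅ + 1 ≤ R * ((ℓ + 1) * Mh) := le_trans (Nat.succ_le_succ ((le_max_left _ _).trans (le_max_right _ _))) hRN
  have hNP' : NP + 1 ≤ R * ((ℓ + 1) * Mh) := le_trans (Nat.succ_le_succ ((le_max_right _ _).trans (le_max_right _ _))) hRN
  obtain ⟨hthr, h261⟩ := hcon k Mh R P' hMh1 hP1 hNc'
  have hd0 : ∀ s t : ↥(bset D.toDomains), 0 ≤ (geomT D).dist s t := (triangle_refl_nonneg_T D hMh1 hP1).2.2
  have hd0' : ∀ s t : ↥(bset D'.toDomains), 0 ≤ (geomT D').dist s t := (triangle_refl_nonneg_T D' hMh1 hP1).2.2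
  -- the (2.136)₁ majorants of the two operators at the common rate
  have hT1D := hG1 m K hN D hk hk1 hMha hM8 hR2 hP5 hℓ4 hM2' hcf hw hwb
  have hT1D' := hG1 m K hN D' hk hk1 hMha hM8 hR2 hP5 hℓ4 hM2' hcf hw' hwb'
  have hφ0 : ∀ a : ↥(bset D.toDomains), 0 ≤ (geomT D).len a * |cf|⁻¹ := fun a => by
    rw [B8Ineq192MultiLevelTorus.geomT_len]; positivity
  have hφ0' : ∀ a : ↥(bset D'.toDomains), 0 ≤ (geomT D').len a * |cf|⁻¹ := fun a => by
    rw [B8Ineq192MultiLevelTorus.geomT_len]; positivity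
  have hT : HasMajorant (g := geomT D) (blkV1 hN D) (DV ν cf ∘ₗ onFun (GE (domT hN D hk) hcf hw))
      (fun a b => A * ((geomT D).len a * |cf|⁻¹) * Real.exp (-(δ * (geomT D).dist a b))) :=
    hasMajorant_mono (g := geomT D) (blkV1 hN D) (hT1D.2 ν) fun a b =>
      mul_le_mul_of_nonneg_left (Real.exp_le_exp.2 (neg_le_neg (mul_le_mul_of_nonneg_right hδG (hd0 a b))))
        (mul_nonneg hA (hφ0 a))
  have hT' : HasMajorant (g := geomT D') (blkV1 hN D') (DV ν cf ∘ₗ onFun (GE (domT hN D' hk) hcf hw'))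
      (fun a b => A * ((geomT D').len a * |cf|⁻¹) * Real.exp (-(δ * (geomT D').dist a b))) :=
    hasMajorant_mono (g := geomT D') (blkV1 hN D') (hT1D'.2 ν) fun a b =>
      mul_le_mul_of_nonneg_left (Real.exp_le_exp.2 (neg_le_neg (mul_le_mul_of_nonneg_right hδG (hd0' a b))))
        (mul_nonneg hA (hφ0' a))
  have hG' : HasMajorant (g := geomT D') (blkV1 hN D') (onFun (GE (domT hN D' hk) hcf hw'))
      (fun a b => A * pref cf a * Real.exp (-(δ * (geomT D').dist a b))) :=
    hasMajorant_mono (g := geomT D') (blkV1 hN D') hT1D'.1 fun a b =>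
      mul_le_mul_of_nonneg_left (Real.exp_le_exp.2 (neg_le_neg (mul_le_mul_of_nonneg_right hδG (hd0' a b))))
        (mul_nonneg hA (pref_nonneg _ _))
  have hres : DV ν cf ∘ₗ onFun (GE (domT hN D hk) hcf hw) - DV ν cf ∘ₗ onFun (GE (domT hN D' hk) hcf hw')
      = (DV ν cf ∘ₗ onFun (GE (domT hN D hk) hcf hw)) ∘ₗ (VP hN D D' cf + VQ hN D D' hk w w') ∘ₗ onFun (GE (domT hN D' hk) hcf hw') := by
    rw [← LinearMap.comp_sub, onFun_GE_sub hN D D' hk hℓ hMh1 hP1 hcf hw hw', ← LinearMap.comp_assoc]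
  have hφ : (fun a : ↥(bset D'.toDomains) => (geomT D').len a * |cf|⁻¹) ⟨y.1, hyD'⟩ = (geomT D).len y * |cf|⁻¹ := rfl
  -- the two-family (3.49)₄ difference at the common rate
  have hΔ : ∀ (p q : ℕ × (Fin (d + 1) → ℤ)) (hpD : p ∈ bset D.toDomains) (hpD' : p ∈ bset D'.toDomains)
      (hqD : q ∈ bset D.toDomains) (hqD' : q ∈ bset D'.toDomains), p.1 = k → q.1 = k →
      ∀ (x x' : ↥(boxDom (N0 ℓ Mh k P'))), blkOf D.toDomains x = ⟨p, hpD⟩ → blkOf D.toDomains x' = ⟨q, hqD⟩ →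
      ∀ μ ν : Fin (d + 1), |dPd D μ ν x x' - dPd D' μ ν x x'|
        ≤ C₅ * ((((ℓ : ℝ) + 1) ^ k) ^ 2)⁻¹ * ((((ℓ : ℝ) + 1) ^ k) ^ (d + 1))⁻¹
          * Real.exp (-(δ * min ((geomT D).dist ⟨p, hpD⟩ ⟨q, hqD⟩) ((geomT D').dist ⟨p, hpD'⟩ ⟨q, hqD'⟩)))
          * Real.exp (-(δ * dOmega D D' p.2 q.2)) := by
    intro p q hpD hpD' hqD hqD' hp hq x₁ x₂ hx₁ hx₂ μ₁ ν₁
    obtain ⟨-, -, -, h4⟩ := h5 k Mh R hMh3 hM5' hR2' hN5' P' hP1 hP4 D D' (aPrinted ℓ 1) (fun _ => 1) hwin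
      (fun i _ => ⟨le_rfl, le_rfl⟩) hrec p q hpD hpD' hqD hqD' hp hq x₁ x₂ hx₁ hx₂
    have h := h4 μ₁ ν₁
    rw [member4_eq_dPd, member4_eq_dPd] at h
    refine h.trans ?_
    have h0 : 0 ≤ C₅ * ((((ℓ : ℝ) + 1) ^ k) ^ 2)⁻¹ * ((((ℓ : ℝ) + 1) ^ k) ^ (d + 1))⁻¹ := by positivity
    have hm0 : 0 ≤ min ((geomT D).dist ⟨p, hpD⟩ ⟨q, hqD⟩) ((geomT D').dist ⟨p, hpD'⟩ ⟨q, hqD'⟩) := le_min (hd0 _ _) (hd0' _ _)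
    have hΩ0 : 0 ≤ dOmega D D' p.2 q.2 := dOmega_nonneg D D' _ _
    have e1 : Real.exp (-(δ₅ * min ((geomT D).dist ⟨p, hpD⟩ ⟨q, hqD⟩) ((geomT D').dist ⟨p, hpD'⟩ ⟨q, hqD'⟩)))
        ≤ Real.exp (-(δ * min ((geomT D).dist ⟨p, hpD⟩ ⟨q, hqD⟩) ((geomT D').dist ⟨p, hpD'⟩ ⟨q, hqD'⟩))) :=
      Real.exp_le_exp.2 (neg_le_neg (mul_le_mul_of_nonneg_right hδ5 hm0))
    have e2 : Real.exp (-(δ₅ * dOmega D D' p.2 q.2)) ≤ Real.exp (-(δ * dOmega D D' p.2 q.2)) :=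
      Real.exp_le_exp.2 (neg_le_neg (mul_le_mul_of_nonneg_right hδ5 hΩ0))
    exact mul_le_mul (mul_le_mul_of_nonneg_left e1 h0) e2 (Real.exp_pos _).le (mul_nonneg h0 (Real.exp_pos _).le)
  -- the one-family (3.49)₄ bounds at the common rate
  have hPD : ∀ (μ ν : Fin (d + 1)) (x x' : ↥(boxDom (N0 ℓ Mh k P'))),
      |dPd D μ ν x x'| ≤ BP * ((((ℓ : ℝ) + 1) ^ D.lev x.1) ^ 2)⁻¹ * (W D.toDomains (blkOf D.toDomains x'))⁻¹ *
        Real.exp (-(δ * (geomT D).dist (blkOf D.toDomains x) (blkOf D.toDomains x'))) := by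
    intro μ₁ ν₁ x₁ x₂
    refine (hPk k Mh R hMh3 hMP' hR2' hNP' P' hP4 D μ₁ ν₁ x₁ x₂).trans ?_
    have hW0 : 0 < W D.toDomains (blkOf D.toDomains x₂) := W_pos _ _
    exact mul_le_mul_of_nonneg_left (Real.exp_le_exp.2 (neg_le_neg (mul_le_mul_of_nonneg_right hδρ (hd0 _ _)))) (by positivity)
  have hPD' : ∀ (μ ν : Fin (d + 1)) (x x' : ↥(boxDom (N0 ℓ Mh k P'))),
      |dPd D' μ ν x x'| ≤ BP * ((((ℓ : ℝ) + 1) ^ D'.lev x.1) ^ 2)⁻¹ * (W D'.toDomains (blkOf D'.toDomains x'))⁻¹ *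
        Real.exp (-(δ * (geomT D').dist (blkOf D'.toDomains x) (blkOf D'.toDomains x'))) := by
    intro μ₁ ν₁ x₁ x₂
    refine (hPk k Mh R hMh3 hMP' hR2' hNP' P' hP4 D' μ₁ ν₁ x₁ x₂).trans ?_
    have hW0 : 0 < W D'.toDomains (blkOf D'.toDomains x₂) := W_pos _ _
    exact mul_le_mul_of_nonneg_left (Real.exp_le_exp.2 (neg_le_neg (mul_le_mul_of_nonneg_right hδρ (hd0' _ _)))) (by positivity)
  -- the weights
  have hw0 : ∀ i, 0 ≤ w i := fun i => (hw i).le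
  have hw0' : ∀ i', 0 ≤ w' i' := fun i' => (hw' i').le
  have hwB := fun i => w_le_of_band hN D hk hcf hwb i
  have hwB' := fun i' => w_le_of_band hN D' hk hcf hwb' i'
  -- FILE 2's abstract theorem
  have hmain := resolvent_diff_bound_gen hN D D' hk hk1 hMh1 hP1 hRM1 hδ0.le hcf hC₅.le hBP.le hb₁0 hA hμ.nonneg hc hthr (h261 D) (h261 D')
    hΔ hPD hPD' hw0 hw0' hwB hwB' hww hA (φ := fun a => (geomT D).len a * |cf|⁻¹) (φ' := fun a => (geomT D').len a * |cf|⁻¹)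
    hφ0 hT hT' hG' hres hy hyD' hy' hy'D hφ hμ x hx
  refine hmain.trans ?_
  -- the rates `½δ`, `¼δ` weakened to `δ/4`, the constant enlarged by `1`
  have hF : 0 ≤ (geomT D).len y * |cf|⁻¹ * B := mul_nonneg (hφ0 y) hμ.nonneg
  have hm0 : 0 ≤ min ((geomT D).dist y ⟨y'.1, hy'D⟩) ((geomT D').dist ⟨y.1, hyD'⟩ y') := le_min (hd0 _ _) (hd0' _ _)
  have e1 : Real.exp (-(1 / 2 * δ * min ((geomT D).dist y ⟨y'.1, hy'D⟩) ((geomT D').dist ⟨y.1, hyD'⟩ y')))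
      ≤ Real.exp (-(δ / 4 * min ((geomT D).dist y ⟨y'.1, hy'D⟩) ((geomT D').dist ⟨y.1, hyD'⟩ y'))) :=
    Real.exp_le_exp.2 (by nlinarith [mul_nonneg hδ0.le hm0])
  have e2 : Real.exp (-(1 / 4 * δ * dOmega D D' y.1.2 y'.1.2)) = Real.exp (-(δ / 4 * dOmega D D' y.1.2 y'.1.2)) := by
    congr 1; ring
  have hK0 : 0 ≤ Real.sqrt (2 * A) * Real.sqrt ((((d : ℝ) + 1) * c * (C₅ + BP * Real.exp (2 * δ) * (1 + ((ℓ : ℝ) + 1) ^ 2)) + 2 * b₁ * Real.exp (5 / 2 * δ) * (1 + ((ℓ : ℝ) + 1) ^ 2)) * ((ℓ : ℝ) + 1) ^ 2 * c * (A * A)) :=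
    mul_nonneg (Real.sqrt_nonneg _) (Real.sqrt_nonneg _)
  have hK1 : Real.sqrt (2 * A) * Real.sqrt ((((d : ℝ) + 1) * c * (C₅ + BP * Real.exp (2 * δ) * (1 + ((ℓ : ℝ) + 1) ^ 2)) + 2 * b₁ * Real.exp (5 / 2 * δ) * (1 + ((ℓ : ℝ) + 1) ^ 2)) * ((ℓ : ℝ) + 1) ^ 2 * c * (A * A)) ≤ (Real.sqrt (2 * A) * Real.sqrt ((((d : ℝ) + 1) * c * (C₅ + BP * Real.exp (2 * δ) * (1 + ((ℓ : ℝ) + 1) ^ 2)) + 2 * b₁ * Real.exp (5 / 2 * δ) * (1 + ((ℓ : ℝ) + 1) ^ 2)) * ((ℓ : ℝ) + 1) ^ 2 * c * (A * A)) + 1) := le_add_of_nonneg_right zero_le_one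
  rw [e2]
  exact mul_le_mul (mul_le_mul (mul_le_mul_of_nonneg_right hK1 hF) e1 (Real.exp_pos _).le
    (mul_nonneg (hK0.trans hK1) hF)) le_rfl (Real.exp_pos _).le
    (mul_nonneg (mul_nonneg (hK0.trans hK1) hF) (Real.exp_pos _).le)

end Literature.MathematicalPhysics.QuantumFieldTheory.Balaban1983to89.B9Thm314GFlatV1Transfer

end
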